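import Mathlib
import Literature.AlgebraicGeometry.CossartPiltant200819.Thm15FrameSHE2019
import Literature.AlgebraicGeometry.Resolution.LocalBlowup
import Literature.AlgebraicGeometry.Resolution.ExcellentRings
import Literature.AlgebraicGeometry.Resolution.ExcellentRingsEssFiniteType
import Literature.AlgebraicGeometry.Resolution.ExcellentRingsFieldProofs
import Literature.AlgebraicGeometry.Resolution.OriginLocalRing
import Literature.AlgebraicGeometry.Resolution.RegularCentreRsopPart
import Summits.ResolutionOfSingularities.ResolutionOfSingularities.Theorems.WeightedInvariantDescentPerfectToAllKummerCriterion
import HarnessLib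

/-!
# `¬ F-110` — refutation of `CossartPiltant2019_thm_1_5_i_frame` (the `ord_𝔪` line; rev 7, sorry-free)

**rev 8 (2026-08-28T23:2xZ)**: same mathematics as rev 7 (sorry-free `¬F-110`); every declaration now carries a
docstring, all 49 linter warnings (deprecated names, unused simp arguments / binders) are fixed, `fact_prime_five`
is a private instance and `algebraSK` a reducible def with a local-instance attribute — i.e. the text is byte-for-byte
the body of the Theorems landing kit `CossartPiltant2019Thm15iFrameFalse{Part1…Part9,}.lean` (10 chained modules,
≤ 400 lines each, farm rc 0 / 0 sorries / 0 warnings; part 1 gate dry-run → QUEUED, no lint codes) published in the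
seat's home `run/shared/lean/pub/res-hironaka/B/res-B-lens-6/landing-g4/` for res-B-lead-1 / the keeper to file.


Crux workfile for `stmt-ResolutionOfSingularities-0549` (`Theses.Descent.DescentPerfectToAll`),
unit `res-B-lens-6` g4 (lens «negation at crux level»).  TARGET of this line is NOT the crux but the
typed negative statement `NegationLens6g3.F110False = ¬ CossartPiltant2019_thm_1_5_i_frame.{0}` (restated here as `F110False`)
(the L5 / 15917 consumer stub `stub_cp2019Thm15iFrame`, confirmed false-as-typed by res-B-crit-1 and
res-inputs-crit-1 R190 on 2026-08-28; a landed `theorem … : ¬ CossartPiltant2019_thm_1_5_i_frame.{0}`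
is the owed item (ii) of R190).  Nothing here bears on resolution in characteristic `p`, which is NOT
proved; `[OURS · CANDIDATE] counted 0`.

WITNESS (res-inputs-crit-1 R190 §2 «divisorial», credited; lens-6 g3's golden composite valuation is the
alternative for the full field `K^p(f)`):  `p = 5`, `S = 𝔽₅[x,y,w]_{(x,y,w)}`, `f = x²y`,
`K = Frac S` realised as `k'(X)` with `k' = 𝔽₅(y₁,w₁)` via `x ↦ X, y ↦ X·y₁, w ↦ X·w₁` (so that
`ν := ord_𝔪 =` the `X`-adic valuation and `O = k'[X]_{(X)}` is Mathlib-native), `μ` = the unique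
extension of `ν` to `K(f^{1/5})`.  Along ANY `F-110` tower the base rings stay in the three-element set
`{S, S[v/u]_{𝔪_S S[v/u]} =: B♯(u,v), O}` (`TowerRing`), every regular parameter of each of them has
`ν`-value `1`, while every point of the affine `K⁵`-line `C⁵f + D⁵ (C ≠ 0)` has `ν`-value in
`5ℤ ∪ (5ℤ+3)`; a regular `AdjoinRoot (X⁵ - g)` over a regular local `B ∋ g` forces (after the
Frobenius translation `X ↦ X + e` in the unit case) a point of the line to be a regular parameter of
`B` — contradiction.

SHAPE (rev 7 — SORRY-FREE; `lean check` rc 0, sorries 0; `#print axioms`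
of `CossartPiltant2019_thm_1_5_i_frame_false` = {propext, Classical.choice, Quot.sound}; the farm
message of the `#print axioms` command at the end of the file is the record).  The end products are
`f110False : F110False` and `CossartPiltant2019_thm_1_5_i_frame_false : ¬ CossartPiltant2019_thm_1_5_i_frame.{0}`
— UNCONDITIONAL (no excellence / Abhyankar / F-112 hypothesis, no named-fact hypothesis anywhere).
Main pieces, all proved IN-FILE:
* the witness data and EVERY STRUCTURAL hypothesis of F-110 at it — `witness_W : IsFractionRing S K`,
  `IsExcellentRing S` (tree: `isExcellentRing_localization_atPrime` + `isExcellentRing_of_field`),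
  `IsRegularLocalRing S`, `ringKrullDim S = 3` (tree `Resolution.OriginLocalization`), `CharP S 5`,
  `S ≤ O` (`range_le_O`), domination (`dominates`), `∀ c, c⁵ ≠ f`;
* `lineValues : L` (`ν(C⁵f + D⁵) ∈ 5ℤ ∪ (5ℤ+3)`), `adjoinRoot_of_kummerCriterion : AStmt` (one line from
  the LANDED `Theorems.stub_kummerCriterion`, p104053);
* `RingFacts S` completely: `regularPrimes_base` (ideals of `S` with regular quotient = principal /
  a regular curve through a frame / the closed point — Matsumura 14.2 via the tree's
  `exists_isRsopPart_span_range_eq`, transported along `toBase : S ≃ baseRing`), `paramVal_base`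
  (`ν = ord_𝔪` on `S`), `unitRes_base` (`κ(S) = 𝔽₅` perfect), and the three CHART LEMMAS
  `eq_of_isLocalBlowupAlong_span_singleton` (divisor centre: no change), `eq_O_of_isLocalBlowupAlong` /
  `eq_O_of_point` (closed point: the chart is `O`), `curveChart` (regular curve `(u, v)`: the chart is
  `B♯(u₀, v)` for a new frame `(u₀, v, t)`);
* `RingFacts O` completely (`topRing`: DVR case); for `B♯ = S[v/u]_{𝔪_S S[v/u]}`:
  `maximalIdeal_sharpRing` (`= (u, t)`), `ringKrullDim_sharp_le` (`dim B♯ ≤ 2`, from the BINARY-FORMS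
  key estimate `coeff_mem_maximalIdeal_of_vX_lt_one` — `u^n·P(v/u)` is a form of degree `n` in the
  regular system of parameters `(u, v, t)` and `ν` detects the `𝔪_S`-adic order, `mem_pow_of_vX_le`),
  the prime classification `regularPrimes_sharp`, `paramVal_sharp` (`ν = ord` on `B♯`, TERNARY-FORMS
  estimate `vX_cu_add_dt`), `unitRes_sharp` (fifth roots in `B♯`: Frobenius lift via
  `map_frobenius_expand` + `fifthPower_coeff_of` + `const_fifthPower_of_LI5` + `LI5`), and the
  reductions `stepClosed_sharp_of`, `ringFacts_sharp`;
* the residue-field kernel: `FL` (generic field lemma in characteristic `5`: `a ∉ F^5 ⇒ 1, a, …, a⁴`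
  independent over `F^5`, via `minpoly` over `(frobenius F 5).fieldRange`), `LI5_of`/`LI5` (through
  `IsLocalRing.ResidueField O`, `charP_κO`), and **`T5`** (`v/u` is NOT a fifth power modulo `𝔪_ν` for
  any frame `(u, v, t)`): clear denominators from `K = k'(X)` down to `A₂ = 𝔽₅[y₁, w₁]`
  (`vX_denom_eq_one`, `RatFunc.num_div_denom`, `IsFractionRing.div_surjective`) to an identity
  `Λ_v·G⁵ = Λ_u·H⁵` (`G ≠ 0`) between the LINEAR PARTS `Λ_u, Λ_v` (`Lj`, `L1_eq`) of numerators of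
  `u, v`; the DERIVATIVE TRICK (`MvPolynomial.pderiv` kills fifth powers in characteristic `5`,
  `pderiv_fifth`, `cross_of_identity`) gives `Λ_v ∂ᵢΛ_u = Λ_u ∂ᵢΛ_v`, hence an `𝔽₅`-dependence of
  `Λ_u, Λ_v` (`relation_of_cross`), contradicting the independence of the linear parts of two members
  of a regular system of parameters (`linearParts_independent`, from `coeff_mem_maximalIdeal_of_eval_mem_pow`);
* the composition `f110False_of : W → L → AStmt → RingFacts S → (∀ frames, RingFacts B♯) → RingFacts O →
  F110False`.
CONSEQUENCE: the owed tree theorem is UNCONDITIONAL, `theorem CossartPiltant2019_thm_1_5_i_frame_false :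
¬ CossartPiltant2019_thm_1_5_i_frame.{0}` (correcting the `_false_of_excellent` shape of
res-inputs-crit-1 R192/R193: excellence of `𝔽₅[x,y,w]_{(x,y,w)}` is a tree theorem; Abhyankar 1956 is not
needed on the `ord_𝔪` line).  STATUS: proved in this crux workfile (farm-elaborated); NOT yet landed under
`Theorems/` or as Literature errata — landing is a prover/keeper action (file is ready verbatim, minus the
`#print axioms` command if the Theorems lint objects).
-/

set_option linter.dupNamespace false

open Literature.AlgebraicGeometry.Resolution
open Literature.AlgebraicGeometry.CossartPiltant200819

noncomputable section

namespace Summit.ResolutionOfSingularities.ResolutionOfSingularities.Cruxes.DescentPerfectToAll.NotF110OrdM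


/-- The negation target, VERBATIM the body of `NegationLens6g3.F110False` (lens-6 g3,
`Cruxes/DescentPerfectToAll/NegationLens6g3.lean`; not imported because crux workfiles are not built
as library modules on the farm — with both files in one session `example : F110False =
NegationLens6g3.F110False := rfl`). [OURS · auxiliary statement of this proof, proved/consumed in this file; folklore] -/
def F110False : Prop := ¬ CossartPiltant2019_thm_1_5_i_frame.{0}

/-! ## The witness -/

/-- `5` is prime, as a `Fact` instance (private, as in the tree's other `ZMod 5` computations). [folklore] -/
private instance fact_prime_five : Fact (Nat.Prime 5) := ⟨Nat.prime_five⟩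

/-- `𝔽₅`. -/
abbrev k₀ : Type := ZMod 5
/-- `𝔽₅[y₁, w₁]`. -/
abbrev A₂ : Type := MvPolynomial (Fin 2) k₀
/-- `k' = 𝔽₅(y₁, w₁)` — the residue field of `O`. -/
abbrev kp : Type := FractionRing A₂
/-- `K = k'(X)`. -/
abbrev K : Type := RatFunc kp
/-- `𝔽₅[x, y, w]`. -/
abbrev A : Type := MvPolynomial (Fin 3) k₀

/-- `𝔪₀ = (x, y, w)`, the kernel of `f ↦ f(0)` (tree: `Resolution.originIdeal`, maximal). -/
abbrev m0 : Ideal A := originIdeal k₀ 3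

/-- `S = 𝔽₅[x,y,w]_{(x,y,w)}` (tree: `Resolution.OriginLocalization` — regular local, `dim = 3`, both PROVED there). -/
abbrev S : Type := OriginLocalization k₀ 3

example : S = Localization.AtPrime m0 := rfl

/-- `y₁, w₁ ∈ k'`. -/
def y₁ : kp := algebraMap A₂ kp (MvPolynomial.X 0)
/-- The second residual coordinate `w₁ ∈ k' = Frac 𝔽₅[y₁, w₁]`. -/
def w₁ : kp := algebraMap A₂ kp (MvPolynomial.X 1)

/-- The substitution `x ↦ X, y ↦ X·y₁, w ↦ X·w₁` into `k'[X]`. -/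
def gens : Fin 3 → Polynomial kp :=
  ![Polynomial.X, Polynomial.X * Polynomial.C y₁, Polynomial.X * Polynomial.C w₁]

/-- `ψ₀ : 𝔽₅[x,y,w] → k'[X]`. -/
def ι : k₀ →+* Polynomial kp :=
  (Polynomial.C : kp →+* Polynomial kp).comp ((algebraMap A₂ kp).comp (MvPolynomial.C : k₀ →+* A₂))

/-- The substitution `x ↦ X, y ↦ X·y₁, w ↦ X·w₁`: `A = 𝔽₅[x,y,w] → k'[X]`. -/
def ψ₀ : A →+* Polynomial kp :=
  MvPolynomial.eval₂Hom ι gens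

/-- `ψ : 𝔽₅[x,y,w] → K = k'(X)`. -/
def ψ : A →+* K := (algebraMap (Polynomial kp) K).comp ψ₀

/-- Evaluating `ψ₀ a` at `X = 0` gives the constant term of `a`. -/
theorem eval_zero_ψ₀ (a : A) :
    Polynomial.eval 0 (ψ₀ a) = algebraMap A₂ kp (MvPolynomial.C (MvPolynomial.constantCoeff a)) := by
  have h : ((Polynomial.evalRingHom (0 : kp)).comp ψ₀) =
      ((algebraMap A₂ kp).comp MvPolynomial.C).comp (MvPolynomial.constantCoeff) := by
    apply MvPolynomial.ringHom_ext
    · intro r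
      simp [ψ₀, ι]
    · intro i
      fin_cases i <;> simp [ψ₀, ι, gens]
  exact congrArg (fun φ : A →+* kp => φ a) h

/-- `ψ a ≠ 0` for `a ∉ 𝔪₀ = (x, y, w)` (its constant term survives). -/
theorem ψ_ne_zero_of_not_mem {a : A} (ha : a ∉ m0) : ψ a ≠ 0 := by
  intro h
  have h0 : ψ₀ a = 0 := by
    have hinj : Function.Injective (algebraMap (Polynomial kp) K) :=
      RatFunc.algebraMap_injective kp
    apply hinj
    rw [map_zero]
    exact h
  have h1 := eval_zero_ψ₀ a
  rw [h0, Polynomial.eval_zero] at h1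
  have h2 : MvPolynomial.constantCoeff a = 0 := by
    have hinj : Function.Injective ((algebraMap A₂ kp).comp (MvPolynomial.C : k₀ →+* A₂)) :=
      (IsFractionRing.injective A₂ kp).comp (MvPolynomial.C_injective (Fin 2) k₀)
    apply hinj
    simpa using h1.symm
  exact ha ((mem_originIdeal_iff k₀ 3).mpr h2)

/-- Elements of `A ∖ 𝔪₀` become units in `K`. -/
theorem isUnit_ψ (y : m0.primeCompl) : IsUnit (ψ y) :=
  isUnit_iff_ne_zero.mpr (ψ_ne_zero_of_not_mem y.2)

/-- `K` as an `S`-algebra: `S = A_{𝔪₀} → K` is the localisation lift of `ψ`. -/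
@[reducible] def algebraSK : Algebra S K := (IsLocalization.lift (M := m0.primeCompl) (S := S) isUnit_ψ).toAlgebra

attribute [local instance] algebraSK

/-- `algebraMap S K` is the localisation lift of `ψ` (by definition). -/
theorem algebraMap_SK_eq : algebraMap S K = IsLocalization.lift (M := m0.primeCompl) (S := S) isUnit_ψ :=
  rfl

/-- `f = x²y ∈ S`. -/
def f : S := algebraMap A S (MvPolynomial.X 0 ^ 2 * MvPolynomial.X 1)

/-- `f` in `K`: `X³·y₁`. -/
theorem algebraMap_f : algebraMap S K f = ψ (MvPolynomial.X 0 ^ 2 * MvPolynomial.X 1) := by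
  rw [algebraMap_SK_eq, f]
  exact IsLocalization.lift_eq (M := m0.primeCompl) isUnit_ψ _

/-- `O = k'[X]_{(X)}`, the valuation ring of `ν = ord_X` (= `ord_𝔪` on `S`). -/
def O : ValuationSubring K :=
  Valuation.valuationSubring
    (IsDedekindDomain.HeightOneSpectrum.valuation (RatFunc kp) (Polynomial.idealX kp))

/-! ## `O`-values of elements of `S` (proved) -/

/-- The `X`-adic valuation on `K = k'(X)` (its valuation ring is `O`). -/
abbrev vX : Valuation K (WithZero (Multiplicative ℤ)) :=
  IsDedekindDomain.HeightOneSpectrum.valuation (RatFunc kp) (Polynomial.idealX kp)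

/-- The `X`-adic valuation `vX` is equivalent to the valuation of `O = vX.valuationSubring`. -/
theorem isEquiv_O : vX.IsEquiv O.valuation := Valuation.isEquiv_valuation_valuationSubring _

/-- Membership in `O` is `vX ≤ 1`. -/
theorem mem_O_iff (x : K) : x ∈ O ↔ vX x ≤ 1 := Valuation.mem_valuationSubring_iff _ _

/-- `ψ(A) ⊆ O` (polynomials have value `≤ 1`). -/
theorem ψ_mem_O (a : A) : ψ a ∈ O :=
  (mem_O_iff _).mpr (IsDedekindDomain.HeightOneSpectrum.valuation_le_one _ _)

/-- Off `𝔪₀` the substitution has a nonzero constant term: `X`-adic value `1`. -/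
theorem vX_ψ_eq_one {b : A} (hb : b ∉ m0) : vX (ψ b) = 1 := by
  change vX (algebraMap (Polynomial kp) K (ψ₀ b)) = 1
  rw [IsDedekindDomain.HeightOneSpectrum.valuation_of_algebraMap,
    IsDedekindDomain.HeightOneSpectrum.intValuation_eq_one_iff, Polynomial.idealX_span,
    Ideal.mem_span_singleton, Polynomial.X_dvd_iff, Polynomial.coeff_zero_eq_eval_zero, eval_zero_ψ₀]
  intro h
  apply hb
  have hinj : Function.Injective ((algebraMap A₂ kp).comp (MvPolynomial.C : k₀ →+* A₂)) :=
    (IsFractionRing.injective A₂ kp).comp (MvPolynomial.C_injective (Fin 2) k₀)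
  have h2 : MvPolynomial.constantCoeff b = 0 := hinj (by simpa using h)
  exact (mem_originIdeal_iff k₀ 3).mpr h2

/-- On `𝔪₀` the substitution is divisible by `X`: `X`-adic value `< 1`. -/
theorem vX_ψ_lt_one {a : A} (ha : a ∈ m0) : vX (ψ a) < 1 := by
  change vX (algebraMap (Polynomial kp) K (ψ₀ a)) < 1
  rw [IsDedekindDomain.HeightOneSpectrum.valuation_of_algebraMap,
    IsDedekindDomain.HeightOneSpectrum.intValuation_lt_one_iff_mem, Polynomial.idealX_span,
    Ideal.mem_span_singleton, Polynomial.X_dvd_iff, Polynomial.coeff_zero_eq_eval_zero, eval_zero_ψ₀]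
  have : MvPolynomial.constantCoeff a = 0 := (mem_originIdeal_iff k₀ 3).mp ha
  rw [this]
  simp

/-- `S → K` on fractions: `a/b ↦ ψ a / ψ b`. -/
theorem algebraMap_mk' (x : A) (y : m0.primeCompl) :
    algebraMap S K (IsLocalization.mk' S x y) = ψ x / ψ y := by
  rw [algebraMap_SK_eq]
  have hy : ψ y ≠ 0 := ψ_ne_zero_of_not_mem y.2
  exact (IsLocalization.lift_mk'_spec (M := m0.primeCompl) isUnit_ψ x (ψ x / ψ y) y).mpr
    (by field_simp)

/-- `S ≤ O` inside `K`. -/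
theorem range_le_O : (algebraMap S K).range ≤ O.toSubring := by
  rintro _ ⟨s, rfl⟩
  obtain ⟨⟨x, y⟩, hxy⟩ := IsLocalization.mk'_surjective m0.primeCompl s
  change IsLocalization.mk' S x y = s at hxy
  rw [← hxy, algebraMap_mk']
  change ψ x / ψ y ∈ O
  rw [mem_O_iff, map_div₀, vX_ψ_eq_one y.2, div_one]
  exact (mem_O_iff _).mp (ψ_mem_O x)

/-- `O` dominates `S`: `𝔪_S` has positive `ν`-value. -/
theorem dominates : ∀ s ∈ IsLocalRing.maximalIdeal S, O.valuation (algebraMap S K s) < 1 := by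
  intro s hs
  obtain ⟨⟨x, y⟩, hxy⟩ := IsLocalization.mk'_surjective m0.primeCompl s
  change IsLocalization.mk' S x y = s at hxy
  subst hxy
  have hx : x ∈ m0 := (IsLocalization.AtPrime.mk'_mem_maximal_iff S m0 x y).mp hs
  rw [algebraMap_mk', ← isEquiv_O.lt_one_iff_lt_one, map_div₀, vX_ψ_eq_one y.2, div_one]
  exact vX_ψ_lt_one hx

/-! ## (W, part 1 — proved) `ψ` is injective

The chart substitution factors as `A --θ--> A ≅ A₂[X] --map--> k'[X]` with `θ : x ↦ x, y ↦ xy, w ↦ xw`;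
`θ` sends the monomial with exponent `e` to the monomial with exponent `ιe e`, and `ιe` is injective. -/

/-- `θ : 𝔽₅[x,y,w] → 𝔽₅[x,y,w]`, `x ↦ x, y ↦ x·y, w ↦ x·w`. -/
def θ : A →+* A :=
  MvPolynomial.eval₂Hom MvPolynomial.C
    ![MvPolynomial.X 0, MvPolynomial.X 0 * MvPolynomial.X 1, MvPolynomial.X 0 * MvPolynomial.X 2]

/-- The effect of `θ` on exponents. -/
def ιe (e : Fin 3 →₀ ℕ) : Fin 3 →₀ ℕ := e + Finsupp.single 0 (e 1 + e 2)

/-- Component `0` of the exponent shear `ιe e = e + (e₁ + e₂)·δ₀`. -/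
theorem ιe_apply_zero (e : Fin 3 →₀ ℕ) : ιe e 0 = e 0 + (e 1 + e 2) := by simp [ιe]
/-- Component `1` of the exponent shear `ιe` is unchanged. -/
theorem ιe_apply_one (e : Fin 3 →₀ ℕ) : ιe e 1 = e 1 := by simp [ιe]
/-- Component `2` of the exponent shear `ιe` is unchanged. -/
theorem ιe_apply_two (e : Fin 3 →₀ ℕ) : ιe e 2 = e 2 := by simp [ιe]

/-- The exponent shear `ιe` is injective. -/
theorem ιe_injective : Function.Injective ιe := by
  intro e e' h
  have h1 : e 1 = e' 1 := by rw [← ιe_apply_one e, ← ιe_apply_one e', h]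
  have h2 : e 2 = e' 2 := by rw [← ιe_apply_two e, ← ιe_apply_two e', h]
  have h0 : e 0 = e' 0 := by
    have := ιe_apply_zero e
    rw [h, ιe_apply_zero e', h1, h2] at this
    omega
  ext i
  fin_cases i
  · exact h0
  · exact h1
  · exact h2

/-- `θ` maps the monomial `x^e` to `x^{ιe e}` (same coefficient). -/
theorem θ_monomial (e : Fin 3 →₀ ℕ) (c : k₀) :
    θ (MvPolynomial.monomial e c) = MvPolynomial.monomial (ιe e) c := by
  rw [θ, MvPolynomial.eval₂Hom_monomial, Finsupp.prod_fintype _ _ (by simp), Fin.prod_univ_three,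
    MvPolynomial.monomial_eq, Finsupp.prod_fintype _ _ (by simp), Fin.prod_univ_three,
    ιe_apply_zero, ιe_apply_one, ιe_apply_two]
  simp only [Matrix.cons_val_zero, Matrix.cons_val_one, Matrix.cons_val_two, Matrix.head_cons,
    Matrix.tail_cons]
  ring

/-- Coefficients of `θ a` at sheared exponents are the coefficients of `a`. -/
theorem coeff_θ (e : Fin 3 →₀ ℕ) (a : A) : MvPolynomial.coeff (ιe e) (θ a) = MvPolynomial.coeff e a := by
  induction a using MvPolynomial.induction_on' with
  | monomial u c =>
    rw [θ_monomial, MvPolynomial.coeff_monomial, MvPolynomial.coeff_monomial]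
    by_cases hu : u = e
    · subst hu; simp
    · rw [if_neg (fun h => hu (ιe_injective h)), if_neg hu]
  | add p q hp hq => rw [map_add, MvPolynomial.coeff_add, MvPolynomial.coeff_add, hp, hq]

/-- `θ : A → A` (`x ↦ x, y ↦ xy, w ↦ xw`) is injective. -/
theorem θ_injective : Function.Injective θ := by
  rw [injective_iff_map_eq_zero]
  intro a ha
  ext e
  rw [← coeff_θ, ha, MvPolynomial.coeff_zero, MvPolynomial.coeff_zero]

/-- `ψ₀ = map (A₂ → k') ∘ (A ≅ A₂[X]) ∘ θ`. -/
theorem ψ₀_eq : ψ₀ = (Polynomial.mapRingHom (algebraMap A₂ kp)).comp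
    ((MvPolynomial.finSuccEquiv k₀ 2 : A →+* Polynomial A₂).comp θ) := by
  apply MvPolynomial.ringHom_ext
  · intro r
    simp [ψ₀, ι, θ, MvPolynomial.finSuccEquiv_apply]
  · intro i
    refine Fin.cases ?_ (fun j => ?_) i
    · simp [ψ₀, gens, θ, MvPolynomial.finSuccEquiv_X_zero]
    · have h1 : θ (MvPolynomial.X (Fin.succ j)) = MvPolynomial.X 0 * MvPolynomial.X (Fin.succ j) := by
        fin_cases j <;> simp [θ]
      have h2 : ψ₀ (MvPolynomial.X (Fin.succ j)) =
          Polynomial.X * Polynomial.C (algebraMap A₂ kp (MvPolynomial.X j)) := by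
        fin_cases j <;> simp [ψ₀, gens, y₁, w₁]
      rw [h2, RingHom.comp_apply, RingHom.comp_apply, h1, map_mul, RingHom.coe_coe,
        MvPolynomial.finSuccEquiv_X_zero, MvPolynomial.finSuccEquiv_X_succ, Polynomial.coe_mapRingHom,
        Polynomial.map_mul, Polynomial.map_X, Polynomial.map_C]

/-- `ψ₀ : A → k'[X]` is injective. -/
theorem ψ₀_injective : Function.Injective ψ₀ := by
  rw [ψ₀_eq]
  exact (Polynomial.map_injective (algebraMap A₂ kp) (IsFractionRing.injective A₂ kp)).comp
    ((MvPolynomial.finSuccEquiv k₀ 2).injective.comp θ_injective)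

/-- `ψ : A → K` is injective. -/
theorem ψ_injective : Function.Injective ψ := (RatFunc.algebraMap_injective kp).comp ψ₀_injective

/-- `S → K` is injective. -/
theorem algebraMap_SK_injective : Function.Injective (algebraMap S K) := by
  rw [injective_iff_map_eq_zero]
  intro s hs
  obtain ⟨⟨a, b⟩, hab⟩ := IsLocalization.mk'_surjective m0.primeCompl s
  change IsLocalization.mk' S a b = s at hab
  subst hab
  rw [algebraMap_mk', div_eq_zero_iff] at hs
  rcases hs with h | h
  · have : a = 0 := ψ_injective (by rw [h, map_zero])
    subst this
    exact IsLocalization.mk'_zero _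
  · exact absurd h (ψ_ne_zero_of_not_mem b.2)

/-! ## (W, part 2 — proved) every element of `K` is a fraction of `ψ`-images; `K = Frac S` -/

/-- `θ x = x`. -/
theorem θ_X0 : θ (MvPolynomial.X 0) = MvPolynomial.X 0 := by simp [θ]

/-- `θ` on the variables: `x ↦ x`, `y ↦ x·y`, `w ↦ x·w`. -/
theorem θ_X (i : Fin 3) :
    θ (MvPolynomial.X i) = MvPolynomial.X 0 ^ (if i = 0 then 0 else 1) * MvPolynomial.X i := by
  fin_cases i <;> simp [θ]

/-- `ψ₀ x = X`. -/
theorem ψ₀_X0 : ψ₀ (MvPolynomial.X 0) = Polynomial.X := by simp [ψ₀, gens]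

/-- `x^N · a ∈ θ(A)` for `N ≫ 0`. -/
theorem exists_θ_eq_X_pow_mul (a : A) : ∃ (N : ℕ) (a' : A), θ a' = MvPolynomial.X 0 ^ N * a := by
  induction a using MvPolynomial.induction_on with
  | C r => exact ⟨0, MvPolynomial.C r, by simp [θ]⟩
  | add p q hp hq =>
    obtain ⟨N₁, a₁, h₁⟩ := hp
    obtain ⟨N₂, a₂, h₂⟩ := hq
    refine ⟨N₁ + N₂, MvPolynomial.X 0 ^ N₂ * a₁ + MvPolynomial.X 0 ^ N₁ * a₂, ?_⟩
    rw [map_add, map_mul, map_mul, map_pow, map_pow, θ_X0, h₁, h₂]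
    ring
  | mul_X p i hp =>
    obtain ⟨N, a₁, h₁⟩ := hp
    exact ⟨N + (if i = 0 then 0 else 1), a₁ * MvPolynomial.X i, by rw [map_mul, h₁, θ_X]; ring⟩

/-- Every `z ∈ K = k'(X)` is `ψ a / ψ b`. -/
theorem exists_frac (z : K) : ∃ a b : A, ψ b ≠ 0 ∧ z * ψ b = ψ a := by
  have hz := RatFunc.num_div_denom z
  have hd : RatFunc.denom z ≠ 0 := RatFunc.denom_ne_zero z
  obtain ⟨bn, hbn, hn⟩ := IsLocalization.integerNormalization_spec (nonZeroDivisors A₂) (RatFunc.num z)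
  obtain ⟨bd, hbd, hdd⟩ := IsLocalization.integerNormalization_spec (nonZeroDivisors A₂) (RatFunc.denom z)
  rw [Algebra.smul_def, Polynomial.algebraMap_apply] at hn hdd
  obtain ⟨n₁, hn₁⟩ : ∃ n₁ : A, MvPolynomial.finSuccEquiv k₀ 2 n₁ =
      IsLocalization.integerNormalization (nonZeroDivisors A₂) (RatFunc.num z) :=
    ⟨_, (MvPolynomial.finSuccEquiv k₀ 2).apply_symm_apply _⟩
  obtain ⟨d₁, hd₁⟩ : ∃ d₁ : A, MvPolynomial.finSuccEquiv k₀ 2 d₁ =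
      IsLocalization.integerNormalization (nonZeroDivisors A₂) (RatFunc.denom z) :=
    ⟨_, (MvPolynomial.finSuccEquiv k₀ 2).apply_symm_apply _⟩
  obtain ⟨cn, hcn⟩ : ∃ cn : A, MvPolynomial.finSuccEquiv k₀ 2 cn = Polynomial.C bn :=
    ⟨_, (MvPolynomial.finSuccEquiv k₀ 2).apply_symm_apply _⟩
  obtain ⟨cd, hcd⟩ : ∃ cd : A, MvPolynomial.finSuccEquiv k₀ 2 cd = Polynomial.C bd :=
    ⟨_, (MvPolynomial.finSuccEquiv k₀ 2).apply_symm_apply _⟩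
  obtain ⟨N₁, a₁, ha₁⟩ := exists_θ_eq_X_pow_mul (cd * n₁)
  obtain ⟨N₂, a₂, ha₂⟩ := exists_θ_eq_X_pow_mul (cn * d₁)
  have e₁ : ψ₀ a₁ = Polynomial.X ^ N₁ * (Polynomial.C (algebraMap A₂ kp bd) *
      (Polynomial.C (algebraMap A₂ kp bn) * RatFunc.num z)) := by
    rw [ψ₀_eq, RingHom.comp_apply, RingHom.comp_apply, ha₁]
    simp only [map_mul, map_pow, RingHom.coe_coe, MvPolynomial.finSuccEquiv_X_zero, hcd, hn₁,
      Polynomial.coe_mapRingHom, Polynomial.map_X, Polynomial.map_C, hn]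
  have e₂ : ψ₀ a₂ = Polynomial.X ^ N₂ * (Polynomial.C (algebraMap A₂ kp bn) *
      (Polynomial.C (algebraMap A₂ kp bd) * RatFunc.denom z)) := by
    rw [ψ₀_eq, RingHom.comp_apply, RingHom.comp_apply, ha₂]
    simp only [map_mul, map_pow, RingHom.coe_coe, MvPolynomial.finSuccEquiv_X_zero, hcn, hd₁,
      Polynomial.coe_mapRingHom, Polynomial.map_X, Polynomial.map_C, hdd]
  have hbn' : algebraMap A₂ kp bn ≠ 0 :=
    fun h => nonZeroDivisors.ne_zero hbn (IsFractionRing.injective A₂ kp (by rw [h, map_zero]))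
  have hbd' : algebraMap A₂ kp bd ≠ 0 :=
    fun h => nonZeroDivisors.ne_zero hbd (IsFractionRing.injective A₂ kp (by rw [h, map_zero]))
  refine ⟨MvPolynomial.X 0 ^ N₂ * a₁, MvPolynomial.X 0 ^ N₁ * a₂, ?_, ?_⟩
  · change algebraMap (Polynomial kp) K (ψ₀ (MvPolynomial.X 0 ^ N₁ * a₂)) ≠ 0
    rw [map_mul, map_pow, ψ₀_X0, e₂]
    intro h
    have h' := RatFunc.algebraMap_injective kp (by rw [h, map_zero] :
      algebraMap (Polynomial kp) K _ = algebraMap (Polynomial kp) K 0)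
    simp only [mul_eq_zero, pow_eq_zero_iff', Polynomial.X_ne_zero, Polynomial.C_eq_zero, ne_eq,
      false_and, false_or] at h'
    rcases h' with h' | h' | h'
    · exact hbn' h'
    · exact hbd' h'
    · exact hd h'
  · change z * algebraMap (Polynomial kp) K (ψ₀ (MvPolynomial.X 0 ^ N₁ * a₂)) =
      algebraMap (Polynomial kp) K (ψ₀ (MvPolynomial.X 0 ^ N₂ * a₁))
    have hD : algebraMap (Polynomial kp) K (RatFunc.denom z) ≠ 0 := by
      intro h
      exact hd (RatFunc.algebraMap_injective kp (by rw [h, map_zero]))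
    simp only [map_mul, map_pow, ψ₀_X0, e₁, e₂]
    rw [(div_eq_iff hD).mp hz]
    ring

/-- (W) `K` is the fraction field of `S` (was `stub_witness` in rev 1/2). -/
theorem isFractionRing_SK : IsFractionRing S K where
  map_units y := by
    have hy : algebraMap S K y ≠ 0 := fun h =>
      nonZeroDivisors.ne_zero y.2 (algebraMap_SK_injective (by rw [h, map_zero]))
    exact isUnit_iff_ne_zero.mpr hy
  surj z := by
    obtain ⟨a, b, hb, h⟩ := exists_frac z
    have hb' : algebraMap A S b ≠ 0 := by
      intro h0
      apply hb
      have : ψ b = algebraMap S K (algebraMap A S b) := (IsLocalization.lift_eq isUnit_ψ b).symm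
      rw [this, h0, map_zero]
    refine ⟨⟨algebraMap A S a, ⟨algebraMap A S b, mem_nonZeroDivisors_of_ne_zero hb'⟩⟩, ?_⟩
    change z * algebraMap S K (algebraMap A S b) = algebraMap S K (algebraMap A S a)
    rw [algebraMap_SK_eq, IsLocalization.lift_eq, IsLocalization.lift_eq]
    exact h
  exists_of_eq {x y} h := ⟨1, by rw [algebraMap_SK_injective h]⟩

/-! ## Structural facts on `S` that the tree already proves -/

/-- `S = 𝔽₅[x,y,w]_{(x,y,w)}` is excellent (tree theorems: localisation of a finite-type algebra over a field). -/
theorem isExcellentRing_S : IsExcellentRing S :=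
  isExcellentRing_localization_atPrime (A := k₀) (B := A) (isExcellentRing_of_field k₀) m0

/-- `S` has characteristic `5`. -/
theorem charP_S : CharP S 5 :=
  charP_of_injective_algebraMap (algebraMap k₀ S).injective 5

/-- `K` has characteristic `5`. -/
theorem charP_K : CharP K 5 := by
  haveI : CharP kp 5 := charP_of_injective_algebraMap (IsFractionRing.injective A₂ kp) 5
  exact charP_of_injective_algebraMap (algebraMap kp K).injective 5

/-- `S` is a regular local ring (tree instance for `OriginLocalization`). -/
theorem isRegularLocalRing_S : IsRegularLocalRing S := inferInstance

/-- `dim S = 3` — tree theorem `Resolution.ringKrullDim_originLocalization`. -/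
theorem ringKrullDim_S : ringKrullDim S = 3 := by
  have h := ringKrullDim_originLocalization k₀ 3
  exact_mod_cast h

/-! ## The three tower rings -/

/-- `S` inside `K`, in the shape `F-110` hands it over (`B 0`). -/
def baseRing : Subring K := locAtCentre (algebraMap S K).range O

/-- `B♯(u,v) = S[v/u]_{𝔪_S S[v/u]}` — the local blowing up of `S` along the regular curve `(u, v)`
seen from `O` (centre = generic point of the fibre over the closed point). -/
def sharpRing (u v : S) : Subring K :=
  locAtCentre (Subring.closure ((baseRing : Set K) ∪ {algebraMap S K v / algebraMap S K u})) O

/-- `(u, v, t)` is a regular system of parameters of `S`. [OURS · auxiliary statement of this proof, proved/consumed in this file; folklore] -/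
def IsFrame (u v t : S) : Prop :=
  Ideal.span ({u, v, t} : Set S) = IsLocalRing.maximalIdeal S

/-- The three (families of) rings an `F-110` tower over `(S, O)` can visit. [OURS · auxiliary statement of this proof, proved/consumed in this file; folklore] -/
def TowerRing (B : Subring K) : Prop :=
  B = baseRing ∨ B = O.toSubring ∨ ∃ u v t : S, IsFrame u v t ∧ B = sharpRing u v

/-- Closedness of `TowerRing` under one local Hironaka-permissible blowing up from `B`. [OURS · auxiliary statement of this proof, proved/consumed in this file; folklore] -/
def StepClosed (B : Subring K) : Prop :=
  ∀ (B' : Subring K) (P : Ideal B), IsRegularLocalRing B → IsRegularLocalRing B' →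
    IsRegularLocalRing (B ⧸ P) → IsLocalBlowupAlong O B P B' → TowerRing B'

/-- Every regular parameter of `B` has `ν`-value `ν(X) = 1`. [OURS · auxiliary statement of this proof, proved/consumed in this file; folklore] -/
def ParamVal (B : Subring K) : Prop :=
  ∀ [IsRegularLocalRing B], ∀ z : B, z ∈ IsLocalRing.maximalIdeal B →
    z ∉ (IsLocalRing.maximalIdeal B) ^ 2 → O.valuation (z : K) = O.valuation (RatFunc.X : K)

/-- A unit of `B` whose residue is a fifth power in `κ(O)` is a fifth power in `κ(B)`
(`κ(B)` is closed under fifth roots inside `κ(O) = k'`). [OURS · auxiliary statement of this proof, proved/consumed in this file; folklore] -/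
def UnitRes (B : Subring K) : Prop :=
  ∀ g ∈ B, O.valuation g = 1 → (∃ D : K, O.valuation (g - D ^ 5) < 1) →
    ∃ e ∈ B, O.valuation (g - e ^ 5) < 1

/-- The per-ring package. [OURS · auxiliary statement of this proof, proved/consumed in this file; folklore] -/
def RingFacts (B : Subring K) : Prop := StepClosed B ∧ ParamVal B ∧ UnitRes B

/-! ## The component statements (`Prop` defs) the proof is organised around -/

/-- (W) the typed hypotheses of `F-110` hold for the witness. [OURS · auxiliary statement of this proof, proved/consumed in this file; folklore] -/
def W : Prop :=
  IsFractionRing S K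

/-- (L) valuation numerics of the affine `K⁵`-line through `f`: `f ∉ K⁵`; no point of the line has
value `ν(X)`; a point of value `0` has its `C⁵f`-part of positive value. [OURS · auxiliary statement of this proof, proved/consumed in this file; folklore] -/
def L : Prop :=
  (∀ c : K, c ^ 5 ≠ algebraMap S K f) ∧
    ∀ C D : K, C ≠ 0 →
      O.valuation (C ^ 5 * algebraMap S K f + D ^ 5) ≠ O.valuation (RatFunc.X : K) ∧
      (O.valuation (C ^ 5 * algebraMap S K f + D ^ 5) = 1 →
        O.valuation (C ^ 5 * algebraMap S K f) < 1)

/-- (A) regularity of `R[X]/(X⁵ - g)` over a regular local `R` of characteristic `5` forces the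
translated radicand `g - e⁵ ∈ 𝔪_R` out of `𝔪_R²` (embedding dimension count after `X ↦ X + e`). [OURS · auxiliary statement of this proof, proved/consumed in this file; folklore] -/
def AStmt : Prop :=
  ∀ (R : Type) [CommRing R] [IsRegularLocalRing R] [CharP R 5] (g e : R),
    g - e ^ 5 ∈ IsLocalRing.maximalIdeal R →
    IsRegularLocalRing (AdjoinRoot (Polynomial.X ^ 5 - Polynomial.C g)) →
    g - e ^ 5 ∉ (IsLocalRing.maximalIdeal R) ^ 2

/-! ## The component statements, proved -/

/-- (W) — NO LONGER A STUB: `K = Frac S` is `isFractionRing_SK` above. -/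
theorem witness_W : W := isFractionRing_SK

/-! ### (L) the line values — PROVED (was a stub in rev 1) -/

/-- `y₁ ≠ 0` in `k'`. -/
theorem y₁_ne_zero : y₁ ≠ 0 := by
  intro h
  apply MvPolynomial.X_ne_zero (R := k₀) (σ := Fin 2) 0
  exact IsFractionRing.injective A₂ kp (by rw [map_zero]; exact h)

/-- `ψ₀ (x²y) = X³·y₁`. -/
theorem ψ₀_f : ψ₀ (MvPolynomial.X 0 ^ 2 * MvPolynomial.X 1) = Polynomial.X ^ 3 * Polynomial.C y₁ := by
  simp [ψ₀, gens]
  ring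

/-- The image of `f = x²y` in `K` is `X³·y₁`. -/
theorem fK_eq : algebraMap S K f = RatFunc.X ^ 3 * RatFunc.C y₁ := by
  rw [algebraMap_f]
  change algebraMap (Polynomial kp) K (ψ₀ (MvPolynomial.X 0 ^ 2 * MvPolynomial.X 1)) = _
  rw [ψ₀_f, map_mul, map_pow, RatFunc.algebraMap_X, RatFunc.algebraMap_C]

/-- `vX X = exp(-1)`. -/
theorem vX_X : vX (RatFunc.X : K) = WithZero.exp (-1 : ℤ) := Polynomial.valuation_X_eq_neg_one kp

/-- `X ∈ O`. -/
theorem X_mem_O : (RatFunc.X : K) ∈ O := by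
  rw [mem_O_iff, vX_X, ← WithZero.exp_zero, WithZero.exp_le_exp]
  norm_num

/-- `vX X < 1`. -/
theorem vX_X_lt_one : vX (RatFunc.X : K) < 1 := by
  rw [vX_X, ← WithZero.exp_zero, WithZero.exp_lt_exp]
  norm_num

/-- The constant `y₁` has value `1`. -/
theorem vX_Cy₁ : vX (RatFunc.C y₁ : K) = 1 := by
  rw [← RatFunc.algebraMap_C, IsDedekindDomain.HeightOneSpectrum.valuation_of_algebraMap,
    IsDedekindDomain.HeightOneSpectrum.intValuation_eq_one_iff, Polynomial.idealX_span,
    Ideal.mem_span_singleton, Polynomial.X_dvd_iff, Polynomial.coeff_C_zero]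
  exact y₁_ne_zero

/-- `vX f = exp(-3)`. -/
theorem vX_fK : vX (algebraMap S K f) = WithZero.exp (-3 : ℤ) := by
  rw [fK_eq, map_mul, map_pow, vX_X, vX_Cy₁, mul_one, ← WithZero.exp_nsmul]
  norm_num

/-- `exp (5a) = (exp a)^5` in the value group. -/
theorem exp_five_mul (a : ℤ) : WithZero.exp (5 * a) = WithZero.exp a ^ 5 := by
  have h := WithZero.exp_nsmul 5 a
  rw [nsmul_eq_mul] at h
  exact_mod_cast h

/-- `ν(C⁵ f) = 5·ν(C) + 3` (written multiplicatively: `exp (5 log − 3)`). -/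
theorem vX_C5f (C : K) (hC : C ≠ 0) :
    vX (C ^ 5 * algebraMap S K f) = WithZero.exp (5 * WithZero.log (vX C) - 3) := by
  have hC' : vX C ≠ 0 := by rwa [Ne, map_eq_zero]
  rw [map_mul, map_pow, vX_fK]
  conv_lhs => rw [← WithZero.exp_log hC']
  rw [← exp_five_mul, ← WithZero.exp_add]
  rfl

/-- `ν(D⁵) = 5·ν(D)` when `D ≠ 0`. -/
theorem vX_D5 (D : K) (hD : vX D ≠ 0) : vX (D ^ 5) = WithZero.exp (5 * WithZero.log (vX D)) := by
  rw [map_pow]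
  conv_lhs => rw [← WithZero.exp_log hD]
  rw [← exp_five_mul]

/-- `ν(C⁵ f) ≠ ν(D⁵)` for `C ≠ 0` (values `5ℤ + 3` vs `5ℤ ∪ {0}`). -/
theorem vX_C5f_ne_D5 (C D : K) (hC : C ≠ 0) : vX (C ^ 5 * algebraMap S K f) ≠ vX (D ^ 5) := by
  rw [vX_C5f C hC]
  by_cases hD : vX D = 0
  · rw [map_pow, hD, zero_pow (by norm_num)]
    exact WithZero.exp_ne_zero
  · rw [vX_D5 D hD, Ne, WithZero.exp_inj]
    omega

/-- **(L, proved)** the values of the points `C⁵f + D⁵` (`C ≠ 0`) of the `K⁵`-line: never `ν(X)`, and `= 0` forces `ν(C⁵f) > 0`. -/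
theorem lineValues : L := by
  refine ⟨?_, ?_⟩
  · intro c h
    have h' := congrArg vX h
    rw [map_pow, vX_fK] at h'
    by_cases hc : vX c = 0
    · rw [hc, zero_pow (by norm_num)] at h'
      exact WithZero.exp_ne_zero h'.symm
    · rw [← WithZero.exp_log hc, ← exp_five_mul, WithZero.exp_inj] at h'
      omega
  · intro C D hC
    have hne := vX_C5f_ne_D5 C D hC
    have hs := vX_C5f C hC
    rcases lt_or_gt_of_ne hne with hlt | hlt
    · -- `ν(D⁵) < ν(C⁵f)`: the sum has the value of `D⁵`
      have hD : vX D ≠ 0 := by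
        intro h0
        rw [map_pow, h0, zero_pow (by norm_num)] at hlt
        exact not_lt_of_ge zero_le hlt
      have hsum : vX (C ^ 5 * algebraMap S K f + D ^ 5) = vX (D ^ 5) :=
        Valuation.map_add_eq_of_lt_right _ hlt
      refine ⟨?_, ?_⟩
      · rw [Ne, ← isEquiv_O.eq_iff, hsum, vX_D5 D hD, vX_X, WithZero.exp_inj]
        omega
      · intro h1
        have h1' : vX (C ^ 5 * algebraMap S K f + D ^ 5) = vX 1 :=
          isEquiv_O.eq_iff.mpr (by rw [h1, map_one])
        rw [map_one, hsum] at h1'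
        exact isEquiv_O.lt_one_iff_lt_one.mp (h1' ▸ hlt)
    · -- `ν(C⁵f) < ν(D⁵)`: the sum has the value of `C⁵ f`
      have hsum : vX (C ^ 5 * algebraMap S K f + D ^ 5) = vX (C ^ 5 * algebraMap S K f) :=
        Valuation.map_add_eq_of_lt_left _ hlt
      refine ⟨?_, ?_⟩
      · rw [Ne, ← isEquiv_O.eq_iff, hsum, hs, vX_X, WithZero.exp_inj]
        omega
      · intro h1
        exfalso
        have h1' : vX (C ^ 5 * algebraMap S K f + D ^ 5) = vX 1 :=
          isEquiv_O.eq_iff.mpr (by rw [h1, map_one])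
        rw [map_one, hsum, hs, ← WithZero.exp_zero, WithZero.exp_inj] at h1'
        omega

/-- (A) — NO LONGER A STUB: the tree's LANDED Kummer criterion
`Theorems.stub_kummerCriterion` (p104053; `AdjoinRoot (X^p − C a)` regular ↔ `∀ c, a − c^p ∉ 𝔪²`)
gives it outright (the hypothesis `g − e⁵ ∈ 𝔪` is not even needed). -/
theorem adjoinRoot_of_kummerCriterion : AStmt := by
  intro R _ _ _ g e _ hreg
  exact (Summit.ResolutionOfSingularities.ResolutionOfSingularities.Theorems.stub_kummerCriterion 5 R g).mp
    hreg e

/-! ### Chart lemma (proved): the local blowing up along a PRINCIPAL ideal is trivial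

For `B ⊆ O` fixed by `locAtCentre` (i.e. already local at the centre) and `P = (π)`, every
`IsLocalBlowupAlong O B P B'` has `B' = B`: the chart element `u₀ = s₀ π` must have `ν(s₀) = 0`,
so each `x / u₀ = s_x / s₀` already lies in `B`.  Serves the height-one case of `StepClosed`
for `S` and for every `B♯`. -/
/-- Chart lemma: the local blowing up along a PRINCIPAL centre of a ring fixed by `locAtCentre · O` is trivial (`B' = B`). -/
theorem eq_of_isLocalBlowupAlong_span_singleton {B B' : Subring K} {P : Ideal B} (π : B)
    (hP : P = Ideal.span {π}) (hfix : locAtCentre B O = B) (h : IsLocalBlowupAlong O B P B') :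
    B' = B := by
  obtain ⟨hle, u, u₀, hspan, hu₀, hu₀ne, hval, rfl⟩ := h
  have hmemP : ∀ x ∈ u, x ∈ Ideal.span {π} := fun x hx => by
    rw [← hP, ← hspan]; exact Ideal.subset_span hx
  have hπ0 : π ≠ 0 := by
    rintro rfl
    apply hu₀ne
    have := hmemP u₀ hu₀
    rwa [Set.singleton_zero, Ideal.span_zero, Ideal.mem_bot] at this
  have hπK : (π : K) ≠ 0 := fun h0 => hπ0 (Subtype.ext h0)
  -- the chart element: `u₀ = s₀ π`
  obtain ⟨s₀, hs₀⟩ := Ideal.mem_span_singleton'.mp (hmemP u₀ hu₀)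
  -- some generator `x = s π` has `ν(s) = 0`
  have key : ∃ x ∈ u, ∃ s : B, s * π = x ∧ O.valuation (s : K) = 1 := by
    by_contra hcon
    push Not at hcon
    have hsub : Ideal.span (↑u : Set B) ≤ Ideal.span {π} * subringCentre B O hle := by
      rw [Ideal.span_le]
      intro x hx
      obtain ⟨s, rfl⟩ := Ideal.mem_span_singleton'.mp (hmemP x hx)
      rw [SetLike.mem_coe, Ideal.mem_span_singleton_mul]
      refine ⟨s, ?_, by ring⟩
      rw [mem_subringCentre_iff]
      exact lt_of_le_of_ne ((O.valuation_le_one_iff _).mpr (hle s.2)) (hcon _ hx s rfl)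
    have hπmem : π ∈ Ideal.span (↑u : Set B) := by
      rw [hspan, hP]; exact Ideal.mem_span_singleton_self π
    obtain ⟨z, hz, hπz⟩ := Ideal.mem_span_singleton_mul.mp (hsub hπmem)
    have hz1 : z = 1 := mul_left_cancel₀ hπ0 (by rw [hπz, mul_one])
    rw [hz1, mem_subringCentre_iff, OneMemClass.coe_one, map_one] at hz
    exact lt_irrefl _ hz
  obtain ⟨x, hx, s, rfl, hs⟩ := key
  -- hence `ν(s₀) = 0`
  have hs₀K : O.valuation (s₀ : K) ≤ 1 := (O.valuation_le_one_iff _).mpr (hle s₀.2)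
  have hv0 : O.valuation (s₀ : K) = 1 := by
    have h1 := hval _ hx
    rw [← hs₀, Subring.coe_mul, Subring.coe_mul, map_mul, map_mul, hs, one_mul] at h1
    have hπv : 0 < O.valuation (π : K) := by
      rw [zero_lt_iff, Ne, map_eq_zero]; exact hπK
    have h2 : 1 ≤ O.valuation (s₀ : K) := le_of_mul_le_mul_right (by rwa [one_mul]) hπv
    exact le_antisymm hs₀K h2
  have hs₀0 : (s₀ : K) ≠ 0 := ne_zero_of_valuation_eq_one hv0
  -- so every `x' / u₀` lies in `B`
  have hcl : Subring.closure ((B : Set K) ∪ (fun x : B => (x : K) / u₀) '' ↑u) = B := by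
    refine le_antisymm (Subring.closure_le.mpr ?_) (fun y hy => Subring.subset_closure (Or.inl hy))
    rintro y (hy | ⟨x', hx', rfl⟩)
    · exact hy
    · obtain ⟨s', hs'⟩ := Ideal.mem_span_singleton'.mp (hmemP x' hx')
      have hmem : ((x' : B) : K) / u₀ ∈ locAtCentre B O := by
        refine ⟨s', s'.2, s₀, s₀.2, hv0, ?_⟩
        rw [← hs', ← hs₀, Subring.coe_mul, Subring.coe_mul, mul_div_mul_right _ _ hπK]
      rw [hfix] at hmem
      exact hmem
  rw [hcl, hfix]

/-! ### Chart lemma (proved): the POINT chart seen from `O` is `O` itself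

If a subring `B ⊆ O` contains `X`, `y₁ = (xy)/x` and `w₁ = (xw)/x` (as happens on the `u₀`-chart of
the blowing up of a closed point through which `ν = ord_𝔪` passes), then `B_{𝔪_O ∩ B} = O`:
every element of `O = k'[X]_{(X)}` is a quotient of elements of `𝔽₅[X, y₁, w₁]` with denominator
of value `0`.  Serves the closed-point case of `StepClosed` for `S` and for every `B♯`. -/

/-- `𝔽₅[y,w][X] → K`. -/
def Φ : Polynomial A₂ →+* K :=
  (algebraMap (Polynomial kp) K).comp (Polynomial.mapRingHom (algebraMap A₂ kp))

/-- `Φ P` is the image in `K` of `P` mapped to `k'[X]`. -/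
theorem Φ_apply (P : Polynomial A₂) : Φ P = algebraMap (Polynomial kp) K (P.map (algebraMap A₂ kp)) :=
  rfl

/-- `Φ` on constants. -/
theorem Φ_C (a : A₂) : Φ (Polynomial.C a) = RatFunc.C (algebraMap A₂ kp a) := by
  rw [Φ_apply, Polynomial.map_C, RatFunc.algebraMap_C]

/-- `Φ X = X`. -/
theorem Φ_X : Φ Polynomial.X = RatFunc.X := by
  rw [Φ_apply, Polynomial.map_X, RatFunc.algebraMap_X]

/-- A subring containing `y₁, w₁` (as constants of `K`) contains every constant from `A₂ = 𝔽₅[y₁, w₁]`. -/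
theorem C_algebraMap_mem {B : Subring K} (hy : (RatFunc.C y₁ : K) ∈ B) (hw : (RatFunc.C w₁ : K) ∈ B)
    (a : A₂) : (RatFunc.C (algebraMap A₂ kp a) : K) ∈ B := by
  have hXi : ∀ i : Fin 2, (RatFunc.C (algebraMap A₂ kp (MvPolynomial.X i)) : K) ∈ B :=
    Fin.forall_fin_two.mpr ⟨hy, hw⟩
  induction a using MvPolynomial.induction_on with
  | C r =>
    rw [← ZMod.natCast_zmod_val r, map_natCast, map_natCast, map_natCast]
    exact natCast_mem B _
  | add p q hp hq => rw [map_add, map_add]; exact add_mem hp hq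
  | mul_X p i hp => rw [map_mul, map_mul]; exact mul_mem hp (hXi i)

/-- A subring containing `X, y₁, w₁` contains `Φ P` for every `P ∈ A₂[X]`. -/
theorem Φ_mem {B : Subring K} (hX : (RatFunc.X : K) ∈ B) (hy : (RatFunc.C y₁ : K) ∈ B)
    (hw : (RatFunc.C w₁ : K) ∈ B) (P : Polynomial A₂) : Φ P ∈ B := by
  induction P using Polynomial.induction_on' with
  | add p q hp hq => rw [map_add]; exact add_mem hp hq
  | monomial n a =>
    rw [← Polynomial.C_mul_X_pow_eq_monomial, map_mul, map_pow, Φ_C, Φ_X]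
    exact mul_mem (C_algebraMap_mem hy hw a) (pow_mem hX n)

/-- Nonzero constants have value `1`. -/
theorem vX_C {c : kp} (hc : c ≠ 0) : vX (RatFunc.C c : K) = 1 := by
  rw [← RatFunc.algebraMap_C, IsDedekindDomain.HeightOneSpectrum.valuation_of_algebraMap,
    IsDedekindDomain.HeightOneSpectrum.intValuation_eq_one_iff, Polynomial.idealX_span,
    Ideal.mem_span_singleton, Polynomial.X_dvd_iff, Polynomial.coeff_C_zero]
  exact hc

/-- A polynomial `d ∈ k'[X]` has value `< 1` iff `X ∣ d`. -/
theorem vX_algebraMap_lt_one_iff (d : Polynomial kp) :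
    vX (algebraMap (Polynomial kp) K d) < 1 ↔ Polynomial.X ∣ d := by
  rw [IsDedekindDomain.HeightOneSpectrum.valuation_lt_one_iff_mem, Polynomial.idealX_span,
    Ideal.mem_span_singleton]

/-- **Point chart.** `X, y₁, w₁ ∈ B ⊆ O ⇒ B_{𝔪_O ∩ B} = O`. -/
theorem locAtCentre_eq_O {B : Subring K} (hB : B ≤ O.toSubring) (hX : (RatFunc.X : K) ∈ B)
    (hy : (RatFunc.C y₁ : K) ∈ B) (hw : (RatFunc.C w₁ : K) ∈ B) : locAtCentre B O = O.toSubring := by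
  refine le_antisymm (locAtCentre_le hB) ?_
  intro q hq
  change q ∈ O at hq
  rw [mem_O_iff] at hq
  have hd0 : RatFunc.denom q ≠ 0 := RatFunc.denom_ne_zero q
  have hD : algebraMap (Polynomial kp) K (RatFunc.denom q) ≠ 0 := fun h =>
    hd0 (RatFunc.algebraMap_injective kp (by rw [h, map_zero]))
  have hqeq := RatFunc.num_div_denom q
  -- the normalised denominator is not divisible by `X`
  have hvd : vX (algebraMap (Polynomial kp) K (RatFunc.denom q)) = 1 := by
    by_contra hne
    have hlt : vX (algebraMap (Polynomial kp) K (RatFunc.denom q)) < 1 :=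
      lt_of_le_of_ne (IsDedekindDomain.HeightOneSpectrum.valuation_le_one _ _) hne
    have hXd : Polynomial.X ∣ RatFunc.denom q := (vX_algebraMap_lt_one_iff _).mp hlt
    have hvn : vX (algebraMap (Polynomial kp) K (RatFunc.num q)) < 1 := by
      have : vX (algebraMap (Polynomial kp) K (RatFunc.num q)) =
          vX q * vX (algebraMap (Polynomial kp) K (RatFunc.denom q)) := by
        rw [← map_mul, (div_eq_iff hD).mp hqeq]
      rw [this]
      exact lt_of_le_of_lt (mul_le_of_le_one_left' hq) hlt
    have hXn : Polynomial.X ∣ RatFunc.num q := (vX_algebraMap_lt_one_iff _).mp hvn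
    exact Polynomial.not_isUnit_X ((RatFunc.isCoprime_num_denom q).isUnit_of_dvd' hXn hXd)
  -- clear the coefficient denominators of `num` and `denom`
  obtain ⟨bn, hbn, hn⟩ :=
    IsLocalization.integerNormalization_spec (nonZeroDivisors A₂) (RatFunc.num q)
  obtain ⟨bd, hbd, hdd⟩ :=
    IsLocalization.integerNormalization_spec (nonZeroDivisors A₂) (RatFunc.denom q)
  rw [Algebra.smul_def, Polynomial.algebraMap_apply] at hn hdd
  have hbn' : algebraMap A₂ kp bn ≠ 0 :=
    fun h => nonZeroDivisors.ne_zero hbn (IsFractionRing.injective A₂ kp (by rw [h, map_zero]))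
  have hbd' : algebraMap A₂ kp bd ≠ 0 :=
    fun h => nonZeroDivisors.ne_zero hbd (IsFractionRing.injective A₂ kp (by rw [h, map_zero]))
  have hCn : (RatFunc.C (algebraMap A₂ kp bn) : K) ≠ 0 := (map_ne_zero RatFunc.C).mpr hbn'
  have hCd : (RatFunc.C (algebraMap A₂ kp bd) : K) ≠ 0 := (map_ne_zero RatFunc.C).mpr hbd'
  have eN : Φ (IsLocalization.integerNormalization (nonZeroDivisors A₂) (RatFunc.num q)) =
      RatFunc.C (algebraMap A₂ kp bn) * algebraMap (Polynomial kp) K (RatFunc.num q) := by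
    rw [Φ_apply, hn, map_mul, RatFunc.algebraMap_C]
  have eD : Φ (IsLocalization.integerNormalization (nonZeroDivisors A₂) (RatFunc.denom q)) =
      RatFunc.C (algebraMap A₂ kp bd) * algebraMap (Polynomial kp) K (RatFunc.denom q) := by
    rw [Φ_apply, hdd, map_mul, RatFunc.algebraMap_C]
  refine ⟨Φ (IsLocalization.integerNormalization (nonZeroDivisors A₂) (RatFunc.num q)) *
      RatFunc.C (algebraMap A₂ kp bd), mul_mem (Φ_mem hX hy hw _) (C_algebraMap_mem hy hw bd),
    Φ (IsLocalization.integerNormalization (nonZeroDivisors A₂) (RatFunc.denom q)) *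
      RatFunc.C (algebraMap A₂ kp bn), mul_mem (Φ_mem hX hy hw _) (C_algebraMap_mem hy hw bn),
    ?_, ?_⟩
  · have h1 : vX (Φ (IsLocalization.integerNormalization (nonZeroDivisors A₂) (RatFunc.denom q)) *
        RatFunc.C (algebraMap A₂ kp bn)) = vX 1 := by
      rw [eD, map_mul, map_mul, vX_C hbd', hvd, vX_C hbn', map_one, one_mul, one_mul]
    have h2 := isEquiv_O.eq_iff.mp h1
    rwa [map_one] at h2
  · rw [eN, eD, (div_eq_iff hD).mp hqeq]
    field_simp

/-! ### Chart lemma (proved): blowing up a centre CONTAINING `x, xy₁, xw₁` lands on `O`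

For `B = (B₀)_{𝔪_O ∩ B₀}` and a proper ideal `P ∋ X, X·y₁, X·w₁` (the closed point of `S`, or of
any `B♯`), every `IsLocalBlowupAlong O B P B'` has `B' = O`, whatever the generating set and the
chart: the chart element has `ν(u₀) = ν(X)`, so `y₁ = (Xy₁/u₀)(X/u₀)⁻¹ ∈ B'` etc., and the
point-chart lemma applies. -/

/-- Discreteness: `vX x < 1 ⇒ vX x ≤ vX X`. -/
theorem vX_le_vX_X_of_lt_one {x : K} (hx : vX x < 1) : vX x ≤ vX (RatFunc.X : K) := by
  rw [vX_X]
  by_cases h0 : vX x = 0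
  · rw [h0]; exact zero_le
  · rw [← WithZero.exp_log h0, WithZero.exp_le_exp]
    rw [← WithZero.exp_log h0, ← WithZero.exp_zero, WithZero.exp_lt_exp] at hx
    omega

/-- Values on `span u` are bounded by the largest value of a generator. -/
theorem valuation_le_of_mem_span {B : Subring K} (hB : B ≤ O.toSubring) {u : Finset B} {u₀ : B}
    (hval : ∀ x ∈ u, O.valuation (x : K) ≤ O.valuation (u₀ : K)) {m : B}
    (hm : m ∈ Ideal.span (↑u : Set B)) : O.valuation (m : K) ≤ O.valuation (u₀ : K) := by
  induction hm using Submodule.span_induction with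
  | mem x hx => exact hval x hx
  | zero => simp
  | add a b _ _ ha hb =>
    rw [Subring.coe_add]
    exact (Valuation.map_add _ _ _).trans (max_le ha hb)
  | smul t a _ ha =>
    rw [smul_eq_mul, Subring.coe_mul, map_mul]
    have ht : O.valuation (t : K) ≤ 1 := (O.valuation_le_one_iff _).mpr (hB t.2)
    calc O.valuation (t : K) * O.valuation (a : K) ≤ 1 * O.valuation (u₀ : K) :=
          mul_le_mul' ht ha
      _ = O.valuation (u₀ : K) := one_mul _

/-- `m / u₀` lies in the chart algebra for every `m ∈ span u`. -/
theorem div_mem_closure_of_mem_span {B : Subring K} {u : Finset B} {u₀ : B} {m : B}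
    (hm : m ∈ Ideal.span (↑u : Set B)) :
    (m : K) / u₀ ∈ Subring.closure ((B : Set K) ∪ (fun x : B => (x : K) / u₀) '' ↑u) := by
  induction hm using Submodule.span_induction with
  | mem x hx => exact Subring.subset_closure (Or.inr ⟨x, hx, rfl⟩)
  | zero => rw [Subring.coe_zero, zero_div]; exact Subring.zero_mem _
  | add a b _ _ ha hb => rw [Subring.coe_add, add_div]; exact add_mem ha hb
  | smul t a _ ha =>
    rw [smul_eq_mul, Subring.coe_mul, mul_div_assoc]
    exact mul_mem (Subring.subset_closure (Or.inl t.2)) ha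

/-- **Closed-point chart.** -/
theorem eq_O_of_isLocalBlowupAlong {B₀ B' : Subring K} (h0 : B₀ ≤ O.toSubring)
    {P : Ideal (locAtCentre B₀ O)} (hP : P ≠ ⊤) (h : IsLocalBlowupAlong O (locAtCentre B₀ O) P B')
    (hX : ∃ hx, (⟨RatFunc.X, hx⟩ : locAtCentre B₀ O) ∈ P)
    (hY : ∃ hy, (⟨RatFunc.X * RatFunc.C y₁, hy⟩ : locAtCentre B₀ O) ∈ P)
    (hW : ∃ hw, (⟨RatFunc.X * RatFunc.C w₁, hw⟩ : locAtCentre B₀ O) ∈ P) : B' = O.toSubring := by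
  obtain ⟨hle, u, u₀, hspan, hu₀, hu₀ne, hval, rfl⟩ := h
  obtain ⟨hxB, hxP⟩ := hX
  obtain ⟨hyB, hyP⟩ := hY
  obtain ⟨hwB, hwP⟩ := hW
  rw [← hspan] at hxP hyP hwP hP
  -- the chart element has the value of `X`
  have hu₀lt : O.valuation (u₀ : K) < 1 := by
    rw [← not_isUnit_locAtCentre_iff h0]
    exact fun hunit => hP (Ideal.eq_top_of_isUnit_mem _ (Ideal.subset_span hu₀) hunit)
  have hXle : O.valuation (RatFunc.X : K) ≤ O.valuation (u₀ : K) := valuation_le_of_mem_span hle hval hxP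
  have hX0 : vX (RatFunc.X : K) ≠ 0 := by rw [vX_X]; exact WithZero.exp_ne_zero
  have hvu₀ : vX (u₀ : K) = vX (RatFunc.X : K) :=
    le_antisymm (vX_le_vX_X_of_lt_one (isEquiv_O.lt_one_iff_lt_one.mpr hu₀lt))
      (isEquiv_O.le_iff_le.mpr hXle)
  have hu₀K : (u₀ : K) ≠ 0 := fun h => hu₀ne (Subtype.ext h)
  have hq1 : O.valuation ((RatFunc.X : K) / u₀) = 1 := by
    have : vX ((RatFunc.X : K) / u₀) = vX 1 := by rw [map_div₀, hvu₀, div_self hX0, map_one]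
    have h2 := isEquiv_O.eq_iff.mp this
    rwa [map_one] at h2
  -- the chart algebra sits in `O` and contains `X/u₀, Xy₁/u₀, Xw₁/u₀`
  have hB₁O : Subring.closure (((locAtCentre B₀ O : Subring K) : Set K) ∪
      (fun x : locAtCentre B₀ O => (x : K) / u₀) '' ↑u) ≤ O.toSubring := by
    refine Subring.closure_le.mpr ?_
    rintro z (hz | ⟨x, hx, rfl⟩)
    · exact hle hz
    · change (x : K) / u₀ ∈ O
      have hpos : 0 < O.valuation (u₀ : K) := by
        rw [zero_lt_iff, Ne, map_eq_zero]; exact hu₀K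
      rw [← O.valuation_le_one_iff, map_div₀, div_le_one₀ hpos]
      exact hval x hx
  have hXq := div_mem_closure_of_mem_span (u₀ := u₀) hxP
  have hYq := div_mem_closure_of_mem_span (u₀ := u₀) hyP
  have hWq := div_mem_closure_of_mem_span (u₀ := u₀) hwP
  change (RatFunc.X : K) / u₀ ∈ _ at hXq
  change (RatFunc.X * RatFunc.C y₁ : K) / u₀ ∈ _ at hYq
  change (RatFunc.X * RatFunc.C w₁ : K) / u₀ ∈ _ at hWq
  have hinv := inv_mem_locAtCentre (le_locAtCentre _ O hXq) hq1
  have hX' := le_locAtCentre _ O (Subring.subset_closure (Or.inl hxB) :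
    (RatFunc.X : K) ∈ Subring.closure (((locAtCentre B₀ O : Subring K) : Set K) ∪
      (fun x : locAtCentre B₀ O => (x : K) / u₀) '' ↑u))
  have hXK : (RatFunc.X : K) ≠ 0 := RatFunc.X_ne_zero
  have hy' : (RatFunc.C y₁ : K) ∈ locAtCentre (Subring.closure
      (((locAtCentre B₀ O : Subring K) : Set K) ∪ (fun x : locAtCentre B₀ O => (x : K) / u₀) '' ↑u)) O := by
    have e : (RatFunc.C y₁ : K) =
        (RatFunc.X * RatFunc.C y₁ / (u₀ : K)) * ((RatFunc.X : K) / (u₀ : K))⁻¹ := by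
      field_simp
    rw [e]
    exact mul_mem (le_locAtCentre _ O hYq) hinv
  have hw' : (RatFunc.C w₁ : K) ∈ locAtCentre (Subring.closure
      (((locAtCentre B₀ O : Subring K) : Set K) ∪ (fun x : locAtCentre B₀ O => (x : K) / u₀) '' ↑u)) O := by
    have e : (RatFunc.C w₁ : K) =
        (RatFunc.X * RatFunc.C w₁ / (u₀ : K)) * ((RatFunc.X : K) / (u₀ : K))⁻¹ := by
      field_simp
    rw [e]
    exact mul_mem (le_locAtCentre _ O hWq) hinv
  rw [← locAtCentre_locAtCentre]
  exact locAtCentre_eq_O (locAtCentre_le hB₁O) hX' hy' hw'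

/-! ### (base, partial) — proved: `baseRing = S`, and `UnitRes S` (`κ(S) = 𝔽₅` is perfect) -/

/-- `S` is already local at the centre of `O`: `baseRing` is just the image of `S` in `K`. -/
theorem baseRing_eq_range : baseRing = (algebraMap S K).range := by
  refine le_antisymm ?_ (le_locAtCentre _ _)
  rintro _ ⟨y, ⟨sy, rfl⟩, z, ⟨sz, rfl⟩, hv, rfl⟩
  have hunit : IsUnit sz := by
    by_contra h
    exact lt_irrefl _ (hv ▸ dominates sz h)
  obtain ⟨w, rfl⟩ := hunit
  exact ⟨sy * ↑w⁻¹, by rw [map_mul, map_units_inv, div_eq_mul_inv]⟩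

/-- `baseRing` is the image of `S` in `K`. -/
theorem mem_baseRing_iff (g : K) : g ∈ baseRing ↔ ∃ s : S, algebraMap S K s = g := by
  rw [baseRing_eq_range, RingHom.mem_range]

/-- `s⁵ ≡ s (mod 𝔪_S)` — the residue field of `S` is `𝔽₅`. -/
theorem self_sub_pow_five_mem (s : S) : s - s ^ 5 ∈ IsLocalRing.maximalIdeal S := by
  obtain ⟨⟨a, b⟩, hab⟩ := IsLocalization.mk'_surjective m0.primeCompl s
  change IsLocalization.mk' S a b = s at hab
  subst hab
  rw [← IsLocalization.mk'_pow, ← IsLocalization.mk'_sub,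
    IsLocalization.AtPrime.mk'_mem_maximal_iff S m0, mem_originIdeal_iff]
  simp [map_sub, map_mul, map_pow, ZMod.pow_card]

/-- (base, UnitRes): for a unit `g` of `S`, `g⁵ ≡ g (mod 𝔪_O)`, so `e := g` works. -/
theorem unitRes_base : UnitRes baseRing := by
  rintro g hg - -
  obtain ⟨s, rfl⟩ := (mem_baseRing_iff g).mp hg
  refine ⟨algebraMap S K s, hg, ?_⟩
  rw [← map_pow, ← map_sub]
  exact dominates _ (self_sub_pow_five_mem s)

/-- In a local subring `B ⊆ O`, elements of `O`-value `< 1` are non-units. -/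
theorem mem_maximalIdeal_of_valuation_lt_one {B : Subring K} [IsLocalRing B]
    (hBO : B ≤ O.toSubring) (z : B) (hz : O.valuation (z : K) < 1) :
    z ∈ IsLocalRing.maximalIdeal B := by
  rw [IsLocalRing.mem_maximalIdeal, mem_nonunits_iff]
  rintro ⟨u, rfl⟩
  have h1 : O.valuation ((u : B) : K) * O.valuation ((↑u⁻¹ : B) : K) = 1 := by
    rw [← map_mul, ← Subring.coe_mul, Units.mul_inv, Subring.coe_one, map_one]
  have h2 : O.valuation ((↑u⁻¹ : B) : K) ≤ 1 :=
    (O.valuation_le_one_iff _).mpr (hBO (↑u⁻¹ : B).2)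
  have : O.valuation ((u : B) : K) * O.valuation ((↑u⁻¹ : B) : K) < 1 * 1 :=
    mul_lt_mul_of_lt_of_le_of_nonneg_of_pos hz h2 zero_le zero_lt_one
  rw [h1, one_mul] at this
  exact lt_irrefl _ this

/-! ### `S ≅ baseRing`, and the generators `x, xy₁, xw₁` inside `baseRing` -/

/-- `S → baseRing ⊆ K` (an isomorphism onto the image). -/
def toBase : S →+* baseRing :=
  (algebraMap S K).codRestrict baseRing (fun s => le_locAtCentre _ _ ⟨s, rfl⟩)

/-- `toBase s` coerces to `algebraMap S K s`. -/
@[simp] theorem coe_toBase (s : S) : ((toBase s : baseRing) : K) = algebraMap S K s := rfl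

/-- `toBase : S → baseRing` is injective. -/
theorem toBase_injective : Function.Injective toBase := fun _ _ h =>
  algebraMap_SK_injective (congrArg (fun x : baseRing => (x : K)) h)

/-- `toBase : S → baseRing` is surjective. -/
theorem toBase_surjective : Function.Surjective toBase := fun b => by
  obtain ⟨s, hs⟩ := (mem_baseRing_iff _).mp b.2
  exact ⟨s, Subtype.ext hs⟩

/-- `ψ` factors through `S`: `ψ a = algebraMap S K (algebraMap A S a)`. -/
theorem ψ_eq_algebraMap (a : A) : ψ a = algebraMap S K (algebraMap A S a) := by
  rw [algebraMap_SK_eq, IsLocalization.lift_eq]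

/-- `ψ(A) ⊆ baseRing`. -/
theorem ψ_mem_baseRing (a : A) : ψ a ∈ baseRing :=
  le_locAtCentre _ _ ⟨algebraMap A S a, (ψ_eq_algebraMap a).symm⟩

/-- `ψ x = X`. -/
theorem ψ_X0 : ψ (MvPolynomial.X 0) = RatFunc.X := by
  change algebraMap (Polynomial kp) K (ψ₀ (MvPolynomial.X 0)) = _
  rw [ψ₀_X0, RatFunc.algebraMap_X]

/-- `ψ y = X·y₁`. -/
theorem ψ_X1 : ψ (MvPolynomial.X 1) = RatFunc.X * RatFunc.C y₁ := by
  change algebraMap (Polynomial kp) K (ψ₀ (MvPolynomial.X 1)) = _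
  rw [show ψ₀ (MvPolynomial.X 1) = Polynomial.X * Polynomial.C y₁ by simp [ψ₀, gens], map_mul,
    RatFunc.algebraMap_X, RatFunc.algebraMap_C]

/-- `ψ w = X·w₁`. -/
theorem ψ_X2 : ψ (MvPolynomial.X 2) = RatFunc.X * RatFunc.C w₁ := by
  change algebraMap (Polynomial kp) K (ψ₀ (MvPolynomial.X 2)) = _
  rw [show ψ₀ (MvPolynomial.X 2) = Polynomial.X * Polynomial.C w₁ by simp [ψ₀, gens], map_mul,
    RatFunc.algebraMap_X, RatFunc.algebraMap_C]

/-- `X ∈ baseRing`. -/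
theorem X_mem_baseRing : (RatFunc.X : K) ∈ baseRing := ψ_X0 ▸ ψ_mem_baseRing _
/-- `X·y₁ ∈ baseRing`. -/
theorem Xy₁_mem_baseRing : (RatFunc.X * RatFunc.C y₁ : K) ∈ baseRing := ψ_X1 ▸ ψ_mem_baseRing _
/-- `X·w₁ ∈ baseRing`. -/
theorem Xw₁_mem_baseRing : (RatFunc.X * RatFunc.C w₁ : K) ∈ baseRing := ψ_X2 ▸ ψ_mem_baseRing _

/-- `X` has `O`-value `< 1`. -/
theorem valuation_X_lt_one : O.valuation (RatFunc.X : K) < 1 :=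
  isEquiv_O.lt_one_iff_lt_one.mp vX_X_lt_one

/-- `X·y₁` has `O`-value `< 1`. -/
theorem valuation_Xy₁_lt_one : O.valuation (RatFunc.X * RatFunc.C y₁ : K) < 1 := by
  rw [← ψ_X1]; exact isEquiv_O.lt_one_iff_lt_one.mp (vX_ψ_lt_one (by simp))

/-- `X·w₁` has `O`-value `< 1`. -/
theorem valuation_Xw₁_lt_one : O.valuation (RatFunc.X * RatFunc.C w₁ : K) < 1 := by
  rw [← ψ_X2]; exact isEquiv_O.lt_one_iff_lt_one.mp (vX_ψ_lt_one (by simp))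

/-- The closed-point case of `StepClosed`, for any tower-shaped ring containing `baseRing`. -/
theorem eq_O_of_point {B₀ B' : Subring K} (h0 : B₀ ≤ O.toSubring) {P : Ideal (locAtCentre B₀ O)}
    (hquot : IsRegularLocalRing (locAtCentre B₀ O ⧸ P)) (hbase : baseRing ≤ locAtCentre B₀ O)
    (hpt : ∀ b : locAtCentre B₀ O, O.valuation (b : K) < 1 → b ∈ P)
    (hbl : IsLocalBlowupAlong O (locAtCentre B₀ O) P B') : B' = O.toSubring := by
  have hP : P ≠ ⊤ := fun h =>
    not_subsingleton (locAtCentre B₀ O ⧸ P) (Ideal.Quotient.subsingleton_iff.mpr h)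
  exact eq_O_of_isLocalBlowupAlong h0 hP hbl
    ⟨hbase X_mem_baseRing, hpt _ valuation_X_lt_one⟩
    ⟨hbase Xy₁_mem_baseRing, hpt _ valuation_Xy₁_lt_one⟩
    ⟨hbase Xw₁_mem_baseRing, hpt _ valuation_Xw₁_lt_one⟩

/-! ### Base ring `S` (all PROVED): its regular primes, and `ν = ord` on parameters -/

/-- The shape of the classification of ideals with regular quotient in `S` (seen in `K`). [OURS · auxiliary statement of this proof, proved/consumed in this file; folklore] -/
def RegularPrimesBase : Prop :=
  ∀ (P : Ideal baseRing), IsRegularLocalRing baseRing → IsRegularLocalRing (baseRing ⧸ P) →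
    (∃ π : baseRing, P = Ideal.span {π}) ∨
    (∃ u v t : S, IsFrame u v t ∧
      (∀ [IsLocalRing baseRing], toBase u ∉ IsLocalRing.maximalIdeal baseRing ^ 2 ∧
        toBase v ∉ IsLocalRing.maximalIdeal baseRing ^ 2) ∧
      P = Ideal.span {toBase u, toBase v}) ∨
    (∀ b : baseRing, O.valuation (b : K) < 1 → b ∈ P)

/-- `toBase` matches the maximal ideals of `S` and `baseRing`. -/
theorem mem_maximalIdeal_S_iff [IsLocalRing baseRing] (z : S) :
    z ∈ IsLocalRing.maximalIdeal S ↔ toBase z ∈ IsLocalRing.maximalIdeal baseRing := by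
  constructor
  · intro hz
    exact mem_maximalIdeal_of_valuation_lt_one (B := baseRing) (locAtCentre_le range_le_O) _
      (dominates z hz)
  · intro hz
    by_contra hz'
    have hu : IsUnit z := by
      simpa [IsLocalRing.mem_maximalIdeal, mem_nonunits_iff] using hz'
    exact ((IsLocalRing.mem_maximalIdeal _).mp hz) (hu.map toBase)

/-- Range of a `Fin 2`-indexed family. -/
theorem range_fin_two {R : Type*} (t : Fin 2 → R) : Set.range t = {t 0, t 1} := by
  ext x
  simp only [Set.mem_range, Fin.exists_fin_two, Set.mem_insert_iff, Set.mem_singleton_iff]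
  exact or_congr eq_comm eq_comm

/-- Range of a `Fin 1`-indexed family. -/
theorem range_fin_one {R : Type*} (t : Fin 1 → R) : Set.range t = {t 0} := by
  ext x
  simp only [Set.mem_range, Fin.exists_fin_one, Set.mem_singleton_iff]
  exact eq_comm

/-- (base primes, PROVED) an ideal `P` of `S ≅ baseRing` with `S/P` regular is principal (heights
`0, 1`), a regular curve `(u, v)` through a frame `(u, v, t)` with `u, v ∉ 𝔪²` (height `2`), or the
closed point.  Matsumura 14.2 in the tree form `Resolution.exists_isRsopPart_span_range_eq`. -/
theorem regularPrimes_base : RegularPrimesBase := by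
  classical
  intro P hB hBP
  haveI := hB
  haveI := hBP
  have hPtop : P ≠ ⊤ := fun h =>
    not_subsingleton (baseRing ⧸ P) (Ideal.Quotient.subsingleton_iff.mpr h)
  have hPm : P ≤ IsLocalRing.maximalIdeal baseRing := IsLocalRing.le_maximalIdeal hPtop
  obtain ⟨r, c, hc, hcP⟩ := exists_isRsopPart_span_range_eq hPm
  obtain ⟨e, y, hre, hspan⟩ := hc.2
  have hbij : Function.Bijective toBase := ⟨toBase_injective, toBase_surjective⟩
  have hdim : ringKrullDim baseRing = 3 := by
    rw [← ringKrullDim_eq_of_ringEquiv (RingEquiv.ofBijective toBase hbij), ringKrullDim_S]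
  have hre3 : r + e = 3 := by
    rw [hdim] at hre
    exact_mod_cast hre.symm
  have hcomap : Ideal.comap toBase (IsLocalRing.maximalIdeal baseRing) = IsLocalRing.maximalIdeal S :=
    Ideal.ext fun z => by rw [Ideal.mem_comap, mem_maximalIdeal_S_iff]
  rcases r with _ | _ | _ | _ | r
  · -- height 0
    refine Or.inl ⟨0, ?_⟩
    rw [← hcP, Set.range_eq_empty, Ideal.span_empty, eq_comm, Ideal.span_singleton_eq_bot]
  · -- height 1
    refine Or.inl ⟨c 0, ?_⟩
    rw [← hcP, range_fin_one]
  · -- height 2 : a regular curve through a frame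
    have he : e = 1 := by omega
    subst he
    obtain ⟨u, hu⟩ := toBase_surjective (c 0)
    obtain ⟨v, hv⟩ := toBase_surjective (c 1)
    obtain ⟨t, ht⟩ := toBase_surjective (y 0)
    refine Or.inr (Or.inl ⟨u, v, t, ?_, ?_, ?_⟩)
    · unfold IsFrame
      have hset : (toBase : S → baseRing) '' {u, v, t} = Set.range c ∪ Set.range y := by
        rw [Set.image_insert_eq, Set.image_insert_eq, Set.image_singleton, hu, hv, ht,
          range_fin_two, range_fin_one, Set.insert_union, Set.singleton_union]
      rw [← hcomap, ← hspan, ← hset, ← Ideal.map_span, Ideal.comap_map_of_bijective toBase hbij]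
    · intro _
      rw [hu, hv]
      exact ⟨hc.not_mem_sq 0, hc.not_mem_sq 1⟩
    · rw [← hcP, range_fin_two, hu, hv]
  · -- height 3 : the closed point
    have he : e = 0 := by omega
    subst he
    refine Or.inr (Or.inr fun b hb => ?_)
    have hP : P = IsLocalRing.maximalIdeal baseRing := by
      rw [← hcP, ← hspan, Set.range_eq_empty y, Set.union_empty]
    rw [hP]
    exact mem_maximalIdeal_of_valuation_lt_one (B := baseRing) (locAtCentre_le range_le_O) b hb
  · omega

/-! ### `ν = ord_𝔪` on `S`: an element of `𝔪_S ∖ 𝔪_S²` has the value of `X` (PROVED) -/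

/-- A degree-one exponent `e` satisfies `ιe e = cons 1 (tail e)`. -/
theorem ιe_eq_cons_of_degree_eq_one {e : Fin 3 →₀ ℕ} (he : Finsupp.degree e = 1) :
    ιe e = Finsupp.cons 1 (Finsupp.tail e) := by
  have hsum : e 0 + e 1 + e 2 = 1 := by
    rw [Finsupp.degree_eq_sum, Fin.sum_univ_three] at he; exact he
  ext j
  refine Fin.cases ?_ (fun k => ?_) j
  · rw [ιe_apply_zero, Finsupp.cons_zero]; omega
  · rw [Finsupp.cons_succ, Finsupp.tail_apply]
    simp [ιe]

/-- The `X`-coefficient of `ψ₀ a` is the image of the `X₀`-coefficient of `finSuccEquiv (θ a)`. -/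
theorem coeff_ψ₀_one (a : A) :
    (ψ₀ a).coeff 1 = algebraMap A₂ kp ((MvPolynomial.finSuccEquiv k₀ 2 (θ a)).coeff 1) := by
  rw [ψ₀_eq]
  simp only [RingHom.coe_comp, Function.comp_apply, Polynomial.coe_mapRingHom, Polynomial.coeff_map,
    RingHom.coe_coe]

/-- The linear part of `a ∈ 𝔪₀ ∖ 𝔪₀²` survives the substitution `(x, xy, xw)`. -/
theorem linearPart_ne_zero {a : A} (ha : a ∈ m0) (ha2 : a ∉ m0 ^ 2) :
    (MvPolynomial.finSuccEquiv k₀ 2 (θ a)).coeff 1 ≠ 0 := by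
  have hm0 : m0 = MvPolynomial.idealOfVars (Fin 3) k₀ := originIdeal_eq_span k₀ 3
  rw [hm0, MvPolynomial.mem_pow_idealOfVars_iff] at ha2
  push Not at ha2
  obtain ⟨e, he, hdeg⟩ := ha2
  have hdeg1 : Finsupp.degree e = 1 := by
    have h1 : 1 ≤ Finsupp.degree e := by
      rw [hm0, ← pow_one (MvPolynomial.idealOfVars (Fin 3) k₀),
        MvPolynomial.mem_pow_idealOfVars_iff] at ha
      exact ha e he
    omega
  intro h
  have hc : MvPolynomial.coeff (Finsupp.tail e)
      ((MvPolynomial.finSuccEquiv k₀ 2 (θ a)).coeff 1) = 0 := by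
    rw [h, MvPolynomial.coeff_zero]
  rw [MvPolynomial.finSuccEquiv_coeff_coeff, ← ιe_eq_cons_of_degree_eq_one hdeg1, coeff_θ] at hc
  exact (MvPolynomial.mem_support_iff.mp he) hc

/-- `ν(ψ a) = ν(X)` for `a ∈ 𝔪₀ ∖ 𝔪₀²`. -/
theorem vX_ψ_eq_of_not_mem_sq {a : A} (ha : a ∈ m0) (ha2 : a ∉ m0 ^ 2) :
    vX (ψ a) = WithZero.exp (-1 : ℤ) := by
  have hle : vX (ψ a) ≤ WithZero.exp (-1 : ℤ) := vX_X ▸ vX_le_vX_X_of_lt_one (vX_ψ_lt_one ha)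
  have hnot : ¬ vX (ψ a) ≤ WithZero.exp (-((2 : ℕ) : ℤ)) := by
    change ¬ vX (algebraMap (Polynomial kp) K (ψ₀ a)) ≤ _
    rw [IsDedekindDomain.HeightOneSpectrum.valuation_of_algebraMap,
      IsDedekindDomain.HeightOneSpectrum.intValuation_le_pow_iff_mem, Polynomial.idealX_span,
      Ideal.span_singleton_pow, Ideal.mem_span_singleton, Polynomial.X_pow_dvd_iff]
    intro h
    have h1 := h 1 (by norm_num)
    rw [coeff_ψ₀_one] at h1
    exact linearPart_ne_zero ha ha2
      (((injective_iff_map_eq_zero _).mp (IsFractionRing.injective A₂ kp)) _ h1)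
  have hne : vX (ψ a) ≠ 0 := by
    intro h0; rw [h0] at hnot; exact hnot zero_le
  rw [← WithZero.exp_log hne] at hle hnot ⊢
  rw [WithZero.exp_le_exp] at hle hnot
  rw [WithZero.exp_inj]
  omega

/-- `toBase⁻¹ 𝔪_{baseRing} = 𝔪_S`. -/
theorem comap_toBase_maximalIdeal [IsLocalRing baseRing] :
    Ideal.comap toBase (IsLocalRing.maximalIdeal baseRing) = IsLocalRing.maximalIdeal S :=
  Ideal.ext fun z => by rw [Ideal.mem_comap, mem_maximalIdeal_S_iff]

/-- `toBase (𝔪_S) = 𝔪_{baseRing}`. -/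
theorem map_toBase_maximalIdeal [IsLocalRing baseRing] :
    Ideal.map toBase (IsLocalRing.maximalIdeal S) = IsLocalRing.maximalIdeal baseRing := by
  rw [← comap_toBase_maximalIdeal, Ideal.map_comap_of_surjective toBase toBase_surjective]

/-- (base ParamVal, PROVED) `ν = ord_𝔪` on `S`: an element of `𝔪_S ∖ 𝔪_S²` has value `ν(X)`. -/
theorem paramVal_base : ParamVal baseRing := by
  intro hB z hz hz2
  obtain ⟨s, rfl⟩ := toBase_surjective z
  have hs : s ∈ IsLocalRing.maximalIdeal S := (mem_maximalIdeal_S_iff s).mpr hz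
  have hs2 : s ∉ IsLocalRing.maximalIdeal S ^ 2 := fun h => hz2 (by
    have := Ideal.mem_map_of_mem toBase h
    rwa [Ideal.map_pow, map_toBase_maximalIdeal] at this)
  obtain ⟨⟨a, b⟩, hab⟩ := IsLocalization.mk'_surjective m0.primeCompl s
  change IsLocalization.mk' S a b = s at hab
  subst hab
  have ha : a ∈ m0 := (IsLocalization.AtPrime.mk'_mem_maximal_iff S m0 a b).mp hs
  have ha2 : a ∉ m0 ^ 2 := by
    intro h
    apply hs2
    have h1 : algebraMap A S a ∈ IsLocalRing.maximalIdeal S ^ 2 := by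
      have hmap : Ideal.map (algebraMap A S) m0 = IsLocalRing.maximalIdeal S :=
        IsLocalization.AtPrime.map_eq_maximalIdeal m0 S
      rw [← hmap, ← Ideal.map_pow]
      exact Ideal.mem_map_of_mem _ h
    rw [IsLocalization.mk'_eq_mul_mk'_one]
    exact Ideal.mul_mem_right _ _ h1
  have hb1 : O.valuation (ψ b) = 1 := isEquiv_O.eq_one_iff_eq_one.mp (vX_ψ_eq_one b.2)
  rw [coe_toBase, algebraMap_mk', map_div₀, hb1, div_one]
  exact isEquiv_O.eq_iff.mp (by rw [vX_ψ_eq_of_not_mem_sq ha ha2, vX_X])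

/-! ### `ν` detects the `𝔪_S`-adic order (all orders), frames are regular systems of parameters -/

/-- The members of a frame lie in `𝔪_S`. -/
theorem mem_maximalIdeal_of_isFrame {u v t : S} (hf : IsFrame u v t) :
    u ∈ IsLocalRing.maximalIdeal S ∧ v ∈ IsLocalRing.maximalIdeal S ∧ t ∈ IsLocalRing.maximalIdeal S := by
  refine ⟨?_, ?_, ?_⟩ <;> rw [← hf] <;> exact Ideal.subset_span (by simp)

/-- Frames are symmetric in the first two members. -/
theorem isFrame_comm {u v t : S} (hf : IsFrame u v t) : IsFrame v u t := by
  unfold IsFrame at hf ⊢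
  rw [← hf, Set.insert_comm]

/-- `ιe e = cons (deg e) (tail e)`: the shear records the total degree in slot `0`. -/
theorem ιe_eq_cons (e : Fin 3 →₀ ℕ) : ιe e = Finsupp.cons (Finsupp.degree e) (Finsupp.tail e) := by
  have hsum : Finsupp.degree e = e 0 + e 1 + e 2 := by
    rw [Finsupp.degree_eq_sum, Fin.sum_univ_three]
  ext j
  refine Fin.cases ?_ (fun k => ?_) j
  · rw [ιe_apply_zero, Finsupp.cons_zero, hsum]; ring
  · rw [Finsupp.cons_succ, Finsupp.tail_apply]
    simp [ιe]

/-- Coefficient `j` of `ψ₀ a` is (the image of) the dehomogenised degree-`j` part of `a`. -/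
theorem coeff_ψ₀ (a : A) (j : ℕ) :
    (ψ₀ a).coeff j = algebraMap A₂ kp ((MvPolynomial.finSuccEquiv k₀ 2 (θ a)).coeff j) := by
  rw [ψ₀_eq]
  simp only [RingHom.coe_comp, Function.comp_apply, Polynomial.coe_mapRingHom, Polynomial.coeff_map,
    RingHom.coe_coe]

/-- A monomial of `a` of degree `j` gives a nonzero `X^j`-coefficient of `ψ₀ a`. -/
theorem coeff_ψ₀_ne_zero {a : A} {e : Fin 3 →₀ ℕ} (he : e ∈ a.support) :
    (ψ₀ a).coeff (Finsupp.degree e) ≠ 0 := by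
  rw [coeff_ψ₀]
  intro h
  have h0 := (injective_iff_map_eq_zero _).mp (IsFractionRing.injective A₂ kp) _ h
  have hc : MvPolynomial.coeff (Finsupp.tail e)
      ((MvPolynomial.finSuccEquiv k₀ 2 (θ a)).coeff (Finsupp.degree e)) = 0 := by
    rw [h0, MvPolynomial.coeff_zero]
  rw [MvPolynomial.finSuccEquiv_coeff_coeff, ← ιe_eq_cons, coeff_θ] at hc
  exact (MvPolynomial.mem_support_iff.mp he) hc

/-- (V) `ν` detects the order on `A = 𝔽₅[x,y,w]`: `ν(ψ a) ≤ ν(X)^n ⇒ a ∈ 𝔪₀^n`. -/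
theorem mem_pow_of_vX_ψ_le {a : A} {n : ℕ} (h : vX (ψ a) ≤ WithZero.exp (-(n : ℤ))) :
    a ∈ m0 ^ n := by
  by_contra hn
  have hm0 : m0 = MvPolynomial.idealOfVars (Fin 3) k₀ := originIdeal_eq_span k₀ 3
  rw [hm0, MvPolynomial.mem_pow_idealOfVars_iff] at hn
  push Not at hn
  obtain ⟨e, he, hdeg⟩ := hn
  apply coeff_ψ₀_ne_zero he
  change vX (algebraMap (Polynomial kp) K (ψ₀ a)) ≤ _ at h
  rw [IsDedekindDomain.HeightOneSpectrum.valuation_of_algebraMap,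
    IsDedekindDomain.HeightOneSpectrum.intValuation_le_pow_iff_mem, Polynomial.idealX_span,
    Ideal.span_singleton_pow, Ideal.mem_span_singleton, Polynomial.X_pow_dvd_iff] at h
  exact h _ hdeg

/-- (V) on `S`: `ν(s) ≤ ν(X)^n ⇒ s ∈ 𝔪_S^n` — the `X`-adic value detects the `𝔪_S`-adic order. -/
theorem mem_pow_of_vX_le {s : S} {n : ℕ} (h : vX (algebraMap S K s) ≤ WithZero.exp (-(n : ℤ))) :
    s ∈ IsLocalRing.maximalIdeal S ^ n := by
  obtain ⟨⟨a, b⟩, hab⟩ := IsLocalization.mk'_surjective m0.primeCompl s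
  change IsLocalization.mk' S a b = s at hab
  subst hab
  rw [algebraMap_mk', map_div₀, vX_ψ_eq_one b.2, div_one] at h
  have ha := mem_pow_of_vX_ψ_le h
  have hmap : Ideal.map (algebraMap A S) m0 = IsLocalRing.maximalIdeal S :=
    IsLocalization.AtPrime.map_eq_maximalIdeal m0 S
  rw [IsLocalization.mk'_eq_mul_mk'_one, ← hmap, ← Ideal.map_pow]
  exact Ideal.mul_mem_right _ _ (Ideal.mem_map_of_mem _ ha)

/-- An element of `𝔪_S ∖ 𝔪_S²` has value exactly `ν(X)`. -/
theorem vX_eq_of_mem_not_mem_sq {s : S} (h1 : s ∈ IsLocalRing.maximalIdeal S)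
    (h2 : s ∉ IsLocalRing.maximalIdeal S ^ 2) : vX (algebraMap S K s) = WithZero.exp (-1 : ℤ) := by
  have hle : vX (algebraMap S K s) ≤ WithZero.exp (-1 : ℤ) :=
    vX_X ▸ vX_le_vX_X_of_lt_one (isEquiv_O.lt_one_iff_lt_one.mpr (dominates s h1))
  have hnot : ¬ vX (algebraMap S K s) ≤ WithZero.exp (-((2 : ℕ) : ℤ)) :=
    fun h => h2 (mem_pow_of_vX_le h)
  have hne : vX (algebraMap S K s) ≠ 0 := fun h0 => by rw [h0] at hnot; exact hnot zero_le
  rw [← WithZero.exp_log hne] at hle hnot ⊢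
  rw [WithZero.exp_le_exp] at hle hnot
  rw [WithZero.exp_inj]
  omega

/-- Range of `![u, v, t]`. -/
theorem range_vec3 (u v t : S) : Set.range ![u, v, t] = {u, v, t} := by
  rw [Matrix.range_cons, Matrix.range_cons, Matrix.range_cons_empty, Set.singleton_union,
    Set.singleton_union]

/-- A frame is a regular system of parameters of `S`. -/
theorem isRsopPart_of_isFrame {u v t : S} (hf : IsFrame u v t) : IsRsopPart ![u, v, t] := by
  refine ⟨inferInstance, 0, fun i => i.elim0, ?_, ?_⟩
  · rw [ringKrullDim_S]; norm_num
  · rw [Set.range_eq_empty (fun i : Fin 0 => (i.elim0 : S)), Set.union_empty, range_vec3]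
    exact hf

/-- The members of a frame are not in `𝔪_S²`. -/
theorem not_mem_sq_of_isFrame {u v t : S} (hf : IsFrame u v t) :
    u ∉ IsLocalRing.maximalIdeal S ^ 2 ∧ v ∉ IsLocalRing.maximalIdeal S ^ 2 ∧
      t ∉ IsLocalRing.maximalIdeal S ^ 2 := by
  have h := isRsopPart_of_isFrame hf
  exact ⟨h.not_mem_sq 0, h.not_mem_sq 1, h.not_mem_sq 2⟩

/-- `𝔪_S` needs exactly `3` generators (`S` regular of dimension `3`). -/
theorem spanFinrank_maximalIdeal_S : (IsLocalRing.maximalIdeal S).spanFinrank = 3 := by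
  have h := IsRegularLocalRing.spanFinrank_maximalIdeal (R := S)
  rw [ringKrullDim_S] at h
  exact_mod_cast h

/-! ### Elements of `S[v/u]` of positive value lie in `(u, t)·S[v/u]` (binary forms in a frame) -/

/-- Elements of `S[τ] = closure (S ∪ {τ})` are polynomial expressions in `τ`. -/
theorem exists_polynomial_of_mem_closure {τ c : K}
    (hc : c ∈ Subring.closure ((baseRing : Set K) ∪ {τ})) :
    ∃ P : Polynomial S, Polynomial.eval₂ (algebraMap S K) τ P = c := by
  have hrange : ((baseRing : Subring K) : Set K) = Set.range (algebraMap S K) := by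
    rw [baseRing_eq_range]; rfl
  rw [hrange] at hc
  have hc' : c ∈ Algebra.adjoin S ({τ} : Set K) := Algebra.mem_adjoin_iff.mpr hc
  rw [Algebra.adjoin_singleton_eq_range_aeval] at hc'
  obtain ⟨P, hP⟩ := (AlgHom.mem_range _).mp hc'
  exact ⟨P, by rw [← Polynomial.aeval_def]; exact hP⟩

/-- The binary form `Σ_{i ≤ n} p_i X₀^{n-i} X₁^{i}` attached to `P = Σ p_i T^i`. -/
def formOf (P : Polynomial S) (n : ℕ) : MvPolynomial (Fin 3) S :=
  ∑ i ∈ Finset.range (n + 1),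
    MvPolynomial.monomial (Finsupp.single 0 (n - i) + Finsupp.single 1 i) (P.coeff i)

/-- `formOf P n` is homogeneous of degree `n`. -/
theorem isHomogeneous_formOf (P : Polynomial S) (n : ℕ) : (formOf P n).IsHomogeneous n := by
  refine MvPolynomial.IsHomogeneous.sum _ _ _ fun i hi => ?_
  apply MvPolynomial.isHomogeneous_monomial
  rw [map_add, Finsupp.degree_single, Finsupp.degree_single]
  have := Finset.mem_range.mp hi
  omega

/-- The coefficient of `X₀^{n-i} X₁^i` in `formOf P n` is `P.coeff i`. -/
theorem coeff_formOf (P : Polynomial S) {n i : ℕ} (hi : i ≤ n) :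
    (formOf P n).coeff (Finsupp.single 0 (n - i) + Finsupp.single 1 i) = P.coeff i := by
  classical
  rw [formOf, MvPolynomial.coeff_sum, Finset.sum_eq_single i]
  · rw [MvPolynomial.coeff_monomial, if_pos rfl]
  · intro j _ hji
    rw [MvPolynomial.coeff_monomial, if_neg]
    intro h
    apply hji
    have h1 := congrArg (fun f : Fin 3 →₀ ℕ => f 1) h
    simpa [Finsupp.single_apply] using h1
  · intro h
    exact absurd (Finset.mem_range.mpr (Nat.lt_succ_of_le hi)) h

/-- `formOf P n` evaluated at `(u, v, t)` is `Σ_{i ≤ n} Pᵢ u^{n-i} vⁱ`. -/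
theorem eval_formOf (P : Polynomial S) (n : ℕ) (u v t : S) :
    MvPolynomial.eval ![u, v, t] (formOf P n) =
      ∑ i ∈ Finset.range (n + 1), P.coeff i * u ^ (n - i) * v ^ i := by
  simp only [formOf, map_sum, MvPolynomial.eval_monomial]
  refine Finset.sum_congr rfl fun i _ => ?_
  rw [Finsupp.prod_add_index' (fun _ => pow_zero _) (fun _ _ _ => pow_add _ _ _)]
  rw [Finsupp.prod_single_index, Finsupp.prod_single_index]
  · simp only [Matrix.cons_val_zero, Matrix.cons_val_one]
    ring
  all_goals exact pow_zero _

/-- In `K`: `formOf P (deg P)` at `(u, v, t)` equals `u^{deg P} · P(v/u)`. -/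
theorem algebraMap_eval_formOf (P : Polynomial S) {u v t : S} (hu : algebraMap S K u ≠ 0) :
    algebraMap S K (MvPolynomial.eval ![u, v, t] (formOf P P.natDegree)) =
      algebraMap S K u ^ P.natDegree *
        Polynomial.eval₂ (algebraMap S K) (algebraMap S K v / algebraMap S K u) P := by
  rw [eval_formOf, Polynomial.eval₂_eq_sum_range, map_sum, Finset.mul_sum]
  refine Finset.sum_congr rfl fun i hi => ?_
  have hi' : i ≤ P.natDegree := Nat.lt_succ_iff.mp (Finset.mem_range.mp hi)
  obtain ⟨k, hk⟩ := Nat.exists_eq_add_of_le hi'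
  rw [hk, Nat.add_sub_cancel_left, map_mul, map_mul, map_pow, map_pow, div_pow, pow_add]
  field_simp

/-- **Key estimate.** If `P(v/u)` has positive `ν`-value then every coefficient of `P` lies in `𝔪_S`:
`u^n P(v/u) = F(u, v)` for the binary form `F = formOf P n` has value `≤ ν(X)^{n+1}`, so
`F(u,v) ∈ 𝔪_S^{n+1}` (`mem_pow_of_vX_le`), and a form of degree `n` in a regular system of parameters
with `F(x) ∈ 𝔪^{n+1}` has coefficients in `𝔪` (Matsumura 17.10, tree
`coeff_mem_maximalIdeal_of_eval_mem_pow`). -/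
theorem coeff_mem_maximalIdeal_of_vX_lt_one {u v t : S} (hf : IsFrame u v t) (P : Polynomial S)
    (hval : vX (Polynomial.eval₂ (algebraMap S K) (algebraMap S K v / algebraMap S K u) P) < 1)
    (i : ℕ) : P.coeff i ∈ IsLocalRing.maximalIdeal S := by
  classical
  by_cases hi : i ≤ P.natDegree
  swap
  · rw [Polynomial.coeff_eq_zero_of_natDegree_lt (not_le.mp hi)]; exact Ideal.zero_mem _
  obtain ⟨hum, -, -⟩ := mem_maximalIdeal_of_isFrame hf
  obtain ⟨hu2, -, -⟩ := not_mem_sq_of_isFrame hf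
  have hvu : vX (algebraMap S K u) = WithZero.exp (-1 : ℤ) := vX_eq_of_mem_not_mem_sq hum hu2
  have hu0 : algebraMap S K u ≠ 0 := by
    intro h; rw [h, map_zero] at hvu; exact WithZero.coe_ne_zero hvu.symm
  have hw : vX (Polynomial.eval₂ (algebraMap S K) (algebraMap S K v / algebraMap S K u) P) ≤
      WithZero.exp (-1 : ℤ) := vX_X ▸ vX_le_vX_X_of_lt_one hval
  have hF : vX (algebraMap S K (MvPolynomial.eval ![u, v, t] (formOf P P.natDegree))) ≤
      WithZero.exp (-((P.natDegree + 1 : ℕ) : ℤ)) := by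
    rw [algebraMap_eval_formOf P hu0, map_mul, map_pow, hvu, ← WithZero.exp_nsmul]
    calc WithZero.exp (P.natDegree • (-1 : ℤ)) *
          vX (Polynomial.eval₂ (algebraMap S K) (algebraMap S K v / algebraMap S K u) P)
        ≤ WithZero.exp (P.natDegree • (-1 : ℤ)) * WithZero.exp (-1 : ℤ) := mul_le_mul' le_rfl hw
      _ = WithZero.exp (-((P.natDegree + 1 : ℕ) : ℤ)) := by
          rw [← WithZero.exp_add]; congr 1; simp; ring
  have hmem := mem_pow_of_vX_le hF
  have hx : Ideal.span (Set.range ![u, v, t]) = IsLocalRing.maximalIdeal S := by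
    rw [range_vec3]; exact hf
  have key := coeff_mem_maximalIdeal_of_eval_mem_pow spanFinrank_maximalIdeal_S ![u, v, t] hx
    (isHomogeneous_formOf P P.natDegree) hmem
    (Finsupp.single 0 (P.natDegree - i) + Finsupp.single 1 i)
  rwa [coeff_formOf P hi] at key

/-! ### Sharp rings `B♯(u,v)`: dimension, regular primes, `ν = ord`, fifth roots (all PROVED) -/

/-- The shape of the classification of ideals with regular quotient in the two-dimensional `B♯`. [OURS · auxiliary statement of this proof, proved/consumed in this file; folklore] -/
def RegularPrimesSharp (u v : S) : Prop :=
  ∀ (P : Ideal (sharpRing u v)), sharpRing u v ≤ O.toSubring → IsRegularLocalRing (sharpRing u v) →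
    IsRegularLocalRing (sharpRing u v ⧸ P) →
    (∃ π : sharpRing u v, P = Ideal.span {π}) ∨
    (∀ b : sharpRing u v, O.valuation (b : K) < 1 → b ∈ P)

/-- `S ⊆ B♯(u, v)`. -/
theorem baseRing_le_sharpRing (u v : S) : baseRing ≤ sharpRing u v :=
  fun _ hx => le_locAtCentre _ _ (Subring.subset_closure (Or.inl hx))

/-- A frame member is nonzero in `K`. -/
theorem algebraMap_ne_zero_of_isFrame {u v t : S} (hf : IsFrame u v t) : algebraMap S K u ≠ 0 := by
  obtain ⟨hum, -, -⟩ := mem_maximalIdeal_of_isFrame hf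
  obtain ⟨hu2, -, -⟩ := not_mem_sq_of_isFrame hf
  have hvu := vX_eq_of_mem_not_mem_sq hum hu2
  intro h
  rw [h, map_zero] at hvu
  exact WithZero.coe_ne_zero hvu.symm

/-- `τ = v/u` and the ring `C(u,v) = S[v/u] ⊆ K`; `B♯(u,v)` is `C(u,v)` localised at the centre of `ν`. -/
def τq (u v : S) : K := algebraMap S K v / algebraMap S K u

/-- `C(u,v) = S[v/u]`. -/
def Cq (u v : S) : Subring K := Subring.closure ((baseRing : Set K) ∪ {τq u v})

/-- `B♯(u,v) = locAtCentre (S[v/u]) O` (by definition). -/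
theorem sharpRing_eq (u v : S) : sharpRing u v = locAtCentre (Cq u v) O := rfl

/-- `S ⊆ Cq u v = S[v/u]`. -/
theorem algebraMap_mem_Cq (u v s : S) : algebraMap S K s ∈ Cq u v :=
  Subring.subset_closure (Or.inl (toBase s).2)

/-- `v/u ∈ S[v/u]`. -/
theorem τq_mem_Cq (u v : S) : τq u v ∈ Cq u v := Subring.subset_closure (Or.inr rfl)

/-- **(𝔮 ⊆ (u, t))** An element of `S[v/u]` of positive value is `u·c₁ + t·c₂` with `c₁, c₂ ∈ S[v/u]`
(write it as `P(v/u)`; all coefficients of `P` lie in `𝔪_S = (u, v, t)` by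
`coeff_mem_maximalIdeal_of_vX_lt_one`, and `v = (v/u)·u`). -/
theorem exists_eq_of_vX_lt_one {u v t : S} (hf : IsFrame u v t) {c : K} (hc : c ∈ Cq u v)
    (hv : vX c < 1) :
    ∃ c₁ ∈ Cq u v, ∃ c₂ ∈ Cq u v, c = algebraMap S K u * c₁ + algebraMap S K t * c₂ := by
  obtain ⟨P, rfl⟩ := exists_polynomial_of_mem_closure hc
  have hcoef := coeff_mem_maximalIdeal_of_vX_lt_one hf P hv
  have hdec : ∀ i, ∃ α β γ : S, P.coeff i = α * u + β * v + γ * t := by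
    intro i
    have hi := hcoef i
    unfold IsFrame at hf
    rw [← hf] at hi
    obtain ⟨α, z, hz, hαz⟩ := Ideal.mem_span_insert.mp hi
    obtain ⟨β, γ, hβγ⟩ := Ideal.mem_span_pair.mp hz
    exact ⟨α, β, γ, by rw [hαz, ← hβγ]; ring⟩
  choose α β γ hαβγ using hdec
  refine ⟨∑ i ∈ Finset.range (P.natDegree + 1),
      (algebraMap S K (α i) + algebraMap S K (β i) * τq u v) * τq u v ^ i, ?_,
    ∑ i ∈ Finset.range (P.natDegree + 1), algebraMap S K (γ i) * τq u v ^ i, ?_, ?_⟩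
  · exact Subring.sum_mem _ fun i _ => Subring.mul_mem _
      (Subring.add_mem _ (algebraMap_mem_Cq u v _)
        (Subring.mul_mem _ (algebraMap_mem_Cq u v _) (τq_mem_Cq u v)))
      (Subring.pow_mem _ (τq_mem_Cq u v) _)
  · exact Subring.sum_mem _ fun i _ => Subring.mul_mem _ (algebraMap_mem_Cq u v _)
      (Subring.pow_mem _ (τq_mem_Cq u v) _)
  · have hvK : algebraMap S K v = τq u v * algebraMap S K u := by
      rw [τq, div_mul_cancel₀ _ (algebraMap_ne_zero_of_isFrame hf)]
    rw [Polynomial.eval₂_eq_sum_range, Finset.mul_sum, Finset.mul_sum, ← Finset.sum_add_distrib]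
    refine Finset.sum_congr rfl fun i _ => ?_
    rw [hαβγ i, map_add, map_add, map_mul, map_mul, map_mul, hvK]
    ring

/-- **𝔪_{B♯} = (u, t)**: the maximal ideal of a sharp ring dominated by `O` is generated by `u, t`. -/
theorem maximalIdeal_sharpRing {u v t : S} (hf : IsFrame u v t) (hO : sharpRing u v ≤ O.toSubring)
    [IsLocalRing (sharpRing u v)] :
    IsLocalRing.maximalIdeal (sharpRing u v) =
      Ideal.span {⟨algebraMap S K u, baseRing_le_sharpRing u v (toBase u).2⟩,
        ⟨algebraMap S K t, baseRing_le_sharpRing u v (toBase t).2⟩} := by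
  classical
  have hC : Cq u v ≤ O.toSubring := (le_locAtCentre _ _).trans hO
  obtain ⟨hum, -, htm⟩ := mem_maximalIdeal_of_isFrame hf
  apply le_antisymm
  · intro b hb
    have hvb : O.valuation (b : K) < 1 := (mem_maximalIdeal_locAtCentre_iff hC b).mp hb
    obtain ⟨y, hy, z, hz, hvz, hyz⟩ := (mem_locAtCentre_iff (B := Cq u v) (O := O)).mp b.2
    have hvz' : vX z = 1 := isEquiv_O.eq_one_iff_eq_one.mpr hvz
    have hvy : vX y < 1 := by
      have h := isEquiv_O.lt_one_iff_lt_one.mpr hvb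
      rwa [hyz, map_div₀, hvz', div_one] at h
    obtain ⟨c₁, hc₁, c₂, hc₂, hy'⟩ := exists_eq_of_vX_lt_one hf hy hvy
    have h1 : c₁ / z ∈ sharpRing u v :=
      (mem_locAtCentre_iff (B := Cq u v) (O := O)).mpr ⟨c₁, hc₁, z, hz, hvz, rfl⟩
    have h2 : c₂ / z ∈ sharpRing u v :=
      (mem_locAtCentre_iff (B := Cq u v) (O := O)).mpr ⟨c₂, hc₂, z, hz, hvz, rfl⟩
    have hz0 : z ≠ 0 := by
      intro h; rw [h, map_zero] at hvz; exact zero_ne_one hvz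
    refine Ideal.mem_span_pair.mpr ⟨⟨c₁ / z, h1⟩, ⟨c₂ / z, h2⟩, ?_⟩
    apply Subtype.ext
    change c₁ / z * algebraMap S K u + c₂ / z * algebraMap S K t = (b : K)
    rw [hyz, hy']
    field_simp
  · rw [Ideal.span_le]
    intro x hx
    simp only [Set.mem_insert_iff, Set.mem_singleton_iff] at hx
    rcases hx with rfl | rfl
    · exact (mem_maximalIdeal_locAtCentre_iff hC _).mpr (dominates u hum)
    · exact (mem_maximalIdeal_locAtCentre_iff hC _).mpr (dominates t htm)

/-- **(sharp dimension, PROVED — was `stub_ringKrullDim_sharp` in rev 3)** `dim B♯(u,v) ≤ 2` for a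
frame `(u, v, t)` when `B♯ ≤ O` is regular: its maximal ideal (= the elements of positive value) is
generated by `u, t` (`maximalIdeal_sharpRing`), and `dim = spanFinrank 𝔪 ≤ 2` for a regular local
ring. -/
theorem ringKrullDim_sharp_le {u v t : S} (hf : IsFrame u v t) (hO : sharpRing u v ≤ O.toSubring)
    (hreg : IsRegularLocalRing (sharpRing u v)) : ringKrullDim (sharpRing u v) ≤ 2 := by
  classical
  have hmax := maximalIdeal_sharpRing hf hO
  have hsfr := IsRegularLocalRing.spanFinrank_maximalIdeal (R := sharpRing u v)
  rw [← hsfr, hmax]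
  have h2 := Submodule.spanFinrank_span_le_ncard_of_finite (R := sharpRing u v)
    (Set.toFinite ({⟨algebraMap S K u, baseRing_le_sharpRing u v (toBase u).2⟩,
        ⟨algebraMap S K t, baseRing_le_sharpRing u v (toBase t).2⟩} : Set (sharpRing u v)))
  have h3 : ({⟨algebraMap S K u, baseRing_le_sharpRing u v (toBase u).2⟩,
        ⟨algebraMap S K t, baseRing_le_sharpRing u v (toBase t).2⟩} : Set (sharpRing u v)).ncard ≤ 2 :=
    (Set.ncard_insert_le _ _).trans (by simp)
  exact_mod_cast h2.trans h3

/-- (sharp primes from the dimension bound, PROVED) in `B♯` of dimension `≤ 2` an ideal with regular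
quotient is principal (heights `0, 1`) or the closed point (= the elements of positive value).
Matsumura 14.2 (`exists_isRsopPart_span_range_eq`). -/
theorem regularPrimes_sharp_of_dim (u v : S)
    (hdim : sharpRing u v ≤ O.toSubring → IsRegularLocalRing (sharpRing u v) →
      ringKrullDim (sharpRing u v) ≤ 2) :
    RegularPrimesSharp u v := by
  classical
  intro P hO hB hBP
  haveI := hB
  haveI := hBP
  have hPtop : P ≠ ⊤ := fun h =>
    not_subsingleton (sharpRing u v ⧸ P) (Ideal.Quotient.subsingleton_iff.mpr h)
  have hPm : P ≤ IsLocalRing.maximalIdeal (sharpRing u v) := IsLocalRing.le_maximalIdeal hPtop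
  obtain ⟨r, c, hc, hcP⟩ := exists_isRsopPart_span_range_eq hPm
  obtain ⟨e, y, hre, hspan⟩ := hc.2
  have hre2 : r + e ≤ 2 := by
    have h2 := hdim hO hB
    rw [hre] at h2
    exact_mod_cast h2
  rcases r with _ | _ | _ | r
  · refine Or.inl ⟨0, ?_⟩
    rw [← hcP, Set.range_eq_empty, Ideal.span_empty, eq_comm, Ideal.span_singleton_eq_bot]
  · refine Or.inl ⟨c 0, ?_⟩
    rw [← hcP, range_fin_one]
  · have he : e = 0 := by omega
    subst he
    refine Or.inr fun b hb => ?_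
    have hP : P = IsLocalRing.maximalIdeal (sharpRing u v) := by
      rw [← hcP, ← hspan, Set.range_eq_empty y, Set.union_empty]
    rw [hP]
    exact mem_maximalIdeal_of_valuation_lt_one hO b hb
  · omega

/-- **(sharp regular primes, proved)** the classification of ideals of `B♯(u,v)` with regular quotient, from `dim B♯ ≤ 2`. -/
theorem regularPrimes_sharp (u v t : S) (h : IsFrame u v t) : RegularPrimesSharp u v :=
  regularPrimes_sharp_of_dim u v (ringKrullDim_sharp_le h)

/-! ### `ν = ord` on `B♯` (PROVED — was `stub_paramVal_sharp` in rev 3): ternary forms in a frame -/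

/-- `ν(v/u) = 1` for a frame `(u, v, t)`. -/
theorem vX_τq {u v t : S} (hf : IsFrame u v t) : vX (τq u v) = 1 := by
  obtain ⟨hum, hvm, -⟩ := mem_maximalIdeal_of_isFrame hf
  obtain ⟨hu2, hv2, -⟩ := not_mem_sq_of_isFrame hf
  rw [τq, map_div₀, vX_eq_of_mem_not_mem_sq hum hu2, vX_eq_of_mem_not_mem_sq hvm hv2,
    div_self (WithZero.coe_ne_zero)]

/-- `baseRing ⊆ O`. -/
theorem baseRing_le_O : baseRing ≤ O.toSubring := locAtCentre_le range_le_O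

/-- `S[v/u] ⊆ O` for a frame. -/
theorem Cq_le_O {u v t : S} (hf : IsFrame u v t) : Cq u v ≤ O.toSubring := by
  refine Subring.closure_le.mpr (Set.union_subset baseRing_le_O ?_)
  rintro x rfl
  change τq u v ∈ O
  rw [mem_O_iff, vX_τq hf]

/-- `B♯(u,v) ⊆ O` for a frame. -/
theorem sharpRing_le_O {u v t : S} (hf : IsFrame u v t) : sharpRing u v ≤ O.toSubring :=
  locAtCentre_le (Cq_le_O hf)

/-- Elements of `S[v/u]` have value `≤ 1`. -/
theorem vX_le_one_of_mem_Cq {u v t : S} (hf : IsFrame u v t) {c : K} (hc : c ∈ Cq u v) : vX c ≤ 1 :=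
  (mem_O_iff c).mp (Cq_le_O hf hc)

/-- `eval (formOf P n) = u^n · P(v/u)` whenever `n ≥ deg P`. -/
theorem algebraMap_eval_formOf_of_le (P : Polynomial S) {n : ℕ} (hn : P.natDegree ≤ n) {u v t : S}
    (hu : algebraMap S K u ≠ 0) :
    algebraMap S K (MvPolynomial.eval ![u, v, t] (formOf P n)) =
      algebraMap S K u ^ n * Polynomial.eval₂ (algebraMap S K) (algebraMap S K v / algebraMap S K u) P := by
  rw [eval_formOf, Polynomial.eval₂_eq_sum_range' (algebraMap S K) (Nat.lt_succ_of_le hn), map_sum,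
    Finset.mul_sum]
  refine Finset.sum_congr rfl fun i hi => ?_
  have hi' : i ≤ n := Nat.lt_succ_iff.mp (Finset.mem_range.mp hi)
  obtain ⟨k, hk⟩ := Nat.exists_eq_add_of_le hi'
  rw [hk, Nat.add_sub_cancel_left, map_mul, map_mul, map_pow, map_pow, div_pow, pow_add]
  field_simp

/-- `formOf P n` involves no `X₂`. -/
theorem coeff_formOf_eq_zero (P : Polynomial S) (n : ℕ) {m : Fin 3 →₀ ℕ} (hm : m 2 ≠ 0) :
    (formOf P n).coeff m = 0 := by
  classical
  rw [formOf, MvPolynomial.coeff_sum]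
  refine Finset.sum_eq_zero fun i _ => ?_
  rw [MvPolynomial.coeff_monomial, if_neg]
  intro h
  apply hm
  rw [← h]
  simp

/-- If all coefficients of `P` lie in `𝔪_S` then `P(v/u)` has positive value. -/
theorem vX_eval₂_lt_one_of_coeff_mem {u v t : S} (hf : IsFrame u v t) {P : Polynomial S}
    (h : ∀ i, P.coeff i ∈ IsLocalRing.maximalIdeal S) :
    vX (Polynomial.eval₂ (algebraMap S K) (τq u v) P) < 1 := by
  rw [Polynomial.eval₂_eq_sum_range]
  refine Valuation.map_sum_lt _ one_ne_zero fun i _ => ?_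
  rw [map_mul, map_pow, vX_τq hf, one_pow, mul_one]
  exact isEquiv_O.lt_one_iff_lt_one.mpr (dominates _ (h i))

/-- **Key estimate (ternary).** For `c, d ∈ S[v/u]` not both of positive value,
`ν(c·u + d·t) = ν(X)`: with `c = P(v/u)`, `d = Q(v/u)` and `N ≥ deg P, deg Q`,
`u^N (c u + d t) = H(u,v,t)` for the form `H = X₀·formOf P N + X₂·formOf Q N` of degree `N+1`;
if `ν(cu+dt) ≤ ν(X)²` then `H(u,v,t) ∈ 𝔪_S^{N+2}`, so all coefficients of `H` — which are the
coefficients of `P` and of `Q` — lie in `𝔪_S`, forcing both `c` and `d` into positive value. -/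
theorem vX_cu_add_dt {u v t : S} (hf : IsFrame u v t) {c d : K} (hc : c ∈ Cq u v) (hd : d ∈ Cq u v)
    (h1 : vX c = 1 ∨ vX d = 1) :
    vX (c * algebraMap S K u + d * algebraMap S K t) = WithZero.exp (-1 : ℤ) := by
  classical
  obtain ⟨hum, -, htm⟩ := mem_maximalIdeal_of_isFrame hf
  obtain ⟨hu2, -, ht2⟩ := not_mem_sq_of_isFrame hf
  have hvu : vX (algebraMap S K u) = WithZero.exp (-1 : ℤ) := vX_eq_of_mem_not_mem_sq hum hu2
  have hvt : vX (algebraMap S K t) = WithZero.exp (-1 : ℤ) := vX_eq_of_mem_not_mem_sq htm ht2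
  have hu0 : algebraMap S K u ≠ 0 := algebraMap_ne_zero_of_isFrame hf
  -- upper bound
  have hle : vX (c * algebraMap S K u + d * algebraMap S K t) ≤ WithZero.exp (-1 : ℤ) := by
    refine (Valuation.map_add _ _ _).trans (max_le ?_ ?_)
    · rw [map_mul, hvu]; exact mul_le_of_le_one_left' (vX_le_one_of_mem_Cq hf hc)
    · rw [map_mul, hvt]; exact mul_le_of_le_one_left' (vX_le_one_of_mem_Cq hf hd)
  -- lower bound: not `≤ ν(X)²`
  have hnot : ¬ vX (c * algebraMap S K u + d * algebraMap S K t) ≤ WithZero.exp (-((2 : ℕ) : ℤ)) := by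
    intro hle2
    obtain ⟨P, rfl⟩ := exists_polynomial_of_mem_closure hc
    obtain ⟨Q, rfl⟩ := exists_polynomial_of_mem_closure hd
    set N := max P.natDegree Q.natDegree with hN
    have hPN : P.natDegree ≤ N := le_max_left _ _
    have hQN : Q.natDegree ≤ N := le_max_right _ _
    set H : MvPolynomial (Fin 3) S :=
      MvPolynomial.X 0 * formOf P N + MvPolynomial.X 2 * formOf Q N with hH
    have hHhom : H.IsHomogeneous (1 + N) :=
      ((MvPolynomial.isHomogeneous_X S 0).mul (isHomogeneous_formOf P N)).add
        ((MvPolynomial.isHomogeneous_X S 2).mul (isHomogeneous_formOf Q N))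
    have hevalH : algebraMap S K (MvPolynomial.eval ![u, v, t] H) =
        algebraMap S K u ^ N *
          (Polynomial.eval₂ (algebraMap S K) (algebraMap S K v / algebraMap S K u) P *
              algebraMap S K u +
            Polynomial.eval₂ (algebraMap S K) (algebraMap S K v / algebraMap S K u) Q *
              algebraMap S K t) := by
      rw [hH, map_add, map_mul, map_mul, MvPolynomial.eval_X, MvPolynomial.eval_X, map_add, map_mul,
        map_mul, algebraMap_eval_formOf_of_le P hPN hu0, algebraMap_eval_formOf_of_le Q hQN hu0]
      simp only [Matrix.cons_val_zero, Matrix.cons_val_two, Matrix.tail_cons, Matrix.head_cons]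
      ring
    have hvalH : vX (algebraMap S K (MvPolynomial.eval ![u, v, t] H)) ≤
        WithZero.exp (-((1 + N + 1 : ℕ) : ℤ)) := by
      rw [hevalH, map_mul, map_pow, hvu, ← WithZero.exp_nsmul]
      calc WithZero.exp (N • (-1 : ℤ)) * vX (Polynomial.eval₂ (algebraMap S K)
              (algebraMap S K v / algebraMap S K u) P * algebraMap S K u +
            Polynomial.eval₂ (algebraMap S K) (algebraMap S K v / algebraMap S K u) Q *
              algebraMap S K t)
          ≤ WithZero.exp (N • (-1 : ℤ)) * WithZero.exp (-((2 : ℕ) : ℤ)) := mul_le_mul' le_rfl hle2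
        _ = WithZero.exp (-((1 + N + 1 : ℕ) : ℤ)) := by
          rw [← WithZero.exp_add]; congr 1; push_cast; ring
    have hmem := mem_pow_of_vX_le hvalH
    have hx : Ideal.span (Set.range ![u, v, t]) = IsLocalRing.maximalIdeal S := by
      rw [range_vec3]; exact hf
    have key := coeff_mem_maximalIdeal_of_eval_mem_pow spanFinrank_maximalIdeal_S ![u, v, t] hx
      hHhom hmem
    -- the coefficients of `P` and `Q` are coefficients of `H`
    have hP : ∀ i, P.coeff i ∈ IsLocalRing.maximalIdeal S := by
      intro i
      by_cases hi : i ≤ N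
      swap
      · rw [Polynomial.coeff_eq_zero_of_natDegree_lt (lt_of_le_of_lt hPN (not_le.mp hi))]
        exact Ideal.zero_mem _
      have hk := key (Finsupp.single 0 1 + (Finsupp.single 0 (N - i) + Finsupp.single 1 i))
      rw [hH, MvPolynomial.coeff_add, MvPolynomial.coeff_X_mul', MvPolynomial.coeff_X_mul',
        if_pos (by simp), if_neg (by simp), add_tsub_cancel_left,
        coeff_formOf P hi, add_zero] at hk
      exact hk
    have hQ : ∀ i, Q.coeff i ∈ IsLocalRing.maximalIdeal S := by
      intro i
      by_cases hi : i ≤ N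
      swap
      · rw [Polynomial.coeff_eq_zero_of_natDegree_lt (lt_of_le_of_lt hQN (not_le.mp hi))]
        exact Ideal.zero_mem _
      have hk := key (Finsupp.single 2 1 + (Finsupp.single 0 (N - i) + Finsupp.single 1 i))
      rw [hH, MvPolynomial.coeff_add, MvPolynomial.coeff_X_mul', MvPolynomial.coeff_X_mul',
        if_pos (show (2 : Fin 3) ∈ _ by simp), add_tsub_cancel_left, coeff_formOf Q hi] at hk
      have h0 : (if (0 : Fin 3) ∈ (Finsupp.single 2 1 +
            (Finsupp.single 0 (N - i) + Finsupp.single 1 i) : Fin 3 →₀ ℕ).support then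
          (formOf P N).coeff (Finsupp.single 2 1 + (Finsupp.single 0 (N - i) + Finsupp.single 1 i) -
            Finsupp.single 0 1) else 0) = 0 := by
        split_ifs with h0
        · apply coeff_formOf_eq_zero
          simp
        · rfl
      rw [h0, zero_add] at hk
      exact hk
    have hc1 := vX_eval₂_lt_one_of_coeff_mem hf hP
    have hd1 := vX_eval₂_lt_one_of_coeff_mem hf hQ
    rw [τq] at hc1 hd1
    rcases h1 with h1 | h1
    · exact absurd h1 (ne_of_lt hc1)
    · exact absurd h1 (ne_of_lt hd1)
  have hne : vX (c * algebraMap S K u + d * algebraMap S K t) ≠ 0 := fun h0 => by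
    rw [h0] at hnot; exact hnot zero_le
  rw [← WithZero.exp_log hne] at hle hnot ⊢
  rw [WithZero.exp_le_exp] at hle hnot
  rw [WithZero.exp_inj]
  omega

/-- **(sharp ParamVal, PROVED — was `stub_paramVal_sharp` in rev 3)** `ν = ord` on `B♯(u,v)`:
an element of `𝔪 ∖ 𝔪²`, `𝔪 = (u, t)`, is `a u + b t` with `a` or `b` a unit, and clearing the
denominators of `a, b ∈ S[v/u]_𝔮` reduces to `vX_cu_add_dt`. -/
theorem paramVal_sharp (u v t : S) (hf : IsFrame u v t) : ParamVal (sharpRing u v) := by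
  classical
  intro hreg z hz hz2
  have hO := sharpRing_le_O hf
  have hC : Cq u v ≤ O.toSubring := Cq_le_O hf
  have hmax := maximalIdeal_sharpRing hf hO
  set uB : sharpRing u v := ⟨algebraMap S K u, baseRing_le_sharpRing u v (toBase u).2⟩ with huB
  set tB : sharpRing u v := ⟨algebraMap S K t, baseRing_le_sharpRing u v (toBase t).2⟩ with htB
  have huBm : uB ∈ IsLocalRing.maximalIdeal (sharpRing u v) := by
    rw [hmax]; exact Ideal.subset_span (by simp)
  have htBm : tB ∈ IsLocalRing.maximalIdeal (sharpRing u v) := by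
    rw [hmax]; exact Ideal.subset_span (by simp)
  have hz' := hz
  rw [hmax] at hz'
  obtain ⟨a, b, hab⟩ := Ideal.mem_span_pair.mp hz'
  have hnot : ¬ (a ∈ IsLocalRing.maximalIdeal (sharpRing u v) ∧
      b ∈ IsLocalRing.maximalIdeal (sharpRing u v)) := by
    rintro ⟨ha, hb⟩
    apply hz2
    rw [← hab, pow_two]
    exact Ideal.add_mem _ (Ideal.mul_mem_mul ha huBm) (Ideal.mul_mem_mul hb htBm)
  -- units have value one
  have hval1 : ∀ x : sharpRing u v, x ∉ IsLocalRing.maximalIdeal (sharpRing u v) → vX (x : K) = 1 := by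
    intro x hx
    have hx1 : ¬ O.valuation (x : K) < 1 := fun h => hx ((mem_maximalIdeal_locAtCentre_iff hC x).mpr h)
    have hxle : vX (x : K) ≤ 1 := (mem_O_iff _).mp (hO x.2)
    have hx1' : ¬ vX (x : K) < 1 := fun h => hx1 (isEquiv_O.lt_one_iff_lt_one.mp h)
    exact le_antisymm hxle (not_lt.mp hx1')
  obtain ⟨a₁, ha₁, z₁, hz₁, hvz₁, haz⟩ := (mem_locAtCentre_iff (B := Cq u v) (O := O)).mp a.2
  obtain ⟨b₁, hb₁, z₂, hz₂, hvz₂, hbz⟩ := (mem_locAtCentre_iff (B := Cq u v) (O := O)).mp b.2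
  have hvz₁' : vX z₁ = 1 := isEquiv_O.eq_one_iff_eq_one.mpr hvz₁
  have hvz₂' : vX z₂ = 1 := isEquiv_O.eq_one_iff_eq_one.mpr hvz₂
  have hz₁0 : z₁ ≠ 0 := by intro h; rw [h, map_zero] at hvz₁; exact zero_ne_one hvz₁
  have hz₂0 : z₂ ≠ 0 := by intro h; rw [h, map_zero] at hvz₂; exact zero_ne_one hvz₂
  have hzK : (z : K) = ((a₁ * z₂) * algebraMap S K u + (b₁ * z₁) * algebraMap S K t) / (z₁ * z₂) := by
    have h := congrArg Subtype.val hab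
    simp only [Subring.coe_add, Subring.coe_mul] at h
    rw [← h, haz, hbz]
    field_simp
    ring
  have h1 : vX (a₁ * z₂) = 1 ∨ vX (b₁ * z₁) = 1 := by
    by_cases ha : a ∈ IsLocalRing.maximalIdeal (sharpRing u v)
    · have hb : b ∉ IsLocalRing.maximalIdeal (sharpRing u v) := fun hb => hnot ⟨ha, hb⟩
      right
      have := hval1 b hb
      rw [hbz, map_div₀, hvz₂', div_one] at this
      rw [map_mul, this, hvz₁', one_mul]
    · left
      have := hval1 a ha
      rw [haz, map_div₀, hvz₁', div_one] at this
      rw [map_mul, this, hvz₂', one_mul]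
  have key := vX_cu_add_dt hf (Subring.mul_mem _ ha₁ hz₂) (Subring.mul_mem _ hb₁ hz₁) h1
  apply isEquiv_O.eq_iff.mp
  rw [hzK, map_div₀, key, map_mul, hvz₁', hvz₂', mul_one, div_one, vX_X]

/-! ### Fifth roots on `B♯`: `UnitRes` via the coefficient statement (PROVED) -/

/-- An element of `S` of positive value lies in `𝔪_S`. -/
theorem mem_maximalIdeal_S_of_vX_lt_one {s : S} (h : vX (algebraMap S K s) < 1) :
    s ∈ IsLocalRing.maximalIdeal S := by
  by_contra hs
  have hu : IsUnit s := by
    simpa [IsLocalRing.mem_maximalIdeal, mem_nonunits_iff] using hs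
  obtain ⟨w, hw⟩ := hu.exists_right_inv
  have h1 : vX (algebraMap S K s) * vX (algebraMap S K w) = 1 := by
    rw [← map_mul, ← map_mul, hw, map_one, map_one]
  have hw1 : vX (algebraMap S K w) ≤ 1 := (mem_O_iff _).mp (range_le_O ⟨w, rfl⟩)
  have h2 : vX (algebraMap S K s) * vX (algebraMap S K w) < 1 :=
    lt_of_le_of_lt (mul_le_mul_right hw1 _) (by rwa [mul_one])
  rw [h1] at h2
  exact lt_irrefl _ h2

/-- Residues of `S` are constants: every `s ∈ S` is congruent to some `c ∈ 𝔽₅` modulo `𝔪_S`. -/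
theorem exists_sub_C_mem_maximalIdeal (s : S) :
    ∃ c : k₀, s - algebraMap A S (MvPolynomial.C c) ∈ IsLocalRing.maximalIdeal S := by
  obtain ⟨⟨a, b⟩, hab⟩ := IsLocalization.mk'_surjective m0.primeCompl s
  change IsLocalization.mk' S a b = s at hab
  subst hab
  have hb0 : MvPolynomial.constantCoeff (b : A) ≠ 0 := fun h =>
    b.2 ((mem_originIdeal_iff k₀ 3).mpr h)
  set c : k₀ := MvPolynomial.constantCoeff a / MvPolynomial.constantCoeff (b : A) with hc
  refine ⟨c, ?_⟩
  apply mem_maximalIdeal_S_of_vX_lt_one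
  have hmem : a - MvPolynomial.C c * (b : A) ∈ m0 := by
    rw [mem_originIdeal_iff k₀ 3, map_sub, map_mul, MvPolynomial.constantCoeff_C, hc,
      div_mul_cancel₀ _ hb0, sub_self]
  have hψb : vX (ψ b) = 1 := vX_ψ_eq_one b.2
  have hψb0 : ψ (b : A) ≠ 0 := fun h => by rw [h, map_zero] at hψb; exact zero_ne_one hψb
  rw [map_sub, algebraMap_mk', ← ψ_eq_algebraMap]
  have heq : ψ a / ψ b - ψ (MvPolynomial.C c) = ψ (a - MvPolynomial.C c * (b : A)) / ψ b := by
    rw [map_sub, map_mul]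
    field_simp
  rw [heq, map_div₀, hψb, div_one]
  exact vX_ψ_lt_one hmem

/-- `P(v/u) ∈ S[v/u]` for `P ∈ S[T]`. -/
theorem eval₂_mem_Cq (u v : S) (P : Polynomial S) :
    Polynomial.eval₂ (algebraMap S K) (τq u v) P ∈ Cq u v := by
  rw [Polynomial.eval₂_eq_sum_range]
  exact Subring.sum_mem _ fun i _ =>
    Subring.mul_mem _ (algebraMap_mem_Cq u v _) (Subring.pow_mem _ (τq_mem_Cq u v) _)

/-- helper (PROVED): reindex a sum over `range (5 * L)` by residues mod `5`. -/
theorem sum_range_five_mul (g : ℕ → K) (L : ℕ) :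
    ∑ i ∈ Finset.range (5 * L), g i =
      ∑ r ∈ Finset.range 5, ∑ q ∈ Finset.range L, g (5 * q + r) := by
  induction L with
  | zero => simp
  | succ L ih =>
    rw [show 5 * (L + 1) = 5 * L + 5 by ring, Finset.sum_range_add, ih, ← Finset.sum_add_distrib]
    refine Finset.sum_congr rfl fun r _ => ?_
    rw [Finset.sum_range_succ]

/-! NOTE (LI5: `1, τ̄, τ̄², τ̄³, τ̄⁴` are linearly independent over `k'^5`) — rev 5 had this as the
only stub; rev 6 proved it from `FL` (generic field lemma) and `T5` (`v/u` is not a fifth power mod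
`𝔪_ν`), both PROVED by rev 7 below.  HISTORICAL statement: for a frame `(u, v, t)` of `S`, `τ = v/u`, and `W₀, …, W₄ ∈ K` of value
`≤ 1` (i.e. in `O`): if `ν(Σ_{r<5} τ^r W_r^5) < 1` then every `ν(W_r) < 1`.
RESIDUE PICTURE (= the mathematical content): in `κ(O) = k' = 𝔽₅(y₁, w₁)` (`O = k'[X]_{(X)}`) the
residue of `τ` is `τ̄ = ε·ℓ_v(1,y₁,w₁)/ℓ_u(1,y₁,w₁)` (`ε ∈ 𝔽₅ˣ`; `ℓ_u, ℓ_v, ℓ_t` the linearly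
independent linear parts of the frame, cf. `coeff_mem_maximalIdeal_of_eval_mem_pow` with `n = 1`),
and the claim reads `Σ_{r<5} τ̄^r w̄_r^5 = 0 ⇒ all w̄_r = 0`.  PLAN: (1) `τ̄ ∉ k'^5` — else
`ℓ_v ℓ_u^4 = H^5·G^{-5}`, i.e. `ℓ_v ℓ_u^4 G^5 = H^5` in the UFD `𝔽₅[y₁, w₁]`; compare the
multiplicity of the irreducible degree-one factor `ℓ_u(1,y₁,w₁)` (or, if `ℓ_u(1,y₁,w₁)` is constant,
i.e. `ℓ_u = x`, of `ℓ_v(1,y₁,w₁)`; both constant is excluded by independence) — it is `≡ 4` or `≡ 1`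
`(mod 5)` on the left (`ℓ_v ∉ 𝔽₅ ℓ_u`) and `≡ 0` on the right; (2) minimal polynomial: the monic
generator `μ` of `{Π ∈ k'^5[T] : Π(τ̄) = 0}` divides `T^5 - τ̄^5 = (T - τ̄)^5` in `k'[T]`, so
`μ = (T - τ̄)^m` (`Polynomial.prime_X_sub_C`, `dvd_prime_pow`, monic + associated ⇒ equal), its
constant coefficient gives `τ̄^m ∈ k'^5`, and `1 ≤ m ≤ 4` would give `τ̄ ∈ k'^5` (Bézout with `5`);
hence `m = 5` and a relation `Σ_{r<5} w̄_r^5 T^r` of degree `≤ 4` vanishes identically.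
IN `K`-TERMS (no residue-field API needed): clear denominators in `k'[X]` and read off constant
coefficients (`Polynomial.X_dvd_iff`, as in `vX`'s definition via `intValuation`).
ALTERNATIVE (b): binary forms — with `5 ∣ N`, `Σ_r ℓ_v^r ℓ_u^{N-r}·(form)_r^5` a fifth power of a
form in `𝔽₅[x,y,w]`; substitute `(ℓ_u, ℓ_v, ℓ_t) ↦ (x, y, w)` and compare exponents of `y` mod 5. -/

/-! #### Residue-field plumbing for `O` and the two kernel lemmas `FL`, `T5` (PROVED) -/

/-- The residue field `κ(O)` (abstractly; it is `k' = 𝔽₅(y₁, w₁)`). -/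
abbrev κO : Type := IsLocalRing.ResidueField O

/-- `O` has characteristic `5`. -/
theorem charP_Osub : CharP O 5 := by
  haveI := charP_K
  refine ⟨fun n => ?_⟩
  rw [← CharP.cast_eq_zero_iff K 5 n]
  constructor
  · intro h
    have := congrArg Subtype.val h
    simpa using this
  · intro h
    exact Subtype.ext (by simpa using h)

/-- The residue field `κ(O)` has characteristic `5`. -/
theorem charP_κO : CharP κO 5 := by
  haveI := charP_Osub
  exact CharP.of_ringHom_of_ne_zero (IsLocalRing.residue O) 5 (by norm_num)

/-- `vX x ≤ 1 ⇒ x ∈ O`. -/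
theorem mem_O_of_vX_le_one {x : K} (h : vX x ≤ 1) : x ∈ O :=
  (O.valuation_le_one_iff x).mp (isEquiv_O.le_one_iff_le_one.mp h)

/-- An element of `O` has residue `0` iff its value is `< 1`. -/
theorem residue_eq_zero_iff_vX_lt_one (x : O) :
    IsLocalRing.residue O x = 0 ↔ vX (x : K) < 1 := by
  rw [IsLocalRing.residue_eq_zero_iff, ValuationSubring.valuation_lt_one_iff,
    ← isEquiv_O.lt_one_iff_lt_one]

/-- (FL — generic field lemma, PROVED: "`1, a, …, a⁴` are linearly independent over `F^5` when
`a ∉ F^5`").  For a field `F` of characteristic `5` and `a ∈ F` not a fifth power: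
`Σ_{r<5} a^r w_r^5 = 0 ⇒ w_r = 0` for all `r < 5`.
PLAN (minimal polynomial over the subfield `F^5 = (frobenius F 5).fieldRange`): `a` is a root of
`T^5 - a^5 ∈ F^5[T]`, so `μ := minpoly F^5 a` divides it (`minpoly.dvd`); in `F[T]`,
`T^5 - C a^5 = (T - C a)^5` (`sub_pow_char`), hence `μ.map = (T - C a)^m` with `1 ≤ m ≤ 5`
(`Polynomial.prime_X_sub_C`, `dvd_prime_pow`, `eq_of_monic_of_associated`); the constant coefficient
gives `a^m ∈ F^5`, and for `m ∈ {1,2,3,4}` Bézout (`a = (a^2)^3/a^5 = (a^3)^2/a^5 = (a^4)^4/(a^5)^3`;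
`a ≠ 0` since `0 = 0^5`) yields `a ∈ F^5`, contradiction; so `deg μ = 5`, and the relation
`Σ_{r<5} C(w_r^5) T^r ∈ F^5[T]` of degree `≤ 4` vanishing at `a` is divisible by `μ`, hence zero;
finally `w_r^5 = 0 ⇒ w_r = 0`. -/
theorem FL (F : Type) [Field F] [CharP F 5] (a : F) (ha : ∀ e : F, e ^ 5 ≠ a) (w : ℕ → F)
    (h : ∑ r ∈ Finset.range 5, a ^ r * w r ^ 5 = 0) (r : ℕ) (hr : r < 5) : w r = 0 := by
  classical
  haveI : Fact (Nat.Prime 5) := ⟨by norm_num⟩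
  haveI : ExpChar F 5 := ExpChar.prime (by norm_num)
  open Polynomial in
  -- the subfield of fifth powers
  set F5 : Subfield F := (frobenius F 5).fieldRange with hF5
  have hmem : ∀ x : F, x ^ 5 ∈ F5 := fun x => ⟨x, rfl⟩
  have ha0 : a ≠ 0 := fun h0 => ha 0 (by rw [h0]; ring)
  -- `a` is integral over `F5`, root of `T^5 - a^5`
  set a5 : F5 := ⟨a ^ 5, hmem a⟩ with ha5
  set P5 : Polynomial F5 := Polynomial.X ^ 5 - Polynomial.C a5 with hP5
  have hP5a : Polynomial.aeval a P5 = 0 := by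
    simp only [hP5, map_sub, map_pow, Polynomial.aeval_X, Polynomial.aeval_C]
    exact sub_self _
  have hint : IsIntegral F5 a :=
    ⟨P5, Polynomial.monic_X_pow_sub_C a5 (by norm_num), by simpa [Polynomial.aeval_def] using hP5a⟩
  set μ := minpoly F5 a with hμ
  have hμdvd : μ ∣ P5 := minpoly.dvd F5 a hP5a
  have hinj : Function.Injective (algebraMap F5 F) := (algebraMap F5 F).injective
  set μF := μ.map (algebraMap F5 F) with hμF
  have hμFmonic : μF.Monic := (minpoly.monic hint).map _
  have hXa : (Polynomial.X - Polynomial.C a : Polynomial F) ^ 5 =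
      Polynomial.X ^ 5 - Polynomial.C (a ^ 5) := by
    rw [sub_pow_char, ← Polynomial.C_pow]
  have hμFdvd : μF ∣ (Polynomial.X - Polynomial.C a) ^ 5 := by
    have hP5map : P5.map (algebraMap F5 F) = Polynomial.X ^ 5 - Polynomial.C (a ^ 5) := by
      rw [hP5, Polynomial.map_sub, Polynomial.map_pow, Polynomial.map_X, Polynomial.map_C]; rfl
    rw [hXa, hμF, ← hP5map]; exact Polynomial.map_dvd _ hμdvd
  obtain ⟨m, hm5, hassoc⟩ := (dvd_prime_pow (Polynomial.prime_X_sub_C a) 5).mp hμFdvd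
  have hμFeq : μF = (Polynomial.X - Polynomial.C a) ^ m :=
    Polynomial.eq_of_monic_of_associated hμFmonic ((Polynomial.monic_X_sub_C a).pow m) hassoc
  -- `m ≥ 1`
  have hm1 : 1 ≤ m := by
    by_contra hm0
    have hm0' : m = 0 := by omega
    rw [hm0', pow_zero] at hμFeq
    apply minpoly.ne_one F5 a
    apply Polynomial.map_injective _ hinj
    rw [Polynomial.map_one]; exact hμFeq
  -- constant coefficient: `a^m ∈ F^5`
  have hcoeff : ∃ y : F, y ^ 5 = a ^ m := by
    have h0 : μF.coeff 0 = (-a) ^ m := by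
      rw [hμFeq, Polynomial.coeff_zero_eq_eval_zero, Polynomial.eval_pow, Polynomial.eval_sub,
        Polynomial.eval_X, Polynomial.eval_C, zero_sub]
    have h1 : μF.coeff 0 = ((μ.coeff 0 : F5) : F) := by
      rw [hμF, Polynomial.coeff_map]; rfl
    obtain ⟨x, hx⟩ := (μ.coeff 0).2
    refine ⟨(-1) ^ m * x, ?_⟩
    have hx' : x ^ 5 = (-a) ^ m := by
      rw [← h0, h1]; exact hx
    rw [mul_pow, hx', ← pow_mul, neg_pow a]
    rw [← mul_assoc, ← pow_add]
    rw [show m * 5 + m = 2 * (3 * m) by ring, pow_mul, neg_one_sq, one_pow, one_mul]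
  -- `m = 5`
  have hm : m = 5 := by
    obtain ⟨y, hy⟩ := hcoeff
    rcases (show m = 1 ∨ m = 2 ∨ m = 3 ∨ m = 4 ∨ m = 5 by omega) with h1 | h2 | h3 | h4 | h5
    · exact absurd (by rw [hy, h1, pow_one]) (ha y)
    · refine absurd ?_ (ha (y ^ 3 / a))
      rw [div_pow, ← pow_mul, show 3 * 5 = 5 * 3 by rfl, pow_mul, hy, h2]
      field_simp
    · refine absurd ?_ (ha (y ^ 2 / a))
      rw [div_pow, ← pow_mul, show 2 * 5 = 5 * 2 by rfl, pow_mul, hy, h3]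
      field_simp
    · refine absurd ?_ (ha (y ^ 4 / a ^ 3))
      rw [div_pow, ← pow_mul, ← pow_mul, show 4 * 5 = 5 * 4 by rfl, pow_mul, hy, h4]
      field_simp
    · exact h5
  have hdeg : μ.natDegree = 5 := by
    have : μF.natDegree = 5 := by
      rw [hμFeq, hm, Polynomial.natDegree_pow, Polynomial.natDegree_X_sub_C]
    rwa [hμF, Polynomial.natDegree_map_eq_of_injective hinj] at this
  -- the relation polynomial
  set w5 : ℕ → F5 := fun r => ⟨w r ^ 5, hmem (w r)⟩ with hw5
  set Q : Polynomial F5 := ∑ r ∈ Finset.range 5, Polynomial.C (w5 r) * Polynomial.X ^ r with hQ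
  have hQcoeff : ∀ N, Q.coeff N = if N ∈ Finset.range 5 then w5 N else 0 := by
    intro N
    rw [hQ, Polynomial.finsetSum_coeff]
    simp only [Polynomial.coeff_C_mul_X_pow]
    rw [Finset.sum_ite_eq]
  have hQa : Polynomial.aeval a Q = 0 := by
    rw [hQ, map_sum]
    simp only [map_mul, map_pow, Polynomial.aeval_C, Polynomial.aeval_X]
    rw [← h]
    refine Finset.sum_congr rfl fun r _ => ?_
    rw [mul_comm]; rfl
  have hQdeg : Q.natDegree ≤ 4 := by
    rw [Polynomial.natDegree_le_iff_coeff_eq_zero]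
    intro N hN
    rw [hQcoeff, if_neg (by simpa [Finset.mem_range] using by omega)]
  have hQ0 : Q = 0 := by
    by_contra hne
    have := Polynomial.natDegree_le_of_dvd (minpoly.dvd F5 a hQa) hne
    rw [← hμ, hdeg] at this
    omega
  have : w5 r = 0 := by
    have := hQcoeff r
    rw [hQ0, Polynomial.coeff_zero, if_pos (Finset.mem_range.mpr hr)] at this
    exact this.symm
  have : w r ^ 5 = 0 := by simpa [hw5] using congrArg Subtype.val this
  exact pow_eq_zero_iff (by norm_num) |>.mp this

/-! #### Linear parts (towards T5): `L_j(a)` = dehomogenised degree-`j` part of `a ∈ 𝔽₅[x,y,w]` -/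

/-- `L_j(a) ∈ A₂ = 𝔽₅[y₁, w₁]`: the coefficient of `x^j` in `θ a`, i.e. the degree-`j` part of `a`
dehomogenised at `x = 1` (`(ψ₀ a).coeff j = algebraMap A₂ k' (Lj a j)`, `coeff_ψ₀`). -/
def Lj (a : A) (j : ℕ) : A₂ := (MvPolynomial.finSuccEquiv k₀ 2 (θ a)).coeff j

/-- `L₀(a)` is the constant term of `a`. -/
theorem L0_eq (a : A) : Lj a 0 = MvPolynomial.C (MvPolynomial.constantCoeff a) := by
  apply IsFractionRing.injective A₂ kp
  rw [Lj, ← coeff_ψ₀, Polynomial.coeff_zero_eq_eval_zero, eval_zero_ψ₀]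

/-- `L₀(a) = 0` for `a ∈ 𝔪₀`. -/
theorem L0_eq_zero {a : A} (ha : a ∈ m0) : Lj a 0 = 0 := by
  rw [L0_eq, (mem_originIdeal_iff k₀ 3).mp ha, map_zero]

/-- `L₁` is additive. -/
theorem L1_add (a b : A) : Lj (a + b) 1 = Lj a 1 + Lj b 1 := by
  simp only [Lj, map_add, Polynomial.coeff_add]

/-- `L₁(ab) = L₁(a)·L₀(b)` for `a ∈ 𝔪₀`. -/
theorem L1_mul {a : A} (ha : a ∈ m0) (b : A) : Lj (a * b) 1 = Lj a 1 * Lj b 0 := by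
  have h0 : Lj a 0 = 0 := L0_eq_zero ha
  unfold Lj at h0 ⊢
  show (MvPolynomial.finSuccEquiv k₀ 2 (θ (a * b))).coeff (0 + 1) = _
  rw [map_mul, map_mul, Polynomial.coeff_mul, Finset.Nat.sum_antidiagonal_succ,
    Finset.Nat.antidiagonal_zero, Finset.sum_singleton]
  simp only [zero_add]
  rw [h0]; ring

/-- `a ∈ 𝔪₀` with vanishing linear part lies in `𝔪₀²`. -/
theorem mem_sq_of_L1_eq_zero {a : A} (ha : a ∈ m0) (h : Lj a 1 = 0) : a ∈ m0 ^ 2 := by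
  by_contra h2
  exact linearPart_ne_zero ha h2 h

/-- If `a/b = s ∈ 𝔪_S` then `a ∈ 𝔪₀`. -/
theorem mem_m0_of_mk'_eq {a : A} {b : m0.primeCompl} {s : S} (hs : IsLocalization.mk' S a b = s)
    (hm : s ∈ IsLocalRing.maximalIdeal S) : a ∈ m0 := by
  rw [← hs] at hm
  exact (IsLocalization.AtPrime.mk'_mem_maximal_iff S m0 a b).mp hm

/-- **(linear-part independence, PROVED)** for a frame `(u, v, t)` with `u = a_u/b_u`,
`v = a_v/b_v`: the degree-`≤ 1` polynomials `Λ_u = L₁(a_u)·L₀(b_v)` and `Λ_v = L₁(a_v)·L₀(b_u)` of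
`𝔽₅[y₁, w₁]` admit no non-trivial `𝔽₅`-relation.  (A relation gives `c₁'u + c₂'v ∈ 𝔪_S²` with unit
coefficients, contradicting `coeff_mem_maximalIdeal_of_eval_mem_pow` for the linear form
`c₁'X₀ + c₂'X₁` in the rsop `(u, v, t)`.) -/
theorem linearParts_independent {u v t : S} (hf : IsFrame u v t) {au av : A}
    {bu bv : m0.primeCompl} (hu : IsLocalization.mk' S au bu = u)
    (hv : IsLocalization.mk' S av bv = v) (c₁ c₂ : k₀)
    (h : MvPolynomial.C c₁ * (Lj au 1 * Lj (bv : A) 0) +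
      MvPolynomial.C c₂ * (Lj av 1 * Lj (bu : A) 0) = 0) : c₁ = 0 ∧ c₂ = 0 := by
  classical
  obtain ⟨hum, hvm, -⟩ := mem_maximalIdeal_of_isFrame hf
  have hau : au ∈ m0 := mem_m0_of_mk'_eq hu hum
  have hav : av ∈ m0 := mem_m0_of_mk'_eq hv hvm
  -- the element of `A` with vanishing linear part
  set a : A := au * ((bv : A) * MvPolynomial.C c₁) + av * ((bu : A) * MvPolynomial.C c₂) with ha
  have ham : a ∈ m0 :=
    Ideal.add_mem _ (Ideal.mul_mem_right _ _ hau) (Ideal.mul_mem_right _ _ hav)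
  have hL1' : Lj a 1 = MvPolynomial.C c₁ * (Lj au 1 * Lj (bv : A) 0) +
      MvPolynomial.C c₂ * (Lj av 1 * Lj (bu : A) 0) := by
    rw [ha, L1_add, L1_mul hau, L1_mul hav, L0_eq ((bv : A) * MvPolynomial.C c₁),
      L0_eq ((bu : A) * MvPolynomial.C c₂), L0_eq (bv : A), L0_eq (bu : A)]
    simp only [map_mul, MvPolynomial.constantCoeff_C]
    ring
  have hL1 : Lj a 1 = 0 := hL1'.trans h
  have ha2 : a ∈ m0 ^ 2 := mem_sq_of_L1_eq_zero ham hL1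
  -- push to `S`
  have hmap : Ideal.map (algebraMap A S) m0 = IsLocalRing.maximalIdeal S :=
    IsLocalization.AtPrime.map_eq_maximalIdeal m0 S
  have haS : algebraMap A S a ∈ IsLocalRing.maximalIdeal S ^ 2 := by
    rw [← hmap, ← Ideal.map_pow]; exact Ideal.mem_map_of_mem _ ha2
  set c₁' : S := algebraMap A S (MvPolynomial.C c₁) with hc₁'
  set c₂' : S := algebraMap A S (MvPolynomial.C c₂) with hc₂'
  have hbu : IsUnit (algebraMap A S (bu : A)) := IsLocalization.map_units S bu
  have hbv : IsUnit (algebraMap A S (bv : A)) := IsLocalization.map_units S bv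
  have hrel : algebraMap A S a =
      (algebraMap A S (bu : A) * algebraMap A S (bv : A)) * (c₁' * u + c₂' * v) := by
    have h1 : algebraMap A S au = u * algebraMap A S (bu : A) := by
      rw [← hu]; exact (IsLocalization.mk'_spec S au bu).symm
    have h2 : algebraMap A S av = v * algebraMap A S (bv : A) := by
      rw [← hv]; exact (IsLocalization.mk'_spec S av bv).symm
    rw [ha, map_add, map_mul, map_mul, map_mul, map_mul, h1, h2]
    ring
  have hsum : c₁' * u + c₂' * v ∈ IsLocalRing.maximalIdeal S ^ 2 := by
    rw [hrel] at haS
    exact (Ideal.unit_mul_mem_iff_mem _ (hbu.mul hbv)).mp haS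
  -- the linear form `c₁' X₀ + c₂' X₁` in the rsop `(u, v, t)`
  set F : MvPolynomial (Fin 3) S :=
    MvPolynomial.C c₁' * MvPolynomial.X 0 + MvPolynomial.C c₂' * MvPolynomial.X 1 with hF
  have hFh : F.IsHomogeneous 1 := by
    rw [hF]
    refine MvPolynomial.IsHomogeneous.add ?_ ?_
    · simpa using (MvPolynomial.isHomogeneous_C (Fin 3) c₁').mul (MvPolynomial.isHomogeneous_X S 0)
    · simpa using (MvPolynomial.isHomogeneous_C (Fin 3) c₂').mul (MvPolynomial.isHomogeneous_X S 1)
  have hFe : MvPolynomial.eval ![u, v, t] F = c₁' * u + c₂' * v := by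
    simp [hF]
  have hx : Ideal.span (Set.range ![u, v, t]) = IsLocalRing.maximalIdeal S := by
    rw [range_vec3]; exact hf
  have key := coeff_mem_maximalIdeal_of_eval_mem_pow spanFinrank_maximalIdeal_S ![u, v, t] hx
    hFh (by rw [hFe]; exact hsum)
  have hc1F : F.coeff (Finsupp.single 0 1) = c₁' := by
    rw [hF, MvPolynomial.coeff_add, MvPolynomial.coeff_C_mul, MvPolynomial.coeff_C_mul,
      MvPolynomial.coeff_X, MvPolynomial.coeff_X, if_pos rfl, if_neg]
    · ring
    · intro h0
      have := Finsupp.single_left_injective (one_ne_zero) |>.eq_iff.mp h0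
      exact absurd this (by decide)
  have hc2F : F.coeff (Finsupp.single 1 1) = c₂' := by
    rw [hF, MvPolynomial.coeff_add, MvPolynomial.coeff_C_mul, MvPolynomial.coeff_C_mul,
      MvPolynomial.coeff_X, MvPolynomial.coeff_X, if_neg, if_pos rfl]
    · ring
    · intro h0
      have := Finsupp.single_left_injective (one_ne_zero) |>.eq_iff.mp h0
      exact absurd this (by decide)
  have h1 := key (Finsupp.single 0 1)
  have h2 := key (Finsupp.single 1 1)
  rw [hc1F, hc₁', IsLocalization.AtPrime.to_map_mem_maximal_iff S m0] at h1
  rw [hc2F, hc₂', IsLocalization.AtPrime.to_map_mem_maximal_iff S m0] at h2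
  exact ⟨by simpa [mem_originIdeal_iff] using h1, by simpa [mem_originIdeal_iff] using h2⟩

/-! #### Explicit linear parts: `L₁(a) = a_x + a_y·y₁ + a_w·w₁` (PROVED) -/

/-- `θ a` has no monomial whose `x`-exponent is smaller than its `(y,w)`-degree. -/
theorem coeff_θ_eq_zero {E : Fin 3 →₀ ℕ} (hE : E 0 < E 1 + E 2) (a : A) :
    MvPolynomial.coeff E (θ a) = 0 := by
  classical
  induction a using MvPolynomial.induction_on' with
  | monomial u c =>
    rw [θ_monomial, MvPolynomial.coeff_monomial, if_neg]
    intro h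
    have h0 := DFunLike.congr_fun h 0
    have h1 := DFunLike.congr_fun h 1
    have h2 := DFunLike.congr_fun h 2
    rw [ιe_apply_zero] at h0
    rw [ιe_apply_one] at h1
    rw [ιe_apply_two] at h2
    omega
  | add p q hp hq => rw [map_add, MvPolynomial.coeff_add, hp, hq, add_zero]

/-- the three degree-one coefficients of `a` -/
def cα (a : A) : k₀ := MvPolynomial.coeff (Finsupp.single 0 1) a
/-- The `y`-coefficient of `a`. -/
def cβ (a : A) : k₀ := MvPolynomial.coeff (Finsupp.single 1 1) a
/-- The `w`-coefficient of `a`. -/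
def cγ (a : A) : k₀ := MvPolynomial.coeff (Finsupp.single 2 1) a

/-- `(1 : Fin 3) = succ 0`. -/
theorem fin3_one_eq : (1 : Fin 3) = Fin.succ 0 := rfl
/-- `(2 : Fin 3) = succ 1`. -/
theorem fin3_two_eq : (2 : Fin 3) = Fin.succ 1 := rfl

/-- Components of `Finsupp.cons y m` on `Fin 3`. -/
theorem cons_apply3 (y : ℕ) (m : Fin 2 →₀ ℕ) :
    (Finsupp.cons y m) 0 = y ∧ (Finsupp.cons y m) 1 = m 0 ∧ (Finsupp.cons y m) 2 = m 1 := by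
  refine ⟨Finsupp.cons_zero _ _, ?_, ?_⟩
  · rw [fin3_one_eq, Finsupp.cons_succ]
  · rw [fin3_two_eq, Finsupp.cons_succ]

/-- **Explicit linear part**: `L₁(a) = a_x + a_y·y₁ + a_w·w₁`. -/
theorem L1_eq (a : A) : Lj a 1 = MvPolynomial.C (cα a) + MvPolynomial.C (cβ a) * MvPolynomial.X 0 +
    MvPolynomial.C (cγ a) * MvPolynomial.X 1 := by
  classical
  apply MvPolynomial.ext
  intro m
  rw [Lj, MvPolynomial.finSuccEquiv_coeff_coeff]
  simp only [MvPolynomial.coeff_add, MvPolynomial.coeff_C_mul, MvPolynomial.coeff_C,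
    MvPolynomial.coeff_X]
  obtain ⟨hc0, hc1, hc2⟩ := cons_apply3 1 m
  have hm : m = Finsupp.single 0 (m 0) + Finsupp.single 1 (m 1) := by
    ext i; fin_cases i <;> simp
  by_cases hbig : 2 ≤ m 0 + m 1
  · rw [coeff_θ_eq_zero (by rw [hc0, hc1, hc2]; omega)]
    rw [if_neg, if_neg, if_neg]
    · ring
    · intro h; have h0' := DFunLike.congr_fun h 0; have h1' := DFunLike.congr_fun h 1
      simp at h0' h1'; omega
    · intro h; have h0' := DFunLike.congr_fun h 0; have h1' := DFunLike.congr_fun h 1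
      simp at h0' h1'; omega
    · intro h; have h0' := DFunLike.congr_fun h 0; have h1' := DFunLike.congr_fun h 1
      simp at h0' h1'; omega
  · rcases (show (m 0 = 0 ∧ m 1 = 0) ∨ (m 0 = 1 ∧ m 1 = 0) ∨ (m 0 = 0 ∧ m 1 = 1) by omega) with
      ⟨h0, h1⟩ | ⟨h0, h1⟩ | ⟨h0, h1⟩
    · have hm0 : m = 0 := by rw [hm, h0, h1]; simp
      subst hm0
      have hE : Finsupp.cons (1 : ℕ) (0 : Fin 2 →₀ ℕ) = ιe (Finsupp.single 0 1) := by
        ext i; fin_cases i <;> simp [hc0, hc1, hc2, ιe_apply_zero, ιe_apply_one, ιe_apply_two]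
      rw [hE, coeff_θ, if_pos rfl, if_neg, if_neg]
      · simp [cα]
      · intro h; have := DFunLike.congr_fun h 1; simp at this
      · intro h; have := DFunLike.congr_fun h 0; simp at this
    · have hm0 : m = Finsupp.single 0 1 := by rw [hm, h0, h1]; simp
      subst hm0
      have hE : Finsupp.cons (1 : ℕ) (Finsupp.single (0 : Fin 2) 1) = ιe (Finsupp.single 1 1) := by
        ext i; fin_cases i <;> simp [hc0, hc1, hc2, ιe_apply_zero, ιe_apply_one, ιe_apply_two]
      rw [hE, coeff_θ, if_neg, if_pos rfl, if_neg]
      · simp [cβ]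
      · intro h; have := DFunLike.congr_fun h 0; simp at this
      · intro h; have := DFunLike.congr_fun h 0; simp at this
    · have hm0 : m = Finsupp.single 1 1 := by rw [hm, h0, h1]; simp
      subst hm0
      have hE : Finsupp.cons (1 : ℕ) (Finsupp.single (1 : Fin 2) 1) = ιe (Finsupp.single 2 1) := by
        ext i; fin_cases i <;> simp [hc0, hc1, hc2, ιe_apply_zero, ιe_apply_one, ιe_apply_two]
      rw [hE, coeff_θ, if_neg, if_neg, if_pos rfl]
      · simp [cγ]
      · intro h; have := DFunLike.congr_fun h 1; simp at this
      · intro h; have := DFunLike.congr_fun h 1; simp at this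

/-! #### The derivative trick in `A₂ = 𝔽₅[y₁, w₁]` (PROVED): `Λ_v G⁵ = Λ_u H⁵` is impossible -/

/-- In characteristic `5`, partial derivatives kill fifth powers. -/
theorem pderiv_fifth (i : Fin 2) (G : A₂) : MvPolynomial.pderiv i (G ^ 5) = 0 := by
  rw [MvPolynomial.pderiv_pow]
  have : ((5 : ℕ) : A₂) = 0 := CharP.cast_eq_zero A₂ 5
  rw [this, zero_mul, zero_mul]

/-- From `Λ_v G⁵ = Λ_u H⁵` (`G ≠ 0`): `Λ_v ∂ᵢΛ_u = Λ_u ∂ᵢΛ_v` (derivations kill fifth powers). -/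
theorem cross_of_identity {Λu Λv G H : A₂} (hG : G ≠ 0) (hid : Λv * G ^ 5 = Λu * H ^ 5)
    (i : Fin 2) : Λv * MvPolynomial.pderiv i Λu = Λu * MvPolynomial.pderiv i Λv := by
  have hd := congrArg (MvPolynomial.pderiv i) hid
  rw [MvPolynomial.pderiv_mul, MvPolynomial.pderiv_mul, pderiv_fifth, pderiv_fifth, mul_zero,
    mul_zero, add_zero, add_zero] at hd
  have hG5 : G ^ 5 ≠ 0 := pow_ne_zero _ hG
  apply mul_right_cancel₀ hG5
  calc Λv * MvPolynomial.pderiv i Λu * G ^ 5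
      = MvPolynomial.pderiv i Λu * (Λv * G ^ 5) := by ring
    _ = MvPolynomial.pderiv i Λu * (Λu * H ^ 5) := by rw [hid]
    _ = Λu * (MvPolynomial.pderiv i Λu * H ^ 5) := by ring
    _ = Λu * (MvPolynomial.pderiv i Λv * G ^ 5) := by rw [hd]
    _ = Λu * MvPolynomial.pderiv i Λv * G ^ 5 := by ring

/-- Two polynomials of degree `≤ 1` satisfying the cross identities are `𝔽₅`-dependent. -/
theorem relation_of_cross (α β γ α' β' γ' : k₀) (Λu Λv : A₂)
    (hΛu : Λu = MvPolynomial.C α + MvPolynomial.C β * MvPolynomial.X 0 +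
      MvPolynomial.C γ * MvPolynomial.X 1)
    (hΛv : Λv = MvPolynomial.C α' + MvPolynomial.C β' * MvPolynomial.X 0 +
      MvPolynomial.C γ' * MvPolynomial.X 1)
    (hne : Λu ≠ 0)
    (h0 : Λv * MvPolynomial.pderiv 0 Λu = Λu * MvPolynomial.pderiv 0 Λv)
    (h1 : Λv * MvPolynomial.pderiv 1 Λu = Λu * MvPolynomial.pderiv 1 Λv) :
    ∃ c₁ c₂ : k₀, c₂ ≠ 0 ∧ MvPolynomial.C c₁ * Λu + MvPolynomial.C c₂ * Λv = 0 := by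
  have h10 : (1 : Fin 2) ≠ 0 := by decide
  have h01 : (0 : Fin 2) ≠ 1 := by decide
  have d0u : MvPolynomial.pderiv 0 Λu = MvPolynomial.C β := by
    rw [hΛu]; simp [MvPolynomial.pderiv_X_of_ne h10]
  have d1u : MvPolynomial.pderiv 1 Λu = MvPolynomial.C γ := by
    rw [hΛu]; simp [MvPolynomial.pderiv_X_of_ne h01]
  have d0v : MvPolynomial.pderiv 0 Λv = MvPolynomial.C β' := by
    rw [hΛv]; simp [MvPolynomial.pderiv_X_of_ne h10]
  have d1v : MvPolynomial.pderiv 1 Λv = MvPolynomial.C γ' := by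
    rw [hΛv]; simp [MvPolynomial.pderiv_X_of_ne h01]
  rw [d0u, d0v] at h0
  rw [d1u, d1v] at h1
  by_cases hβ : β ≠ 0
  · refine ⟨β', -β, neg_ne_zero.mpr hβ, ?_⟩
    rw [map_neg]
    linear_combination (-1 : A₂) * h0
  by_cases hγ : γ ≠ 0
  · refine ⟨γ', -γ, neg_ne_zero.mpr hγ, ?_⟩
    rw [map_neg]
    linear_combination (-1 : A₂) * h1
  push Not at hβ hγ
  have hΛu' : Λu = MvPolynomial.C α := by rw [hΛu, hβ, hγ]; simp
  have hα : α ≠ 0 := by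
    intro h0'; apply hne; rw [hΛu', h0', map_zero]
  rw [hΛu', hβ, map_zero, mul_zero, ← map_mul] at h0
  rw [hΛu', hγ, map_zero, mul_zero, ← map_mul] at h1
  have hβ' : β' = 0 := by
    have := (MvPolynomial.C_eq_zero).mp h0.symm
    rcases mul_eq_zero.mp this with h | h
    · exact absurd h hα
    · exact h
  have hγ' : γ' = 0 := by
    have := (MvPolynomial.C_eq_zero).mp h1.symm
    rcases mul_eq_zero.mp this with h | h
    · exact absurd h hα
    · exact h
  refine ⟨α', -α, neg_ne_zero.mpr hα, ?_⟩
  rw [hΛu', hΛv, hβ', hγ']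
  simp only [map_zero, zero_mul, add_zero, map_neg]
  ring

/-- If `a/b = s ∉ 𝔪_S²` then `a ∉ 𝔪₀²`. -/
theorem not_mem_m0_sq_of_mk'_eq {a : A} {b : m0.primeCompl} {s : S}
    (hs : IsLocalization.mk' S a b = s) (h2 : s ∉ IsLocalRing.maximalIdeal S ^ 2) : a ∉ m0 ^ 2 := by
  intro ha
  apply h2
  have hmap : Ideal.map (algebraMap A S) m0 = IsLocalRing.maximalIdeal S :=
    IsLocalization.AtPrime.map_eq_maximalIdeal m0 S
  have haS : algebraMap A S a ∈ IsLocalRing.maximalIdeal S ^ 2 := by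
    rw [← hmap, ← Ideal.map_pow]; exact Ideal.mem_map_of_mem _ ha
  rw [← hs]
  have hspec := IsLocalization.mk'_spec S a b
  rw [← hspec] at haS
  exact (Ideal.mul_unit_mem_iff_mem _ (IsLocalization.map_units S b)).mp haS

/-- **(the `A₂`-kernel of T5, PROVED)** for a frame `(u, v, t)`, `u = a_u/b_u`, `v = a_v/b_v`:
there are no `G ≠ 0`, `H ∈ 𝔽₅[y₁, w₁]` with `Λ_v·G⁵ = Λ_u·H⁵`. -/
theorem false_of_fifthPower_identity {u v t : S} (hf : IsFrame u v t) {au av : A}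
    {bu bv : m0.primeCompl} (hu : IsLocalization.mk' S au bu = u)
    (hv : IsLocalization.mk' S av bv = v) {G H : A₂} (hG : G ≠ 0)
    (hid : (Lj av 1 * Lj (bu : A) 0) * G ^ 5 = (Lj au 1 * Lj (bv : A) 0) * H ^ 5) : False := by
  obtain ⟨hum, hvm, -⟩ := mem_maximalIdeal_of_isFrame hf
  obtain ⟨hu2, hv2, -⟩ := not_mem_sq_of_isFrame hf
  have hau : au ∈ m0 := mem_m0_of_mk'_eq hu hum
  have hau2 : au ∉ m0 ^ 2 := not_mem_m0_sq_of_mk'_eq hu hu2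
  have hne : Lj au 1 * Lj (bv : A) 0 ≠ 0 := by
    refine mul_ne_zero (linearPart_ne_zero hau hau2) ?_
    rw [L0_eq, Ne, MvPolynomial.C_eq_zero]
    exact fun h => bv.2 ((mem_originIdeal_iff k₀ 3).mpr h)
  have hΛu : Lj au 1 * Lj (bv : A) 0 =
      MvPolynomial.C (cα au * MvPolynomial.constantCoeff (bv : A)) +
      MvPolynomial.C (cβ au * MvPolynomial.constantCoeff (bv : A)) * MvPolynomial.X 0 +
      MvPolynomial.C (cγ au * MvPolynomial.constantCoeff (bv : A)) * MvPolynomial.X 1 := by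
    rw [L1_eq, L0_eq]; simp only [map_mul]; ring
  have hΛv : Lj av 1 * Lj (bu : A) 0 =
      MvPolynomial.C (cα av * MvPolynomial.constantCoeff (bu : A)) +
      MvPolynomial.C (cβ av * MvPolynomial.constantCoeff (bu : A)) * MvPolynomial.X 0 +
      MvPolynomial.C (cγ av * MvPolynomial.constantCoeff (bu : A)) * MvPolynomial.X 1 := by
    rw [L1_eq, L0_eq]; simp only [map_mul]; ring
  obtain ⟨c₁, c₂, hc₂, hrel⟩ := relation_of_cross _ _ _ _ _ _ _ _ hΛu hΛv hne
    (cross_of_identity hG hid 0) (cross_of_identity hG hid 1)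
  exact hc₂ (linearParts_independent hf hu hv c₁ c₂ hrel).2

/-! #### From `K` down to `A₂` (PROVED): `ν(v/u - D⁵) < 1` yields `Λ_v G⁵ = Λ_u H⁵` -/

/-- A polynomial `d ∈ k'[X]` has value `1` iff `X ∤ d`. -/
theorem vX_algebraMap_eq_one_iff (d : Polynomial kp) :
    vX (algebraMap (Polynomial kp) K d) = 1 ↔ ¬ Polynomial.X ∣ d := by
  rw [← vX_algebraMap_lt_one_iff]
  constructor
  · intro h; rw [h]; exact lt_irrefl _
  · intro h
    exact le_antisymm (IsDedekindDomain.HeightOneSpectrum.valuation_le_one _ _) (not_lt.mp h)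

/-- the normalised denominator of an element of `O` is prime to `X` -/
theorem vX_denom_eq_one {q : K} (hq : vX q ≤ 1) :
    vX (algebraMap (Polynomial kp) K (RatFunc.denom q)) = 1 := by
  have hd0 : RatFunc.denom q ≠ 0 := RatFunc.denom_ne_zero q
  have hD : algebraMap (Polynomial kp) K (RatFunc.denom q) ≠ 0 := fun h =>
    hd0 (RatFunc.algebraMap_injective kp (by rw [h, map_zero]))
  have hqeq := RatFunc.num_div_denom q
  by_contra hne
  have hlt : vX (algebraMap (Polynomial kp) K (RatFunc.denom q)) < 1 :=
    lt_of_le_of_ne (IsDedekindDomain.HeightOneSpectrum.valuation_le_one _ _) hne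
  have hXd : Polynomial.X ∣ RatFunc.denom q := (vX_algebraMap_lt_one_iff _).mp hlt
  have hvn : vX (algebraMap (Polynomial kp) K (RatFunc.num q)) < 1 := by
    have : vX (algebraMap (Polynomial kp) K (RatFunc.num q)) =
        vX q * vX (algebraMap (Polynomial kp) K (RatFunc.denom q)) := by
      rw [← map_mul, (div_eq_iff hD).mp hqeq]
    rw [this]
    exact lt_of_le_of_lt (mul_le_of_le_one_left' hq) hlt
  have hXn : Polynomial.X ∣ RatFunc.num q := (vX_algebraMap_lt_one_iff _).mp hvn
  exact Polynomial.not_isUnit_X ((RatFunc.isCoprime_num_denom q).isUnit_of_dvd' hXn hXd)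

/-- `ψ a` is the image in `K` of `ψ₀ a` (by definition). -/
theorem ψ_eq_algebraMap_ψ₀ (a : A) : ψ a = algebraMap (Polynomial kp) K (ψ₀ a) := rfl

/-- Constant coefficient of `ψ₀ a` = image of `L₀(a)`. -/
theorem coeff_zero_ψ₀ (a : A) : (ψ₀ a).coeff 0 = algebraMap A₂ kp (Lj a 0) := by
  rw [coeff_ψ₀]; rfl

/-- Linear coefficient of `ψ₀ a` = image of `L₁(a)`. -/
theorem coeff_one_ψ₀ (a : A) : (ψ₀ a).coeff 1 = algebraMap A₂ kp (Lj a 1) := by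
  rw [coeff_ψ₀]; rfl

/-- **(T5, PROVED)** `v/u` is not a fifth power modulo `𝔪_ν`: for a frame `(u, v, t)` and
`D ∈ O`, `¬ ν(v/u - D⁵) < 1`.  Proof: clear denominators down to `A₂ = 𝔽₅[y₁, w₁]`
(`Λ_v G⁵ = Λ_u H⁵`) and apply the derivative trick `false_of_fifthPower_identity`. -/
theorem T5 (u v t : S) (hf : IsFrame u v t) (D : K) (hD : vX D ≤ 1) :
    ¬ vX (τq u v - D ^ 5) < 1 := by
  classical
  intro hlt
  obtain ⟨hum, hvm, -⟩ := mem_maximalIdeal_of_isFrame hf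
  obtain ⟨hu2, hv2, -⟩ := not_mem_sq_of_isFrame hf
  obtain ⟨⟨au, bu⟩, hu⟩ := IsLocalization.mk'_surjective m0.primeCompl u
  obtain ⟨⟨av, bv⟩, hv⟩ := IsLocalization.mk'_surjective m0.primeCompl v
  change IsLocalization.mk' S au bu = u at hu
  change IsLocalization.mk' S av bv = v at hv
  have hau : au ∈ m0 := mem_m0_of_mk'_eq hu hum
  have hav : av ∈ m0 := mem_m0_of_mk'_eq hv hvm
  have hau2 : au ∉ m0 ^ 2 := not_mem_m0_sq_of_mk'_eq hu hu2
  -- `ψ₀ a = X · Q_a`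
  obtain ⟨Qu, hQu⟩ : Polynomial.X ∣ ψ₀ au := by
    rw [Polynomial.X_dvd_iff, coeff_zero_ψ₀, L0_eq_zero hau, map_zero]
  obtain ⟨Qv, hQv⟩ : Polynomial.X ∣ ψ₀ av := by
    rw [Polynomial.X_dvd_iff, coeff_zero_ψ₀, L0_eq_zero hav, map_zero]
  have hQu0 : Qu.coeff 0 = algebraMap A₂ kp (Lj au 1) := by
    rw [← coeff_one_ψ₀, hQu, Polynomial.coeff_X_mul]
  have hQv0 : Qv.coeff 0 = algebraMap A₂ kp (Lj av 1) := by
    rw [← coeff_one_ψ₀, hQv, Polynomial.coeff_X_mul]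
  have hLu : Lj au 1 ≠ 0 := linearPart_ne_zero hau hau2
  have hQu_ndvd : ¬ Polynomial.X ∣ Qu := by
    rw [Polynomial.X_dvd_iff, hQu0]
    exact fun h => hLu (IsFractionRing.injective A₂ kp (by rw [h, map_zero]))
  -- names in `K`
  have hιinj : Function.Injective (algebraMap (Polynomial kp) K) := RatFunc.algebraMap_injective kp
  have hX0 : algebraMap (Polynomial kp) K Polynomial.X ≠ 0 :=
    fun h => Polynomial.X_ne_zero (hιinj (by rw [h, map_zero]))
  have hQuK : algebraMap (Polynomial kp) K Qu ≠ 0 := by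
    intro h; apply hQu_ndvd
    rw [hιinj (by rw [h, map_zero] :
      algebraMap (Polynomial kp) K Qu = algebraMap (Polynomial kp) K 0)]
    exact dvd_zero _
  have hbuK : algebraMap (Polynomial kp) K (ψ₀ bu) ≠ 0 := ψ_ne_zero_of_not_mem bu.2
  have hbvK : algebraMap (Polynomial kp) K (ψ₀ bv) ≠ 0 := ψ_ne_zero_of_not_mem bv.2
  -- `τ = (Qv·ψ₀ bu)/(Qu·ψ₀ bv)`
  have hτ : τq u v = algebraMap (Polynomial kp) K Qv * algebraMap (Polynomial kp) K (ψ₀ bu) /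
      (algebraMap (Polynomial kp) K Qu * algebraMap (Polynomial kp) K (ψ₀ bv)) := by
    rw [τq, ← hu, ← hv, algebraMap_mk', algebraMap_mk', ψ_eq_algebraMap_ψ₀, ψ_eq_algebraMap_ψ₀,
      ψ_eq_algebraMap_ψ₀, ψ_eq_algebraMap_ψ₀, hQu, hQv, map_mul, map_mul]
    rw [div_div_div_eq, div_eq_div_iff (mul_ne_zero hbvK (mul_ne_zero hX0 hQuK))
      (mul_ne_zero hQuK hbvK)]
    ring
  set ι := algebraMap (Polynomial kp) K with hι
  set n := RatFunc.num D with hn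
  set d := RatFunc.denom D with hd
  have hd0 : d ≠ 0 := RatFunc.denom_ne_zero D
  have hdK : ι d ≠ 0 := fun h => hd0 (hιinj (by rw [h, map_zero]))
  have hDeq : ι n / ι d = D := RatFunc.num_div_denom D
  have hvd : vX (ι d) = 1 := vX_denom_eq_one hD
  have hd_ndvd : ¬ Polynomial.X ∣ d := (vX_algebraMap_eq_one_iff d).mp hvd
  set Num : Polynomial kp := Qv * ψ₀ bu * d ^ 5 - Qu * ψ₀ bv * n ^ 5 with hNum
  set Den : Polynomial kp := Qu * ψ₀ bv * d ^ 5 with hDen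
  have hDenK : ι Den ≠ 0 := by
    rw [hDen, map_mul, map_mul, map_pow]
    exact mul_ne_zero (mul_ne_zero hQuK hbvK) (pow_ne_zero _ hdK)
  have hE : τq u v - D ^ 5 = ι Num / ι Den := by
    rw [hτ, ← hDeq, hNum, hDen]
    simp only [map_mul, map_sub, map_pow]
    field_simp
  -- `ν(Den) = 1`, hence `X ∣ Num`
  have hvDen : vX (ι Den) = 1 := by
    rw [hDen, map_mul, map_mul, map_pow, map_mul, map_mul, map_pow,
      (vX_algebraMap_eq_one_iff Qu).mpr hQu_ndvd, hvd, one_pow, mul_one, one_mul]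
    exact vX_ψ_eq_one bv.2
  have hvNum : vX (ι Num) < 1 := by
    have : vX (ι Num) = vX (τq u v - D ^ 5) * vX (ι Den) := by
      rw [← map_mul, hE, div_mul_cancel₀ _ hDenK]
    rw [this, hvDen, mul_one]; exact hlt
  have hXNum : Polynomial.X ∣ Num := (vX_algebraMap_lt_one_iff _).mp hvNum
  -- constant coefficients: an identity in `k'`
  have hc : algebraMap A₂ kp (Lj av 1) * algebraMap A₂ kp (Lj (bu : A) 0) * (d.coeff 0) ^ 5 =
      algebraMap A₂ kp (Lj au 1) * algebraMap A₂ kp (Lj (bv : A) 0) * (n.coeff 0) ^ 5 := by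
    have h0 := (Polynomial.X_dvd_iff).mp hXNum
    rw [hNum, Polynomial.coeff_sub, sub_eq_zero] at h0
    have hpow : ∀ (q : Polynomial kp), (q ^ 5).coeff 0 = (q.coeff 0) ^ 5 := fun q => by
      simp only [Polynomial.coeff_zero_eq_eval_zero, Polynomial.eval_pow]
    rw [Polynomial.mul_coeff_zero, Polynomial.mul_coeff_zero, Polynomial.mul_coeff_zero,
      Polynomial.mul_coeff_zero, hpow, hpow, hQu0, hQv0, coeff_zero_ψ₀, coeff_zero_ψ₀] at h0
    exact h0
  -- clear the `A₂`-denominators of `d(0) ≠ 0` and `n(0)`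
  have hd00 : d.coeff 0 ≠ 0 := fun h => hd_ndvd (Polynomial.X_dvd_iff.mpr h)
  obtain ⟨d₁, d₂, hd₂, hdd⟩ := IsFractionRing.div_surjective (A := A₂) (d.coeff 0)
  obtain ⟨n₁, n₂, hn₂, hnn⟩ := IsFractionRing.div_surjective (A := A₂) (n.coeff 0)
  have hd₂' : algebraMap A₂ kp d₂ ≠ 0 :=
    fun h => nonZeroDivisors.ne_zero hd₂ (IsFractionRing.injective A₂ kp (by rw [h, map_zero]))
  have hn₂' : algebraMap A₂ kp n₂ ≠ 0 :=
    fun h => nonZeroDivisors.ne_zero hn₂ (IsFractionRing.injective A₂ kp (by rw [h, map_zero]))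
  have hd₁ : d₁ ≠ 0 := by
    intro h; apply hd00; rw [← hdd, h, map_zero, zero_div]
  rw [← hdd, ← hnn, div_pow, div_pow, mul_div_assoc', mul_div_assoc',
    div_eq_div_iff (pow_ne_zero _ hd₂') (pow_ne_zero _ hn₂')] at hc
  simp only [← map_pow, ← map_mul] at hc
  have hid : (Lj av 1 * Lj (bu : A) 0) * (d₁ * n₂) ^ 5 = (Lj au 1 * Lj (bv : A) 0) * (n₁ * d₂) ^ 5 := by
    have := IsFractionRing.injective A₂ kp hc
    linear_combination this
  exact false_of_fifthPower_identity hf hu hv (mul_ne_zero hd₁ (nonZeroDivisors.ne_zero hn₂)) hid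

/-! (HISTORICAL plan of T5 — now PROVED above as `T5` — the model-specific kernel: `v/u` is NOT a
fifth power modulo `𝔪_ν`; it was the only remaining stub of rev 6.)  For a frame `(u, v, t)` of `S` and any `D ∈ K`:
`¬ (ν(τ - D^5) < 1)`, `τ = v/u`.  (Only `D ∈ O` is ever used — `LI5_of` applies it to a lift of a
residue class — so a prover may add the hypothesis `vX D ≤ 1` and adjust `LI5_of` in one line.)
RESIDUE PICTURE: `τ̄ = Λ_v/Λ_u ∉ k'^5` in `k' = 𝔽₅(y₁, w₁) = Frac A₂`, where for `u = a_u/b_u`,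
`v = a_v/b_v` (`IsLocalization.mk'_surjective`), `Λ_u := L₁(a_u)·L₀(b_v)`, `Λ_v := L₁(a_v)·L₀(b_u) ∈ A₂`,
`L_j(a) := (finSuccEquiv (θ a)).coeff j` = the dehomogenised degree-`j` part (`coeff_ψ₀`:
`(ψ₀ a).coeff j = algebraMap A₂ k' (L_j a)`); `L₀(b) = C (constantCoeff b) ≠ 0` for `b ∉ 𝔪₀` and
`L₁(a) = a_x + a_y·y₁ + a_w·w₁ ≠ 0` for `a ∈ 𝔪₀ ∖ 𝔪₀²` (`linearPart_ne_zero`).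
PLAN (≈ 300 lines; no UFD / irreducibility needed):
(P1) `K → k'`: with `D = n/d` (`RatFunc.num_div_denom`; `ν(D) ≤ 1 ⇒ X ∤ d`, cf. the proof of
  `locAtCentre_eq_O`) and `ψ₀(a) = X·Q_a` for `a ∈ 𝔪₀` (`Polynomial.X_dvd_iff`, `Q_a.coeff 0 = L₁ a`),
  `ν(τ - D^5) < 1` becomes `X ∣ (Q_{a_v} ψ₀(b_u) d^5 - Q_{a_u} ψ₀(b_v) n^5)` (`vX_algebraMap_lt_one_iff`),
  i.e. `Λ_v·d(0)^5 = Λ_u·n(0)^5` in `k'` (`Polynomial.coeff_zero_eq_eval_zero`, `eval_mul/pow/sub`).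
(P2) `k' → A₂`: clear the denominators of `d(0) ≠ 0`, `n(0)` (`IsFractionRing.div_surjective`,
  injectivity of `algebraMap A₂ k'`): `Λ_v·G^5 = Λ_u·H^5` in `A₂ = 𝔽₅[y₁, w₁]` with `G ≠ 0`.
(P3) DERIVATIVE TRICK: apply `MvPolynomial.pderiv i` (`i = 0, 1`); in characteristic `5`,
  `pderiv i (G^5) = 5 • G^4 • pderiv i G = 0` (`Derivation.leibniz_pow`, `CharP`), so
  `(∂ᵢΛ_v)·G^5 = (∂ᵢΛ_u)·H^5`; cross-multiplying with (P2) and cancelling `G^5 ≠ 0`: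
  `Λ_v·∂ᵢΛ_u = Λ_u·∂ᵢΛ_v` for both `i`.
(P4) `Λ_u = α + β y₁ + γ w₁`, `Λ_v = α' + β' y₁ + γ' w₁` explicitly (`finSuccEquiv_coeff_coeff`,
  `ιe_eq_cons`, `coeff_θ`), so (P3) says that all `2 × 2` minors of `[[α,β,γ],[α',β',γ']]` vanish,
  i.e. the two rows are linearly dependent: `c₁Λ_u + c₂Λ_v = 0` with `(c₁, c₂) ≠ 0`.
(P5) But then `s := c₁·L₀(b_v)·b_u·u + c₂·L₀(b_u)·b_v·v`... more simply the numerator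
  `c₁ a_u b_v L₀(b_v)⁻¹… ` — a `k₀`-combination `c₁' u + c₂' v` (`c'` nonzero constants times units of
  `S`) has vanishing linear part, hence lies in `𝔪_S²` (`mem_pow_of_vX_le` after `coeff 1 = 0 ⇒ X² ∣ …`),
  contradicting `coeff_mem_maximalIdeal_of_eval_mem_pow` (`n = 1`, the linear form `c₁'X₀ + c₂'X₁`
  in the rsop `(u, v, t)`: its coefficients would lie in `𝔪_S`, but they are units). -/

/-- **(LI5 from FL + T5, PROVED)** `1, τ̄, …, τ̄⁴` are `k'^5`-independent: pass to the residue field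
`κ(O)` (`IsLocalRing.residue`, characteristic `5` by `charP_κO`), where `τ̄` is not a fifth power by
`T5` (`IsLocalRing.residue_surjective` lifts a fifth root to `O`) and `FL` applies. -/
theorem LI5_of {u v t : S} (hf : IsFrame u v t)
    (hFL : ∀ (a : κO), (∀ e : κO, e ^ 5 ≠ a) → ∀ w : ℕ → κO,
      ∑ r ∈ Finset.range 5, a ^ r * w r ^ 5 = 0 → ∀ r, r < 5 → w r = 0)
    (hT5 : ∀ D : K, vX D ≤ 1 → ¬ vX (τq u v - D ^ 5) < 1)
    (Wf : ℕ → K) (hW : ∀ r, vX (Wf r) ≤ 1)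
    (h : vX (∑ r ∈ Finset.range 5, τq u v ^ r * Wf r ^ 5) < 1) (r : ℕ) (hr : r < 5) :
    vX (Wf r) < 1 := by
  classical
  have hτO : τq u v ∈ O := mem_O_of_vX_le_one (le_of_eq (vX_τq hf))
  set τO : O := ⟨τq u v, hτO⟩ with hτOdef
  set WO : ℕ → O := fun r => ⟨Wf r, mem_O_of_vX_le_one (hW r)⟩ with hWOdef
  have ha : ∀ e : κO, e ^ 5 ≠ IsLocalRing.residue O τO := by
    intro e he
    obtain ⟨d, rfl⟩ := IsLocalRing.residue_surjective e
    apply hT5 (d : K) ((mem_O_iff _).mp d.2)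
    have h0 : IsLocalRing.residue O (τO - d ^ 5) = 0 := by
      rw [map_sub, map_pow, he, sub_self]
    rw [residue_eq_zero_iff_vX_lt_one] at h0
    simpa [hτOdef] using h0
  have hcoe : ((∑ r ∈ Finset.range 5, τO ^ r * WO r ^ 5 : O) : K) =
      ∑ r ∈ Finset.range 5, τq u v ^ r * Wf r ^ 5 := by
    push_cast
    simp [hτOdef, hWOdef]
  have hrel : ∑ r ∈ Finset.range 5,
      IsLocalRing.residue O τO ^ r * IsLocalRing.residue O (WO r) ^ 5 = 0 := by
    have h0 : IsLocalRing.residue O (∑ r ∈ Finset.range 5, τO ^ r * WO r ^ 5) = 0 := by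
      rw [residue_eq_zero_iff_vX_lt_one, hcoe]; exact h
    simpa [map_sum, map_mul, map_pow] using h0
  have hw := hFL _ ha (fun r => IsLocalRing.residue O (WO r)) hrel r hr
  have := (residue_eq_zero_iff_vX_lt_one _).mp hw
  simpa [hWOdef] using this

/-- **(LI5, PROVED from `FL` and `T5`)** for `W₀, …, W₄ ∈ O`:
`ν(Σ_{r<5} τ^r W_r^5) < 1 ⇒ ν(W_r) < 1`. -/
theorem LI5 (u v t : S) (hf : IsFrame u v t) (Wf : ℕ → K) (hW : ∀ r, vX (Wf r) ≤ 1)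
    (h : vX (∑ r ∈ Finset.range 5, τq u v ^ r * Wf r ^ 5) < 1) (r : ℕ) (hr : r < 5) :
    vX (Wf r) < 1 := by
  haveI := charP_κO
  exact LI5_of hf (fun a ha w h r hr => FL κO a ha w h r hr) (T5 u v t hf) Wf hW h r hr

/-- **(transcendence step, PROVED)** an `𝔽₅`-combination of powers of `τ = v/u` of positive
`ν`-value is trivial: multiply by `u^L` to get a binary form in the rsop `(u, v, t)` with constant
coefficients and apply `coeff_mem_maximalIdeal_of_vX_lt_one`. -/
theorem const_coeff_eq_zero_of_vX_lt_one {u v t : S} (hf : IsFrame u v t) (L : ℕ) (c : ℕ → k₀)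
    (h : vX (∑ q ∈ Finset.range L, ψ (MvPolynomial.C (c q)) * τq u v ^ q) < 1)
    (q : ℕ) (hq : q < L) : c q = 0 := by
  classical
  set P : Polynomial S := ∑ j ∈ Finset.range L,
    Polynomial.C (algebraMap A S (MvPolynomial.C (c j))) * Polynomial.X ^ j with hP
  have hPcoeff : ∀ j, P.coeff j = if j ∈ Finset.range L then
      algebraMap A S (MvPolynomial.C (c j)) else 0 := by
    intro j
    rw [hP, Polynomial.finsetSum_coeff]
    simp only [Polynomial.coeff_C_mul_X_pow]
    rw [Finset.sum_ite_eq]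
  have hPeval : Polynomial.eval₂ (algebraMap S K) (τq u v) P =
      ∑ j ∈ Finset.range L, ψ (MvPolynomial.C (c j)) * τq u v ^ j := by
    rw [hP, Polynomial.eval₂_finsetSum]
    refine Finset.sum_congr rfl fun j _ => ?_
    rw [Polynomial.eval₂_mul, Polynomial.eval₂_C, Polynomial.eval₂_X_pow, ← ψ_eq_algebraMap]
  have hval : vX (Polynomial.eval₂ (algebraMap S K)
      (algebraMap S K v / algebraMap S K u) P) < 1 := by
    rw [show algebraMap S K v / algebraMap S K u = τq u v from rfl, hPeval]; exact h
  have hmem := coeff_mem_maximalIdeal_of_vX_lt_one hf P hval q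
  rw [hPcoeff, if_pos (Finset.mem_range.mpr hq),
    IsLocalization.AtPrime.to_map_mem_maximal_iff S m0] at hmem
  simpa [mem_originIdeal_iff] using hmem

/-- **(fifth powers among `𝔽₅`-combinations of powers of `τ`, PROVED from `LI5`)** for a frame
`(u, v, t)` and constants `c₀, …, c_N ∈ 𝔽₅`: if `Σ cᵢ τⁱ` is a fifth power in `K` up to positive
`ν`-value, then `cᵢ = 0` whenever `5 ∤ i`.  Proof: `c^5 = c` in `𝔽₅`, so writing `i = 5q + r`,
`Σ cᵢ τⁱ = Σ_{r<5} τ^r E_r^5` with `E_r = Σ_q κ(c_{5q+r}) τ^q`; `LI5` applied to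
`(E₀ - D, E₁, …, E₄)` gives `ν(E_r) < 1` for `r = i mod 5 ≠ 0`, and the transcendence step
`const_coeff_eq_zero_of_vX_lt_one` gives `c_{5q+r} = 0`. -/
theorem const_fifthPower_of_LI5 {u v t : S} (hf : IsFrame u v t)
    (hLI : ∀ Wf : ℕ → K, (∀ r, vX (Wf r) ≤ 1) →
      vX (∑ r ∈ Finset.range 5, τq u v ^ r * Wf r ^ 5) < 1 → ∀ r, r < 5 → vX (Wf r) < 1)
    (N : ℕ) (c : ℕ → k₀) (D : K)
    (h : vX (∑ i ∈ Finset.range (N + 1), ψ (MvPolynomial.C (c i)) * τq u v ^ i - D ^ 5) < 1)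
    (i : ℕ) (hiN : i < N + 1) (hi : ¬ 5 ∣ i) : c i = 0 := by
  classical
  haveI := charP_K
  haveI : ExpChar K 5 := ExpChar.prime (by norm_num)
  -- truncate `c` beyond `N`
  let c' : ℕ → k₀ := fun j => if j < N + 1 then c j else 0
  let κ : ℕ → K := fun j => ψ (MvPolynomial.C (c' j))
  have hκ5 : ∀ j, κ j ^ 5 = κ j := by
    intro j
    show ψ (MvPolynomial.C (c' j)) ^ 5 = ψ (MvPolynomial.C (c' j))
    rw [← map_pow, ← map_pow, ZMod.pow_card]
  have hκC : ∀ j, κ j ∈ Cq u v := by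
    intro j
    show ψ (MvPolynomial.C (c' j)) ∈ Cq u v
    rw [ψ_eq_algebraMap]; exact algebraMap_mem_Cq u v _
  let E : ℕ → K := fun r => ∑ q ∈ Finset.range (N + 1), κ (5 * q + r) * τq u v ^ q
  have hEC : ∀ r, E r ∈ Cq u v := fun r =>
    Subring.sum_mem _ fun q _ => Subring.mul_mem _ (hκC _) (Subring.pow_mem _ (τq_mem_Cq u v) _)
  -- Step 1: the hypothesis sum equals `Σ_{r<5} τ^r (E r)^5`
  have hsumC : ∑ j ∈ Finset.range (N + 1), ψ (MvPolynomial.C (c j)) * τq u v ^ j ∈ Cq u v := by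
    refine Subring.sum_mem _ fun j _ => Subring.mul_mem _ ?_ (Subring.pow_mem _ (τq_mem_Cq u v) _)
    rw [ψ_eq_algebraMap]; exact algebraMap_mem_Cq u v _
  have hsum : ∑ j ∈ Finset.range (N + 1), ψ (MvPolynomial.C (c j)) * τq u v ^ j =
      ∑ r ∈ Finset.range 5, τq u v ^ r * E r ^ 5 := by
    have h1 : ∑ j ∈ Finset.range (N + 1), ψ (MvPolynomial.C (c j)) * τq u v ^ j =
        ∑ j ∈ Finset.range (5 * (N + 1)), κ j * τq u v ^ j := by
      rw [show 5 * (N + 1) = (N + 1) + 4 * (N + 1) by ring,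
        Finset.sum_range_add _ (N + 1) (4 * (N + 1))]
      rw [Finset.sum_eq_zero (s := Finset.range (4 * (N + 1))) (fun x _ => by
        show ψ (MvPolynomial.C (c' (N + 1 + x))) * τq u v ^ (N + 1 + x) = 0
        simp only [c', if_neg (show ¬ (N + 1 + x < N + 1) by omega), map_zero, zero_mul]), add_zero]
      refine Finset.sum_congr rfl fun j hj => ?_
      show _ = ψ (MvPolynomial.C (c' j)) * τq u v ^ j
      simp only [c', if_pos (Finset.mem_range.mp hj)]
    rw [h1, sum_range_five_mul]
    refine Finset.sum_congr rfl fun r _ => ?_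
    show _ = τq u v ^ r * (∑ q ∈ Finset.range (N + 1), κ (5 * q + r) * τq u v ^ q) ^ 5
    rw [sum_pow_char 5, Finset.mul_sum]
    refine Finset.sum_congr rfl fun q _ => ?_
    rw [mul_pow, hκ5]; ring
  -- Step 2: the family `W = (E 0 - D, E 1, …, E 4)`
  let Wf : ℕ → K := fun r => if r = 0 then E 0 - D else E r
  have hWsum : ∑ r ∈ Finset.range 5, τq u v ^ r * Wf r ^ 5 =
      (∑ r ∈ Finset.range 5, τq u v ^ r * E r ^ 5) - D ^ 5 := by
    simp only [Finset.sum_range_succ, Finset.sum_range_zero, Wf]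
    simp only [if_true, show (1:ℕ) ≠ 0 from one_ne_zero, show (2:ℕ) ≠ 0 from two_ne_zero,
      show (3:ℕ) ≠ 0 from by norm_num, show (4:ℕ) ≠ 0 from by norm_num, if_false]
    rw [sub_pow_expChar (E 0) D]
    ring
  -- Step 3: values `≤ 1`
  have hE1 : ∀ r, vX (E r) ≤ 1 := fun r => vX_le_one_of_mem_Cq hf (hEC r)
  have hD : vX D ≤ 1 := by
    have hD5 : vX (D ^ 5) ≤ 1 := by
      have := Valuation.map_sub_le vX (vX_le_one_of_mem_Cq hf hsumC) (le_of_lt h)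
      rwa [sub_sub_cancel] at this
    by_contra hlt
    rw [not_le] at hlt
    have := one_lt_pow₀ hlt (n := 5) (by norm_num)
    rw [← map_pow] at this
    exact absurd hD5 (not_le.mpr this)
  have hW : ∀ r, vX (Wf r) ≤ 1 := by
    intro r
    by_cases hr : r = 0
    · simp only [Wf, hr, if_true]
      exact Valuation.map_sub_le vX (hE1 0) hD
    · simp only [Wf, if_neg hr]; exact hE1 r
  -- Step 4: apply LI5
  have hlt : vX (∑ r ∈ Finset.range 5, τq u v ^ r * Wf r ^ 5) < 1 := by
    rw [hWsum, ← hsum]; exact h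
  have hr0 : i % 5 ≠ 0 := fun h0 => hi (Nat.dvd_of_mod_eq_zero h0)
  have hEr : vX (E (i % 5)) < 1 := by
    have := hLI Wf hW hlt (i % 5) (Nat.mod_lt _ (by norm_num))
    simpa only [Wf, if_neg hr0] using this
  -- Step 5: transcendence step
  have hq : i / 5 < N + 1 := lt_of_le_of_lt (Nat.div_le_self i 5) hiN
  have hc' : c' (5 * (i / 5) + i % 5) = 0 :=
    const_coeff_eq_zero_of_vX_lt_one hf (N + 1) (fun q => c' (5 * q + i % 5)) hEr (i / 5) hq
  rw [Nat.div_add_mod] at hc'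
  simpa only [c', if_pos hiN] using hc'

/-- The rev-5 constants statement, now a consequence of `LI5`. -/
theorem const_fifthPower (u v t : S) (hf : IsFrame u v t) (N : ℕ) (c : ℕ → k₀) (D : K)
    (h : vX (∑ i ∈ Finset.range (N + 1), ψ (MvPolynomial.C (c i)) * τq u v ^ i - D ^ 5) < 1)
    (i : ℕ) (hiN : i < N + 1) (hi : ¬ 5 ∣ i) : c i = 0 :=
  const_fifthPower_of_LI5 hf (LI5 u v t hf) N c D h i hiN hi

/-- **(coefficient statement from the constant one, PROVED)** if `P(v/u)` (`P ∈ S[T]`) is a fifth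
power up to positive value then the coefficients of `P` in degrees `∤ 5` lie in `𝔪_S`: split every
coefficient as residue constant plus an element of `𝔪_S` (`exists_sub_C_mem_maximalIdeal`); the
`𝔪_S`-part of `P(τ)` has positive value (`vX_eval₂_lt_one_of_coeff_mem`), so the constant part is a
fifth power up to positive value and `const_fifthPower` kills its coefficients in degrees `∤ 5`. -/
theorem fifthPower_coeff_of {u v t : S} (hf : IsFrame u v t)
    (hconst : ∀ (N : ℕ) (c : ℕ → k₀) (D : K),
      vX (∑ i ∈ Finset.range (N + 1), ψ (MvPolynomial.C (c i)) * τq u v ^ i - D ^ 5) < 1 →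
        ∀ i, i < N + 1 → ¬ 5 ∣ i → c i = 0)
    (P : Polynomial S) (D : K)
    (h : vX (Polynomial.eval₂ (algebraMap S K) (τq u v) P - D ^ 5) < 1) (i : ℕ) (hi : ¬ 5 ∣ i) :
    P.coeff i ∈ IsLocalRing.maximalIdeal S := by
  classical
  choose cst hcst using exists_sub_C_mem_maximalIdeal
  set N := P.natDegree with hN
  by_cases hiN : i < N + 1
  swap
  · rw [Polynomial.coeff_eq_zero_of_natDegree_lt (by omega)]; exact Ideal.zero_mem _
  -- the constant part `Pc` and the `𝔪_S`-part `P - Pc`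
  set Pc : Polynomial S := ∑ j ∈ Finset.range (N + 1),
    Polynomial.C (algebraMap A S (MvPolynomial.C (cst (P.coeff j)))) * Polynomial.X ^ j with hPc
  have hPccoeff : ∀ j, Pc.coeff j = if j ∈ Finset.range (N + 1) then
      algebraMap A S (MvPolynomial.C (cst (P.coeff j))) else 0 := by
    intro j
    rw [hPc, Polynomial.finsetSum_coeff]
    simp only [Polynomial.coeff_C_mul_X_pow]
    rw [Finset.sum_ite_eq]
  have hM : ∀ j, (P - Pc).coeff j ∈ IsLocalRing.maximalIdeal S := by
    intro j
    rw [Polynomial.coeff_sub, hPccoeff]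
    split_ifs with hj
    · exact hcst _
    · rw [Polynomial.coeff_eq_zero_of_natDegree_lt (by simpa [Finset.mem_range, hN] using hj),
        sub_zero]
      exact Ideal.zero_mem _
  have hMval := vX_eval₂_lt_one_of_coeff_mem hf hM
  have hPc_eval : Polynomial.eval₂ (algebraMap S K) (τq u v) Pc =
      ∑ j ∈ Finset.range (N + 1), ψ (MvPolynomial.C (cst (P.coeff j))) * τq u v ^ j := by
    rw [hPc, Polynomial.eval₂_finsetSum]
    refine Finset.sum_congr rfl fun j _ => ?_
    rw [Polynomial.eval₂_mul, Polynomial.eval₂_C, Polynomial.eval₂_X_pow, ← ψ_eq_algebraMap]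
  have hc : vX (∑ j ∈ Finset.range (N + 1), ψ (MvPolynomial.C (cst (P.coeff j))) * τq u v ^ j -
      D ^ 5) < 1 := by
    have heq : ∑ j ∈ Finset.range (N + 1), ψ (MvPolynomial.C (cst (P.coeff j))) * τq u v ^ j - D ^ 5 =
        (Polynomial.eval₂ (algebraMap S K) (τq u v) P - D ^ 5) -
          Polynomial.eval₂ (algebraMap S K) (τq u v) (P - Pc) := by
      rw [Polynomial.eval₂_sub, hPc_eval]; ring
    rw [heq]
    exact Valuation.map_sub_lt _ h hMval
  have hci : cst (P.coeff i) = 0 := hconst N (fun j => cst (P.coeff j)) D hc i hiN hi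
  have := hcst (P.coeff i)
  rwa [hci, map_zero, map_zero, sub_zero] at this

/-- The rev-4 coefficient statement, a consequence of `const_fifthPower`. -/
theorem fifthPower_coeff (u v t : S) (hf : IsFrame u v t) (P : Polynomial S) (D : K)
    (h : vX (Polynomial.eval₂ (algebraMap S K) (τq u v) P - D ^ 5) < 1) (i : ℕ) (hi : ¬ 5 ∣ i) :
    P.coeff i ∈ IsLocalRing.maximalIdeal S :=
  fifthPower_coeff_of hf (const_fifthPower u v t hf) P D h i hi

/-- **(sharp UnitRes from the coefficient statement, PROVED)** a unit `g = y/z` of `B♯` which is a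
fifth power modulo `𝔪_ν` has a fifth root modulo `𝔪_ν` IN `B♯`: write `y z⁴ = P(τ)`; by the
coefficient statement the coefficients `pᵢ`, `5 ∤ i`, lie in `𝔪_S`; replacing each `p_{5j}` by its
residue constant `c_{5j} ∈ 𝔽₅` (`exists_sub_C_mem_maximalIdeal`) and using Frobenius
(`c^5 = c` in `𝔽₅`, `E(τ)^5 = E^{(5)}(τ^5)` in characteristic `5`), `e := E(τ)/z` with
`E = Σ c_{5j} T^j` satisfies `ν(g - e⁵) < 1`. -/
theorem unitRes_sharp_of {u v t : S} (hf : IsFrame u v t)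
    (hstub : ∀ (P : Polynomial S) (D : K),
      vX (Polynomial.eval₂ (algebraMap S K) (τq u v) P - D ^ 5) < 1 →
        ∀ i, ¬ 5 ∣ i → P.coeff i ∈ IsLocalRing.maximalIdeal S) :
    UnitRes (sharpRing u v) := by
  classical
  rintro g hg - ⟨D, hD⟩
  obtain ⟨y, hy, z, hz, hvz, rfl⟩ := (mem_locAtCentre_iff (B := Cq u v) (O := O)).mp hg
  have hvz' : vX z = 1 := isEquiv_O.eq_one_iff_eq_one.mpr hvz
  have hz0 : z ≠ 0 := by intro h; rw [h, map_zero] at hvz; exact zero_ne_one hvz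
  obtain ⟨P, hP⟩ := exists_polynomial_of_mem_closure
    (Subring.mul_mem _ hy (Subring.pow_mem _ hz 4) : y * z ^ 4 ∈ Cq u v)
  have hD' : vX (Polynomial.eval₂ (algebraMap S K) (τq u v) P - (D * z) ^ 5) < 1 := by
    have heq : Polynomial.eval₂ (algebraMap S K) (τq u v) P - (D * z) ^ 5 =
        z ^ 5 * (y / z - D ^ 5) := by
      rw [hP]; field_simp
    rw [heq, map_mul, map_pow, hvz', one_pow, one_mul]
    exact isEquiv_O.lt_one_iff_lt_one.mpr hD
  have hcoef := hstub P (D * z) hD'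
  choose cst hcst using exists_sub_C_mem_maximalIdeal
  set N := P.natDegree with hN
  set E : Polynomial S := ∑ j ∈ Finset.range (N / 5 + 1),
    Polynomial.C (algebraMap A S (MvPolynomial.C (cst (P.coeff (5 * j))))) * Polynomial.X ^ j
    with hE
  have hEcoeff : ∀ j, E.coeff j = if j ∈ Finset.range (N / 5 + 1) then
      algebraMap A S (MvPolynomial.C (cst (P.coeff (5 * j)))) else 0 := by
    intro j
    rw [hE, Polynomial.finsetSum_coeff]
    simp only [Polynomial.coeff_C_mul_X_pow]
    rw [Finset.sum_ite_eq]
  haveI := charP_S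
  haveI : ExpChar S 5 := ExpChar.prime (by norm_num)
  have hE5coeff : ∀ i, (E ^ 5).coeff i = if 5 ∣ i then (E.coeff (i / 5)) ^ 5 else 0 := by
    intro i
    rw [← Polynomial.map_frobenius_expand (p := 5) (f := E), Polynomial.coeff_map,
      Polynomial.coeff_expand (by norm_num), frobenius_def]
    split_ifs <;> simp
  have hM : ∀ i, (P - E ^ 5).coeff i ∈ IsLocalRing.maximalIdeal S := by
    intro i
    rw [Polynomial.coeff_sub, hE5coeff]
    by_cases h5 : 5 ∣ i
    · rw [if_pos h5, hEcoeff]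
      obtain ⟨k, rfl⟩ := h5
      rw [Nat.mul_div_cancel_left k (by norm_num : 0 < 5)]
      by_cases hk : k < N / 5 + 1
      · rw [if_pos (Finset.mem_range.mpr hk), ← map_pow, ← map_pow, ZMod.pow_card]
        exact hcst _
      · rw [if_neg (fun h => hk (Finset.mem_range.mp h)), zero_pow (by norm_num), sub_zero,
          Polynomial.coeff_eq_zero_of_natDegree_lt (by omega)]
        exact Ideal.zero_mem _
    · rw [if_neg h5, sub_zero]
      exact hcoef i h5
  have hval : vX (y * z ^ 4 - (Polynomial.eval₂ (algebraMap S K) (τq u v) E) ^ 5) < 1 := by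
    have h := vX_eval₂_lt_one_of_coeff_mem hf hM
    rwa [Polynomial.eval₂_sub, Polynomial.eval₂_pow, hP] at h
  refine ⟨Polynomial.eval₂ (algebraMap S K) (τq u v) E / z, ?_, ?_⟩
  · exact (mem_locAtCentre_iff (B := Cq u v) (O := O)).mpr ⟨_, eval₂_mem_Cq u v E, z, hz, hvz, rfl⟩
  · have heq : y / z - (Polynomial.eval₂ (algebraMap S K) (τq u v) E / z) ^ 5 =
        (y * z ^ 4 - (Polynomial.eval₂ (algebraMap S K) (τq u v) E) ^ 5) / z ^ 5 := by
      field_simp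
    apply isEquiv_O.lt_one_iff_lt_one.mp
    rw [heq, map_div₀, map_pow, hvz', one_pow, div_one]
    exact hval

/-- **(sharp UnitRes, proved)** fifth roots of unit residues exist in `B♯(u,v)`. -/
theorem unitRes_sharp (u v t : S) (hf : IsFrame u v t) : UnitRes (sharpRing u v) :=
  unitRes_sharp_of hf (fifthPower_coeff u v t hf)

/-! ### Proved reductions: `StepClosed` from the prime classification via the chart lemmas -/

/-- The algebra of the curve chart once the chart element `u₀ = a u + b v` has `a` a unit:
`S[U/u₀]_{centre} = B♯(u₀, v)` with the frame `(u₀, v, t)`. -/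
theorem curveChart_core (u v t : S) (hf : IsFrame u v t) {U : Finset baseRing} {u₀ : baseRing}
    (hspan : Ideal.span (↑U : Set baseRing) = Ideal.span {toBase u, toBase v}) (hu₀ne : u₀ ≠ 0)
    {a b : baseRing} (hab : a * toBase u + b * toBase v = u₀) (ha : IsUnit a) :
    ∃ u' v' t' : S, IsFrame u' v' t' ∧
      locAtCentre (Subring.closure ((baseRing : Set K) ∪ (fun x : baseRing => (x : K) / u₀) '' ↑U)) O =
        sharpRing u' v' := by
  obtain ⟨a', rfl⟩ := toBase_surjective a
  obtain ⟨b', rfl⟩ := toBase_surjective b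
  obtain ⟨s₀, rfl⟩ := toBase_surjective u₀
  obtain ⟨c, hc⟩ := ha.exists_right_inv
  obtain ⟨c', rfl⟩ := toBase_surjective c
  have hac : a' * c' = 1 := toBase_injective (by rw [map_mul, map_one]; exact hc)
  have hs₀ : s₀ = a' * u + b' * v := toBase_injective (by rw [map_add, map_mul, map_mul]; exact hab.symm)
  have hu : u = c' * (s₀ - b' * v) := by rw [hs₀]; linear_combination (-u) * hac
  have hu₀K : (algebraMap S K s₀) ≠ 0 := fun h => hu₀ne (Subtype.ext h)
  refine ⟨s₀, v, t, ?_, ?_⟩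
  · -- `(s₀, v, t)` is a frame
    unfold IsFrame at hf ⊢
    rw [← hf]
    apply le_antisymm <;> refine Ideal.span_le.mpr ?_ <;> intro z hz <;>
      simp only [Set.mem_insert_iff, Set.mem_singleton_iff] at hz
    · rcases hz with rfl | rfl | rfl
      · rw [hs₀]
        exact Ideal.add_mem _ (Ideal.mul_mem_left _ _ (Ideal.subset_span (by simp)))
          (Ideal.mul_mem_left _ _ (Ideal.subset_span (by simp)))
      · exact Ideal.subset_span (by simp)
      · exact Ideal.subset_span (by simp)
    · rcases hz with rfl | rfl | rfl
      · rw [hu]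
        exact Ideal.mul_mem_left _ _ (Ideal.sub_mem _ (Ideal.subset_span (by simp))
          (Ideal.mul_mem_left _ _ (Ideal.subset_span (by simp))))
      · exact Ideal.subset_span (by simp)
      · exact Ideal.subset_span (by simp)
  · -- the two chart algebras coincide
    unfold sharpRing
    congr 1
    simp only [coe_toBase]
    apply le_antisymm
    · refine Subring.closure_le.mpr ?_
      rintro z (hz | ⟨x, hx, rfl⟩)
      · exact Subring.subset_closure (Or.inl hz)
      · have hxspan : x ∈ Ideal.span {toBase u, toBase v} := hspan ▸ Ideal.subset_span hx
        obtain ⟨c₁, d₁, hcd⟩ := Ideal.mem_span_pair.mp hxspan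
        have hxK := congrArg (fun z : baseRing => (z : K)) hcd
        simp only [Subring.coe_add, Subring.coe_mul, coe_toBase] at hxK
        have hacK : algebraMap S K a' * algebraMap S K c' = 1 := by rw [← map_mul, hac, map_one]
        have hs₀K : algebraMap S K s₀ = algebraMap S K a' * algebraMap S K u +
            algebraMap S K b' * algebraMap S K v := by rw [hs₀, map_add, map_mul, map_mul]
        have e : (x : K) / algebraMap S K s₀ = (c₁ : K) * algebraMap S K c' +
            ((d₁ : K) - (c₁ : K) * algebraMap S K c' * algebraMap S K b') *
              (algebraMap S K v / algebraMap S K s₀) := by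
          rw [div_eq_iff hu₀K, ← hxK]
          field_simp
          rw [hs₀K]
          linear_combination (-(c₁ : K) * algebraMap S K u) * hacK
        change (x : K) / algebraMap S K s₀ ∈ _
        rw [e]
        have hB : ∀ s : S, algebraMap S K s ∈
            Subring.closure ((baseRing : Set K) ∪ {algebraMap S K v / algebraMap S K s₀}) :=
          fun s => Subring.subset_closure (Or.inl (toBase s).2)
        have hc₁ : (c₁ : K) ∈ Subring.closure ((baseRing : Set K) ∪ {algebraMap S K v / algebraMap S K s₀}) :=
          Subring.subset_closure (Or.inl c₁.2)
        have hd₁ : (d₁ : K) ∈ Subring.closure ((baseRing : Set K) ∪ {algebraMap S K v / algebraMap S K s₀}) :=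
          Subring.subset_closure (Or.inl d₁.2)
        exact add_mem (mul_mem hc₁ (hB c')) (mul_mem (sub_mem hd₁ (mul_mem (mul_mem hc₁ (hB c')) (hB b')))
          (Subring.subset_closure (Or.inr rfl)))
    · refine Subring.closure_le.mpr ?_
      rintro z (hz | rfl)
      · exact Subring.subset_closure (Or.inl hz)
      · have hv : toBase v ∈ Ideal.span (↑U : Set baseRing) := by
          rw [hspan]; exact Ideal.subset_span (by simp)
        have h := div_mem_closure_of_mem_span (u₀ := toBase s₀) hv
        rw [coe_toBase, coe_toBase] at h
        exact h

/-- Curve chart: blowing up `S` along a regular curve `(u, v)` lands on a `B♯`. -/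
theorem curveChart (hpv : ParamVal baseRing) (hB : IsRegularLocalRing baseRing) (u v t : S)
    (hf : IsFrame u v t)
    (huv : ∀ [IsLocalRing baseRing], toBase u ∉ IsLocalRing.maximalIdeal baseRing ^ 2 ∧
      toBase v ∉ IsLocalRing.maximalIdeal baseRing ^ 2)
    {P : Ideal baseRing} (hP : P = Ideal.span {toBase u, toBase v}) {B' : Subring K}
    (hbl : IsLocalBlowupAlong O baseRing P B') : ∃ u' v' t' : S, IsFrame u' v' t' ∧ B' = sharpRing u' v' := by
  classical
  haveI := hB
  subst hP
  obtain ⟨hum, hvm, -⟩ := mem_maximalIdeal_of_isFrame hf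
  have hle : baseRing ≤ O.toSubring := hbl.1
  -- the frame elements have the value of `X`
  have hvu : O.valuation (algebraMap S K u) = O.valuation (RatFunc.X : K) :=
    hpv (toBase u) (mem_maximalIdeal_of_valuation_lt_one hle _ (dominates u hum)) huv.1
  have hvv : O.valuation (algebraMap S K v) = O.valuation (RatFunc.X : K) :=
    hpv (toBase v) (mem_maximalIdeal_of_valuation_lt_one hle _ (dominates v hvm)) huv.2
  obtain ⟨-, U, u₀, hspan, hu₀, hu₀ne, hval, rfl⟩ := hbl
  obtain ⟨a, b, hab⟩ := Ideal.mem_span_pair.mp (hspan ▸ Ideal.subset_span hu₀ :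
    u₀ ∈ Ideal.span {toBase u, toBase v})
  -- the chart element has the value of `X`
  have hvu₀ : O.valuation (u₀ : K) = O.valuation (RatFunc.X : K) := by
    apply le_antisymm
    · have h := valuation_le_of_mem_span hle (u := {toBase u, toBase v}) (u₀ := toBase u)
        (by
          intro x hx
          simp only [Finset.mem_insert, Finset.mem_singleton] at hx
          rcases hx with rfl | rfl
          · exact le_rfl
          · rw [coe_toBase, coe_toBase, hvu, hvv])
        (m := u₀) (by rw [Finset.coe_pair, ← hspan]; exact Ideal.subset_span hu₀)
      rwa [coe_toBase, hvu] at h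
    · have h := valuation_le_of_mem_span hle hval (m := toBase u)
        (by rw [hspan]; exact Ideal.subset_span (by simp))
      rwa [coe_toBase, hvu] at h
  -- hence `a` or `b` is a unit
  have key : IsUnit a ∨ IsUnit b := by
    by_contra hcon
    push Not at hcon
    have ha := (not_isUnit_locAtCentre_iff range_le_O a).mp hcon.1
    have hb := (not_isUnit_locAtCentre_iff range_le_O b).mp hcon.2
    have hXu : vX (algebraMap S K u) = WithZero.exp (-1 : ℤ) := by
      rw [← vX_X]; exact isEquiv_O.eq_iff.mpr hvu
    have hXv : vX (algebraMap S K v) = WithZero.exp (-1 : ℤ) := by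
      rw [← vX_X]; exact isEquiv_O.eq_iff.mpr hvv
    have hau : vX ((a : K) * algebraMap S K u) ≤ WithZero.exp (-2 : ℤ) := by
      rw [map_mul, show (-2 : ℤ) = -1 + -1 by norm_num, WithZero.exp_add, hXu]
      exact mul_le_mul' (vX_X ▸ vX_le_vX_X_of_lt_one (isEquiv_O.lt_one_iff_lt_one.mpr ha)) le_rfl
    have hbv : vX ((b : K) * algebraMap S K v) ≤ WithZero.exp (-2 : ℤ) := by
      rw [map_mul, show (-2 : ℤ) = -1 + -1 by norm_num, WithZero.exp_add, hXv]
      exact mul_le_mul' (vX_X ▸ vX_le_vX_X_of_lt_one (isEquiv_O.lt_one_iff_lt_one.mpr hb)) le_rfl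
    have habK := congrArg (fun z : baseRing => (z : K)) hab
    simp only [Subring.coe_add, Subring.coe_mul, coe_toBase] at habK
    have hsum : vX (u₀ : K) ≤ WithZero.exp (-2 : ℤ) := by
      rw [← habK]
      exact (Valuation.map_add _ _ _).trans (max_le hau hbv)
    have hu₀v : vX (u₀ : K) = WithZero.exp (-1 : ℤ) := by
      rw [← vX_X]; exact isEquiv_O.eq_iff.mpr hvu₀
    rw [hu₀v, WithZero.exp_le_exp] at hsum
    omega
  rcases key with ha | hb
  · exact curveChart_core u v t hf hspan hu₀ne hab ha
  · have hspan' : Ideal.span (↑U : Set baseRing) = Ideal.span {toBase v, toBase u} := by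
      rw [hspan, Set.pair_comm]
    have hab' : b * toBase v + a * toBase u = u₀ := by rw [← hab, add_comm]
    exact curveChart_core v u t (isFrame_comm hf) hspan' hu₀ne hab' hb

/-- `StepClosed S` from the regular-prime classification and `ParamVal S` via the chart lemmas. -/
theorem stepClosed_base_of (hprimes : RegularPrimesBase) (hpv : ParamVal baseRing) :
    StepClosed baseRing := by
  intro B' P hB hB' hBP hbl
  rcases hprimes P hB hBP with ⟨π, hπ⟩ | ⟨u, v, t, hf, huv, hP⟩ | hpt
  · exact Or.inl (eq_of_isLocalBlowupAlong_span_singleton π hπ (locAtCentre_locAtCentre _ _) hbl)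
  · exact Or.inr (Or.inr (curveChart hpv hB u v t hf huv hP hbl))
  · exact Or.inr (Or.inl (eq_O_of_point range_le_O hBP le_rfl hpt hbl))

/-- `StepClosed B♯(u,v)` from its regular-prime classification via the chart lemmas. -/
theorem stepClosed_sharp_of (u v t : S) (hf : IsFrame u v t) (hprimes : RegularPrimesSharp u v) :
    StepClosed (sharpRing u v) := by
  intro B' P hB hB' hBP hbl
  rcases hprimes P hbl.1 hB hBP with ⟨π, hπ⟩ | hpt
  · exact Or.inr (Or.inr ⟨u, v, t, hf,
      eq_of_isLocalBlowupAlong_span_singleton π hπ (locAtCentre_locAtCentre _ _) hbl⟩)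
  · have h0 : Subring.closure ((baseRing : Set K) ∪ {algebraMap S K v / algebraMap S K u}) ≤
        O.toSubring := (le_locAtCentre _ _).trans hbl.1
    exact Or.inr (Or.inl (eq_O_of_point h0 hBP (baseRing_le_sharpRing u v) hpt hbl))

/-- `RingFacts S` from the base facts (all proved). -/
theorem ringFacts_base (hprimes : RegularPrimesBase) (hpv : ParamVal baseRing) : RingFacts baseRing :=
  ⟨stepClosed_base_of hprimes hpv, hpv, unitRes_base⟩

/-- `RingFacts B♯` from the three sharp facts (all proved). -/
theorem ringFacts_sharp (u v t : S) (hf : IsFrame u v t) (hprimes : RegularPrimesSharp u v)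
    (hpv : ParamVal (sharpRing u v)) (hur : UnitRes (sharpRing u v)) : RingFacts (sharpRing u v) :=
  ⟨stepClosed_sharp_of u v t hf hprimes, hpv, hur⟩


/-! ### (top) — proved: `RingFacts O` (`O = k'[X]_{(X)}` is a DVR) -/

/-- Localising `O` at its own centre changes nothing. -/
theorem locAtCentre_top : locAtCentre O.toSubring O = O.toSubring :=
  le_antisymm (locAtCentre_le le_rfl) (le_locAtCentre _ _)

/-- Non-units of `O` have value `< 1` (for whichever local-ring instance is around). -/
theorem valuation_lt_one_of_mem_maximalIdeal_top [IsLocalRing O.toSubring] (z : O.toSubring)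
    (hz : z ∈ IsLocalRing.maximalIdeal O.toSubring) : O.valuation (z : K) < 1 := by
  rcases O.valuation_lt_one_or_eq_one ⟨(z : K), z.2⟩ with h | h
  · exact h
  · exfalso
    change O.valuation (z : K) = 1 at h
    have hz0 : (z : K) ≠ 0 := ne_zero_of_valuation_eq_one h
    have hinv : (z : K)⁻¹ ∈ O.toSubring := by
      change (z : K)⁻¹ ∈ O
      rw [← O.valuation_le_one_iff, map_inv₀, h, inv_one]
    rw [IsLocalRing.mem_maximalIdeal, mem_nonunits_iff] at hz
    exact hz ⟨⟨z, ⟨(z : K)⁻¹, hinv⟩, Subtype.ext (mul_inv_cancel₀ hz0),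
      Subtype.ext (inv_mul_cancel₀ hz0)⟩, rfl⟩

/-- (top, StepClosed): a local blowing up of `O` along any nonzero ideal is `O` itself. -/
theorem stepClosed_top : StepClosed O.toSubring := by
  intro B' P _ _ _ hbl
  obtain ⟨-, u, u₀, -, -, hu₀ne, hval, hB'⟩ := hbl
  right; left
  have hu₀K : ((u₀ : K)) ≠ 0 := fun h => hu₀ne (Subtype.ext h)
  have hcl : Subring.closure ((O.toSubring : Set K) ∪ (fun x : O.toSubring => (x : K) / u₀) '' ↑u) =
      O.toSubring := by
    refine le_antisymm (Subring.closure_le.mpr ?_) (fun x hx => Subring.subset_closure (Or.inl hx))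
    rintro x (hx | ⟨y, hy, rfl⟩)
    · exact hx
    · change (y : K) / u₀ ∈ O
      have h0 : 0 < O.valuation (u₀ : K) := by
        rw [zero_lt_iff, Ne, map_eq_zero]
        exact hu₀K
      rw [← O.valuation_le_one_iff, map_div₀, div_le_one₀ h0]
      exact hval y hy
  rw [hB', hcl, locAtCentre_top]

/-- (top, ParamVal): a regular parameter of the DVR `O` has value `ν(X)`. -/
theorem paramVal_top : ParamVal O.toSubring := by
  intro _ z hz hz2
  have h1 : O.valuation (z : K) < 1 := valuation_lt_one_of_mem_maximalIdeal_top z hz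
  have hz0 : (z : K) ≠ 0 := by
    intro h0
    apply hz2
    rw [show z = 0 from Subtype.ext h0]
    exact Ideal.zero_mem _
  have h2 : ¬ vX (z : K) ≤ WithZero.exp (-2 : ℤ) := by
    intro hle
    apply hz2
    have hXm : (⟨RatFunc.X, X_mem_O⟩ : O.toSubring) ∈ IsLocalRing.maximalIdeal O.toSubring :=
      mem_maximalIdeal_of_valuation_lt_one le_rfl _ (isEquiv_O.lt_one_iff_lt_one.mp vX_X_lt_one)
    have hq : (z : K) / RatFunc.X ^ 2 ∈ O.toSubring := by
      change (z : K) / RatFunc.X ^ 2 ∈ O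
      have hpos : (0 : WithZero (Multiplicative ℤ)) < WithZero.exp (-2 : ℤ) := by
        rw [zero_lt_iff]; exact WithZero.exp_ne_zero
      rw [mem_O_iff, map_div₀, map_pow, vX_X, ← WithZero.exp_nsmul,
        show (2 • (-1 : ℤ)) = -2 by norm_num, div_le_one₀ hpos]
      exact hle
    have hzeq : z = ⟨RatFunc.X, X_mem_O⟩ * ⟨RatFunc.X, X_mem_O⟩ * ⟨(z : K) / RatFunc.X ^ 2, hq⟩ := by
      apply Subtype.ext
      change (z : K) = RatFunc.X * RatFunc.X * ((z : K) / RatFunc.X ^ 2)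
      have hX : (RatFunc.X : K) ≠ 0 := RatFunc.X_ne_zero
      field_simp
    rw [hzeq, pow_two]
    exact Ideal.mul_mem_right _ _ (Ideal.mul_mem_mul hXm hXm)
  have hv0 : vX (z : K) ≠ 0 := by rwa [Ne, map_eq_zero]
  have h1' : vX (z : K) < 1 := isEquiv_O.lt_one_iff_lt_one.mpr h1
  apply isEquiv_O.eq_iff.mp
  rw [vX_X, ← WithZero.exp_log hv0, WithZero.exp_inj]
  rw [← WithZero.exp_log hv0] at h1' h2
  rw [← WithZero.exp_zero, WithZero.exp_lt_exp] at h1'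
  rw [WithZero.exp_le_exp, not_le] at h2
  omega

/-- (top, UnitRes): tautological for `O` — the fifth root `D` already lies in `O`. -/
theorem unitRes_top : UnitRes O.toSubring := by
  rintro g - hv ⟨D, hD⟩
  refine ⟨D, ?_, hD⟩
  change D ∈ O
  rw [← O.valuation_le_one_iff]
  have h5 : O.valuation (D ^ 5) = 1 := by
    have hlt : O.valuation (-(g - D ^ 5)) < O.valuation g := by rw [Valuation.map_neg, hv]; exact hD
    rw [show D ^ 5 = g + -(g - D ^ 5) by ring, Valuation.map_add_eq_of_lt_left _ hlt, hv]
  by_contra hlt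
  rw [not_le] at hlt
  have : (1 : O.ValueGroup) < O.valuation (D ^ 5) := by
    rw [map_pow]; exact one_lt_pow₀ hlt (by norm_num)
  rw [h5] at this
  exact lt_irrefl _ this

/-- (top) — NO LONGER A STUB. -/
theorem topRing : RingFacts O.toSubring := ⟨stepClosed_top, paramVal_top, unitRes_top⟩

/-! ## Proved glue -/

/-- `TowerRing B ⇒ RingFacts B`, by cases over the three ring types. -/
theorem ringFacts_of_towerRing (hb : RingFacts baseRing)
    (hs : ∀ u v t : S, IsFrame u v t → RingFacts (sharpRing u v)) (ht : RingFacts O.toSubring)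
    {B : Subring K} (hB : TowerRing B) : RingFacts B := by
  rcases hB with rfl | rfl | ⟨u, v, t, huvt, rfl⟩
  · exact hb
  · exact ht
  · exact hs u v t huvt

/-- The affine `K⁵`-line bookkeeping along a tower: `g r = C⁵·f + D⁵` with `C ≠ 0`. -/
theorem line_of_tower (fK : K) {r : ℕ} {g : ℕ → K} (h0 : g 0 = fK)
    (hstep : ∀ i < r, ∃ c d : K, c ≠ 0 ∧ g (i + 1) = c ^ 5 * g i + d ^ 5) :
    ∃ C D : K, C ≠ 0 ∧ g r = C ^ 5 * fK + D ^ 5 := by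
  haveI := charP_K
  induction r with
  | zero => exact ⟨1, 0, one_ne_zero, by simp [h0]⟩
  | succ n ih =>
    obtain ⟨C, D, hC, hn⟩ := ih (fun i hi => hstep i (Nat.lt_succ_of_lt hi))
    obtain ⟨c, d, hc, hs⟩ := hstep n (Nat.lt_succ_self n)
    refine ⟨c * C, c * D + d, mul_ne_zero hc hC, ?_⟩
    rw [hs, hn, add_pow_char (c * D) d]
    ring

/-- Subrings of `K` have characteristic `5`. -/
theorem charP_subring (B : Subring K) : CharP B 5 := by
  haveI := charP_K
  exact CharP.subring K 5 B

/-- Every ring of an `F-110` tower over `(S, O)` is a `TowerRing`. -/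
theorem towerRing_of_tower (hfacts : ∀ B, TowerRing B → RingFacts B)
    {r : ℕ} {B : ℕ → Subring K} {g : ℕ → K} (hB0 : B 0 = baseRing)
    (hall : ∀ i ≤ r, B i ≤ O.toSubring ∧ IsRegularLocalRing (B i) ∧ g i ∈ B i)
    (hstep : ∀ i < r, ∃ P : Ideal (B i), IsRegularLocalRing ((B i) ⧸ P) ∧
        IsLocalBlowupAlong O (B i) P (B (i + 1)) ∧
        ∃ c d : K, c ≠ 0 ∧ g (i + 1) = c ^ 5 * g i + d ^ 5) :
    ∀ i ≤ r, TowerRing (B i) := by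
  intro i
  induction i with
  | zero => intro _; exact Or.inl hB0
  | succ n ih =>
    intro hn
    have hlt : n < r := Nat.lt_of_succ_le hn
    have hTn : TowerRing (B n) := ih hlt.le
    obtain ⟨P, hP, hblow, -⟩ := hstep n hlt
    exact (hfacts _ hTn).1 (B (n + 1)) P (hall n hlt.le).2.1 (hall (n + 1) hn).2.1 hP hblow

/-! ## The composition -/

/-- **`F-110` is false** — kernel-checked composition (`W`, `L`, `AStmt`, the three `RingFacts`). -/
theorem f110False_of (hW : W) (hL : L) (hA : AStmt) (hb : RingFacts baseRing)
    (hs : ∀ u v t : S, IsFrame u v t → RingFacts (sharpRing u v)) (ht : RingFacts O.toSubring) :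
    F110False := by
  intro hF
  haveI : IsFractionRing S K := hW
  haveI := isRegularLocalRing_S
  obtain ⟨r, B, g, hB0, hg0, hall, hstep, hend⟩ :=
    hF 5 Nat.prime_five S isExcellentRing_S ringKrullDim_S charP_S K f hL.1 O range_le_O dominates
  -- every ring of the tower is one of the three
  have hT : TowerRing (B r) :=
    towerRing_of_tower (fun B hB => ringFacts_of_towerRing hb hs ht hB) hB0 hall hstep r le_rfl
  obtain ⟨-, hPV, hUR⟩ := ringFacts_of_towerRing hb hs ht hT
  -- the endpoint
  obtain ⟨hBO, hreg, hg⟩ := hall r le_rfl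
  haveI := hreg
  haveI := charP_subring (B r)
  have hEnd := hend hg
  -- the radicand lies on the affine line
  obtain ⟨C, D, hC, hline⟩ := line_of_tower (algebraMap S K f) hg0
    (fun i hi => by obtain ⟨P, -, -, c, d, hc, h⟩ := hstep i hi; exact ⟨c, d, hc, h⟩)
  have hle : O.valuation (g r) ≤ 1 := (O.valuation_le_one_iff _).mpr (hBO hg)
  rcases hle.lt_or_eq with hlt | heq
  · -- `g r ∈ 𝔪_B`: it would be a regular parameter of value 1 on the line
    have hmem : (⟨g r, hg⟩ : B r) - 0 ^ 5 ∈ IsLocalRing.maximalIdeal (B r) := by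
      apply mem_maximalIdeal_of_valuation_lt_one hBO
      simpa using hlt
    have hnot := hA (B r) ⟨g r, hg⟩ 0 hmem hEnd
    have hval := hPV (⟨g r, hg⟩ - 0 ^ 5) hmem hnot
    have hval' : O.valuation (g r) = O.valuation (RatFunc.X : K) := by simpa using hval
    exact (hL.2 C D hC).1 (by rw [← hline]; exact hval')
  · -- `g r` a unit: translate by a fifth power `e⁵`, `e ∈ B`, to land in `𝔪_B`
    have hpos : O.valuation (C ^ 5 * algebraMap S K f) < 1 := (hL.2 C D hC).2 (by rw [← hline]; exact heq)
    have hD : ∃ D' : K, O.valuation (g r - D' ^ 5) < 1 :=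
      ⟨D, by rw [hline]; simpa using hpos⟩
    obtain ⟨e, he, hlt⟩ := hUR (g r) hg heq hD
    have hmem : (⟨g r, hg⟩ : B r) - ⟨e, he⟩ ^ 5 ∈ IsLocalRing.maximalIdeal (B r) := by
      apply mem_maximalIdeal_of_valuation_lt_one hBO
      simpa using hlt
    have hnot := hA (B r) ⟨g r, hg⟩ ⟨e, he⟩ hmem hEnd
    have hval := hPV (⟨g r, hg⟩ - ⟨e, he⟩ ^ 5) hmem hnot
    have hval' : O.valuation (g r - e ^ 5) = O.valuation (RatFunc.X : K) := by simpa using hval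
    haveI := charP_K
    have hline' : g r - e ^ 5 = C ^ 5 * algebraMap S K f + (D - e) ^ 5 := by
      rw [hline, sub_pow_char D e]; ring
    exact (hL.2 C (D - e) hC).1 (by rw [← hline']; exact hval')

/-- The same statement against the Literature declaration itself (the shape of the owed
`theorem CossartPiltant2019_thm_1_5_i_frame_false`). -/
theorem not_cp2019_frame_of (hW : W) (hL : L) (hA : AStmt) (hb : RingFacts baseRing)
    (hs : ∀ u v t : S, IsFrame u v t → RingFacts (sharpRing u v)) (ht : RingFacts O.toSubring) :
    ¬ CossartPiltant2019_thm_1_5_i_frame.{0} :=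
  f110False_of hW hL hA hb hs ht

/-- End product of the line (rev 7: SORRY-FREE). -/
theorem f110False : F110False :=
  f110False_of witness_W lineValues adjoinRoot_of_kummerCriterion
    (ringFacts_base regularPrimes_base paramVal_base)
    (fun u v t hf => ringFacts_sharp u v t hf (regularPrimes_sharp u v t hf)
      (paramVal_sharp u v t hf) (unitRes_sharp u v t hf)) topRing


/-- **¬F-110, sorry-free, unconditional** (no excellence / Abhyankar / F-112 hypothesis): the
typed frame statement `CossartPiltant2019_thm_1_5_i_frame` (F-110) is FALSE at universe `0`.
Witness: `S = 𝔽₅[x,y,w]_{(x,y,w)}`, `f = x²y`, `ν = ord_𝔪` (see the module docstring).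
This is the shape of the owed tree theorem; it refutes an INPUT of the Descent route, it proves
nothing about resolution of singularities in characteristic `p`. -/
theorem CossartPiltant2019_thm_1_5_i_frame_false : ¬ CossartPiltant2019_thm_1_5_i_frame.{0} :=
  f110False

#print axioms CossartPiltant2019_thm_1_5_i_frame_false

/-! Axiom census: `#print axioms CossartPiltant2019_thm_1_5_i_frame_false` above prints
`[propext, Classical.choice, Quot.sound]` (farm run 2026-08-28T23:00Z; a `collectAxioms` `#eval`
guard confirming it was removed because crux workfiles may not use `#eval`). -/

end Summit.ResolutionOfSingularities.ResolutionOfSingularities.Cruxes.DescentPerfectToAll.NotF110OrdM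

end
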